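/-
Copyright: cell `langlands-arthur-audit` (papers/Langlands/langlands-arthur-audit), unit `pub-arthur-down-g41`
(downstream tracer, gen 41).  Thirteenth file of the exact-support certificates of the downstream register (module M225 of the cell's MODULE-MAP — CLAIMed in
`lean/MODULE-MAP2.md` 2026-08-23T00:52:27Z): `DownstreamSupport.lean` … `DownstreamSupport11.lean` are full or CLOSED and `DownstreamSupport12.lean` (sections
99–107, module M218, 78 % of the proposal cap after v9) is CLOSED for sections; the supports of the register from tranche 105 on (`Downstream31.lean` v3 ff.) start
here, APPEND-ONLY in the same conventions and the same namespace `…Arthur2013.Downstream.Support`; this file imports `…DownstreamSupport12` (through it every earlier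
support file and the canonical readings `canon`, `canon₂`, `canon₆`, `canon₈` / `canon₈no`, `canon₃₄`, `canon₆₇`, `canon₈₉W`, the tops `νtop` / `μtop` / `κtop`,
the import-denied `κnoMok` with `κnoMok_facts`, `bookInputs_top` / `mokInputs_top` / `kmswInputs_top`, `not_B_cm` / `not_M_cm`, `scope_of_onlyFull`, the denied reading
`c₂noIINH` of section 93, the countermodel lemmas) and `…Downstream31`; v1 = section 108, the supports of the hundred-and-fifth tranche (`Downstream31.lean` v3, this unit:
THE PERIOD-FORMULA VEIN — NEW rows C265 P. D. Nelson, Invent. Math. 232 (2023) = arXiv:2012.02187 — `NelsonBranching` (Theorem 1) premise-free, `NelsonSubconvex` (Corollary 2)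
⇐ it ∧ row C26 `Consumers2.BPCZii` —, C266 X. Dimitrakopoulou, IMRN 2026 = arXiv:2312.05841 — `DimitrakopoulouPadicL` ⇐ C26 —, C267 S. Hua – X. Miao arXiv:2508.15964 —
`HMdecorrelation` ⇐ row C41 `Consumers67.FMBessel` ∧ row C226 `Consumers89.FMrefined` —, C268 Z. Wei, J. Théor. Nombres Bordeaux 34 (2022/23) = arXiv:2110.06254 —
`WeiNonvanishing` ⇐ C41 —, C269 M. Tsuzuki arXiv:2001.02859 — `TsuzukiNonvanishing` ⇐ C41 — and C270 M.-L. Hsieh – S. Yamana, Trans. AMS 377 (2024) = arXiv:1810.03231 —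
hypothesis nodes `HYjl`, `HYboch`, `HYtheta` (Theorem 1.2) ⇐ the book by name ∧ the two nodes —; `canon₁₀₅W`, `canon₁₀₅`, `canon_implications₁₀₅W`, `canon_implications₁₀₅`,
`c105_all_of`, `hundredfifth_holds_top`, `c105_book_cm`, the denied readings `c₆₇noFM` / `c₈₉noR`, `c105_rows_denied_top`, `c105_nodes_denied_top`, `c105_mok_cm`, `c105_kmsw`,
`c105_regraded`); v2 (same unit) = section 109 APPENDED, the supports of the hundred-and-sixth tranche (`Downstream31.lean` v4, this unit: THE BÖCHERER-FORMULA APPLIERS,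
second batch — NEW rows C271 S. Kuga – M. Tsuzuki arXiv:2410.03166 — `KTequidist` (Theorem 1.2) ⇐ the book by name, `KTnonvanishing` (Corollary 1.3) ⇐ it ∧ row C41
`Consumers67.FMBessel` ∧ row C226 `Consumers89.FMrefined` — and C272 F. Comtat – J. Marzec-Ballesteros – A. Saha, J. London Math. Soc. 111 (2025) = arXiv:2307.07376 —
`CMSfourier` (Theorem 1.1) ⇐ row C44 `Consumers21.PaulSaha` ∧ row C226, `CMSsupnorm` (Corollary 1.2 / Theorem 1.3 under GRH) ⇐ it —; `canon₁₀₆W`, `canon₁₀₆`,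
`canon_implications₁₀₆W`, `canon_implications₁₀₆`, `c106_all_of`, `hundredsixth_holds_top`, `c106_book_cm`, the denied reading `c₂₁noPS`, `c106_rows_denied_top`,
`c106_mok_cm`, `c106_kmsw`, `c106_regraded`); v3 (unit `pub-arthur-down-g42`, gen 42) = section 110 APPENDED, the supports of the hundred-and-seventh tranche (NEW
`Downstream32.lean` v1, module M227 — hence the new import `…Downstream32`: a NEW node `FMggpEquiv` on row C226 (Furusawa – Morimoto, Compositio Math. 160 (2024),
Corollary 1.1 ⇐ the row's Theorem 1.2 = `Consumers89.FMrefined`) and a NEW node `KTrationality` on row C271 (Kuga – Tsuzuki arXiv:2410.03166 v2, Corollary 1.4 ⇐ the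
book by name ∧ `FMggpEquiv`); `canon₁₀₇W`, `canon₁₀₇`, `canon_implications₁₀₇W`, `canon_implications₁₀₇`, `c107_all_of`, `hundredseventh_holds_top`, `c107_book_cm`,
`c107_rows_denied_top`, `c107_mok_cm`, `c107_kmsw`, `c107_regraded`); v4 (same unit) = section 111 APPENDED, the supports of the hundred-and-eighth tranche
(`Downstream32.lean` v2: THE MOK-2014 CONDUIT VEIN — NEW rows C273 Hida – Tilouine JIMJ 19 (2020) (`HTunitaryU4`, `HTstandardGSp4` ⇐ row C191 `Consumers28.MokGSp4`;
`HTsymTower` ⇐ row C177 `Consumers18.ClozelThorne2`), C274 Jones LMS JCM 19 (2016) (`JonesQzeta12` ⇐ C191), C275 Tsaltas – Jarvis JNT 199 (2019) (node `TJlgc` ⇐ C191,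
`TJdescent` ⇐ it), C276 H. Wang arXiv:1910.07569 (`HWangLevelLowering` ⇐ C191), C277 Broshi – Mullath – Sorensen – Weston arXiv:2009.06575 (`BMSWunobstructed` ⇐ C191);
`canon₁₀₈W`, `canon₁₀₈`, `canon_implications₁₀₈W`, `canon_implications₁₀₈`, `c108_all_of`, `hundredeighth_holds_top`, `c108_book_cm`, the denied reading `c₁₈noCT2`,
`c108_rows_denied_top`, `c108_mok_cm`, `c108_kmsw`, `c108_regraded`; no new import); v5 (same unit) = section 112 APPENDED, the supports of the hundred-and-ninth
tranche (`Downstream32.lean` v3: THE SYMMETRIC-POWER VEIN, I — NEW rows C278 Gillman – Kural – Pascadi – Peng – Sah, Res. Number Theory 6 (2020) (`GKPPSsatoTateGaps` ⇐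
rows C177 `Consumers18.ClozelThorne2` ∧ C29 `Consumers64.ClozelThorneIII`), C279 Lemke Oliver – Thorner IMRN 2019 (`LOTeffectiveST8` ⇐ C29), C280 Januszewski
Amer. J. Math. 146 (2024) (`JanuszewskiSymPadicL` ⇐ C177 ∧ C29), C281 X. Zhang Amer. J. Math. 143 (2021) (node `ZhangSymLayers` ⇐ C177 ∧ C29, `ZhangSelmerTower` ⇐ it);
`canon₁₀₉W`, `canon₁₀₉`, `canon_implications₁₀₉W`, `canon_implications₁₀₉`, `c109_all_of`, `hundredninth_holds_top`, `c109_book_cm`, `c109_book_open_leaves`,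
`c109_book_published_leaves`, the denied reading `c₆₄noCT3`, `c109_rows_denied_top`, `c109_mok_cm`, `c109_kmsw`, `c109_regraded`; no new import); v6 (unit
`pub-arthur-down-g43`, gen 43) = section 113 APPENDED, the supports of the hundred-and-tenth tranche (`Downstream32.lean` v4: THE NOETHER–LEFSCHETZ / BALL-QUOTIENT
VEIN, II — NEW rows C282 Stover – Toledo, Pure Appl. Math. Q. 18 (2022) (node `STcupProduct` ⇐ row C17-Acta `Consumers4.BMMball`; `STcentralRF`, `STbranchedCovers` ⇐ it),
C283 Llosa Isenrich – Py, J. Topol. 18 (2025) (`LIPexoticKernels` ⇐ C282), C284 Petersen, Amer. J. Math. 141 (2019) (`PetersenVanishing` ⇐ row C99 `Consumers2.BLMM`),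
C285 Laza – O'Grady, Compositio Math. 155 (2019) (`LOGpicardRank` ⇐ C99); `canon₁₁₀W`, `canon₁₁₀`, `canon_implications₁₁₀W`, `canon_implications₁₁₀`, `c110_all_of`,
`hundredtenth_holds_top`, `c110_book_cm`, the denied readings `c₄noBMMball` / `c₂noBLMM`, `c110_rows_denied_top`, `c110_mok_cm`, `c110_kmsw`, `c110_regraded`;
no new import); v7 (same unit) = section 114 APPENDED, the supports of the hundred-and-eleventh tranche (`Downstream33.lean` v1, the thirty-third register file:
THE NOETHER–LEFSCHETZ VEIN, III — NEW rows C286 Bergeron – Li, Duke Math. J. 168 (2019) with its Erratum, Duke Math. J. 171 (2022) (node `BLspecialCycles` ⇐ row C99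
`Consumers2.BLMM` ∧ row C17-IMRN `Consumers4.BMMorth`; `BLfranchetta` ⇐ it; `BLtautological` ⇐ C99 ∧ it), C287 Li – Zhang, Forum Math. Sigma 10 (2022) (`LZdeligneBeilinson`
⇐ C286), C288 Di Lorenzo – Fringuelli – Vistoli, Bull. LMS 56 (2024) (`DFVintegralPicard` ⇐ C99), C289 Bruinier – Zuffetti, Proc. LMS 133 (2026) (node `BZheegnerSpan` ⇐ C99;
`BZprimitiveLift` ⇐ C99), C290 Barros – Beri – Flapan – Williams, Math. Ann. 394 (2026) (`BBFWnlCone`, `BBFWuniruled` ⇐ C99 ∧ C289's node), C291 Huang – Li – Müller – Ye,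
arXiv:2411.12931 (`HLMYpicardOne` ⇐ C99; `HLMYbailyBorel` ⇐ it ∧ C288); `canon₁₁₁W`, `canon₁₁₁`, `canon_implications₁₁₁W`, `canon_implications₁₁₁`, `c111_all_of`,
`hundredeleventh_holds_top`, `c111_book_cm`, the denied reading `c₄noBMMorth`, `c111_rows_denied_top`, `c111_mok_cm`, `c111_kmsw`, `c111_regraded`; ONE new import,
`…Downstream33`; the corrected tautological theorem of C286 is cited to BOTH the Duke Erratum (notice) and the AFST *Complement* (6) 32 (2023) (proof, Thm 3.1)).
-/
import HarnessLib
import Literature.NumberTheory.Automorphic.Arthur2013.DownstreamSupport12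
import Literature.NumberTheory.Automorphic.Arthur2013.Downstream31
import Literature.NumberTheory.Automorphic.Arthur2013.Downstream32
import Literature.NumberTheory.Automorphic.Arthur2013.Downstream33

/-!
# Downstream of Arthur (2013): exact leaf support of the downstream register, thirteenth file (sections ≥ 108)

**Source reproduced.**  Nothing beyond what `Downstream.lean` … `Downstream31.lean` transcribe (the downstream
authors' own sentences, cited there chunk by chunk) and what the three leaf-support modules certify
(`Arthur2013/LeafSupport.lean`, `Mok2015/LeafSupport.lean`, `KMSW2014/LeafSupport.lean`: for every leaf a
kernel-checked countermodel of the DAG as typed).  As in the first twelve files: a CANONICAL READING assigns to each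
typed downstream statement the conjunction of DAG outputs its edge receives, the tranche's edges are shown to hold in
that reading for arbitrary node assignments, and the countermodels then give the [read: only if] half of each support —
which leaves are load-bearing for which downstream theorem, in the register AS TYPED (a statement about the cell's
transcription, not about the mathematics).  [cite: Arthur2013, §1.5 with AGIKMS2024 l.380-382 (the conditional
reading whose supports are certified)]

**v1 (section 108; unit `pub-arthur-down-g41`, gen 41).**  The hundred-and-fifth tranche (`Downstream31.lean` v3) types THE PERIOD-FORMULA VEIN: second-order consumers of the
typed Ichino – Ikeda / Böcherer formulas — row C26 (Beuzart-Plessis – Chaudouard – Zydor, ⇐ Mok ∧ KMSW's proved scope), row C41 (Furusawa – Morimoto 2021, ⇐ the book), row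
C226's Theorem 1.2 (Furusawa – Morimoto 2024, ⇐ Mok ∧ C67 ∧ C24) — found by all-years forward citations of those rows: texts that apply the formulas as theorems and never name
the classification (GAPS G-DN-442 / G-DN-443).  Certified with ONE reading `canon₁₀₅W ν c₂ c₆₇ c₈₉ j k` parametrised by the assignments of tranches 2 / 67 / 89 and by the
truth values `j`, `k` of C270's two hypothesis nodes (C265's Theorem 1 := True; its Corollary 2 := True ∧ `c₂.BPCZii`; C266 := `c₂.BPCZii`; C267 := `c₆₇.FMBessel` ∧
`c₈₉.FMrefined`; C268, C269 := `c₆₇.FMBessel`; C270's Theorem 1.2 := book ∧ `j` ∧ `k`), whose edges hold for every ν and every such assignment (`canon_implications₁₀₅W`), and its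
canonical instance `canon₁₀₅ ν μ κ` over `canon₂`, section 70's `canon₆₇` and section 92's `canon₈₉W` (over `canon`, `canon₈no`, `canon₃₄`) with both nodes granted
(`canon_implications₁₀₅`): at the top all seven typed statements hold (`hundredfifth_holds_top`, through the tranche's `hundredfifth_of_inputs` fed by `canon_implications₂`,
`canon_implications₆₇`, `canon_implications₈₉W`, `canon_implications₃₄`); in each of the 24 book countermodels (tranches 1 / 2 / 67 / 105 read canonically over it, ALL their
edges valid) the three Böcherer consumers C267 – C269 and C270's Theorem 1.2 FAIL while C265's two statements and C266 HOLD (`c105_book_cm`: every book leaf is load-bearing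
through C41 and by name; the book is NOT in the support of the C26 consumers, whose premise reads Mok ∧ KMSW-scope); with one premise denied at the top (`c105_rows_denied_top`,
over section 93's `c₂noIINH` and the readings `c₆₇noFM`, `c₈₉noR` defined here): C26 denied ⇒ C265's Corollary 2 and C266 FAIL, C265's Theorem 1 and the rest HOLD; C41 denied ⇒
C267, C268, C269 FAIL, the rest HOLD; C226's Theorem 1.2 denied ⇒ only C267 FAILS; with a node of C270 denied (`c105_nodes_denied_top`) only its Theorem 1.2 FAILS (the nodes
(JL), (Böch) have no supplier in the register: [read: Arthur's project will establish this hypothesis]; Furusawa – Morimoto supply (Böch) for the trivial character only); in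
every Mok countermodel (`c105_mok_cm`) and with KMSW's Mok import denied (`c105_kmsw` I) C265's Corollary 2, C266 and C267 FAIL while C265's Theorem 1, C268, C269, C270 HOLD;
in KMSW's countermodel of each only-full leaf (the unwritten sequels, `AubertSS`) the proved scope holds and the three unitary-supported statements HOLD (`c105_kmsw` II: the
sequels are not in the support); in every KMSW leaf countermodel the book-side rows hold (III).  In one statement (`c105_regraded`): support(`NelsonBranching`) = ∅;
support(`NelsonSubconvex`) = support(`DimitrakopoulouPadicL`) = Mok 29 ∪ KMSW's Mok import (through C26; NO book leaf — the first arithmetic-analytic rows of the register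
since D15 whose open leaves are Mok's alone); support(`WeiNonvanishing`) = support(`TsuzukiNonvanishing`) = book 24 (through C41); support(`HMdecorrelation`) = book 24 ∪
Mok 29 ∪ KMSW's import (through C41 and C226); support(`HYtheta`) = book 24 ∪ {(JL), (Böch)} — a 2023 Inventiones subconvex bound and a 2026 IMRN p-adic L-function inherit
exactly Mok's open leaves (the 2024–2026 preprint layer, Mok's general and non-standard weighted fundamental lemmas) and KMSW's general weighted fundamental lemma; two
non-vanishing corollaries for spinor L-values (JTNB 2023, a 2020 preprint) inherit exactly the book's open leaves; a 2025 decorrelation theorem inherits both; a 2024 TAMS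
p-adic L-function inherits the book's open leaves behind its own two printed hypotheses.

**What this module certifies (v2 = section 109, hundred-and-sixth tranche).**  The PARAMETRISED canonical reading `canon₁₀₆W ν c₂₁ c₆₇ c₈₉` (C271's Theorem 1.2 := the
book at all ranks; C271's Corollary 1.3 := book ∧ `c₆₇.FMBessel` ∧ `c₈₉.FMrefined`; C272's Theorem 1.1 := `c₂₁.PaulSaha` ∧ `c₈₉.FMrefined`; C272's Corollary 1.2 / Theorem 1.3 := the
same conjunction), whose edges hold for every ν and every such assignment (`canon_implications₁₀₆W`), and its canonical instance `canon₁₀₆ ν μ κ` over section 25's `canon₂₁` (C44 :=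
book ∧ C180 ∧ C182, each of these := book), section 70's `canon₆₇` and section 92's `canon₈₉W` (over `canon`, `canon₈no`, `canon₃₄`) (`canon_implications₁₀₆`): at the top all four
typed statements hold (`hundredsixth_holds_top`, through the tranche's `hundredsixth_of_inputs` fed by `canon_implications₂₁` / `canon_implications₂₀` / `canon_implications₁₉`,
`canon_implications₆₇`, `canon_implications₈₉W`, `canon_implications₃₄`); in each of the 24 book countermodels (tranches 1 / 19 / 20 / 21 / 67 / 106 read canonically over it,
ALL their edges valid) ALL FOUR statements FAIL (`c106_book_cm`: every book leaf is load-bearing — by name for C271's Theorem 1.2, [read: The existence of transfer to GL_4 due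
to Arthur]; by name and through C41 for its Corollary 1.3; through C44, [read: see, e.g., Proposition 2.3.1 of [ps22]], for C272 — while C226's Theorem 1.2, read through Mok,
holds there); with one premise denied at the top (`c106_rows_denied_top`, over the reading `c₂₁noPS` defined here and section 108's `c₆₇noFM`, `c₈₉noR`): C44 denied ⇒ C272's
two statements FAIL, C271's two HOLD; C41 denied ⇒ only C271's Corollary 1.3 FAILS; C226's Theorem 1.2 denied ⇒ C271's Corollary 1.3 and C272's two statements FAIL, C271's
Theorem 1.2 HOLDS; in every Mok countermodel (`c106_mok_cm`) and with KMSW's Mok import denied (`c106_kmsw` I) C271's Corollary 1.3 and C272's two statements FAIL while C271's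
Theorem 1.2 (and row C44 itself) HOLD; in KMSW's countermodel of each only-full leaf (the unwritten sequels, `AubertSS`) the proved scope holds and the three C226-supported
statements HOLD (`c106_kmsw` II: the sequels are not in the support); in every KMSW leaf countermodel C271's Theorem 1.2 holds (III).  In one statement (`c106_regraded`):
support(`KTequidist`) = book 24 (by name); support(`KTnonvanishing`) = support(`CMSfourier`) = support(`CMSsupnorm`) = book 24 ∪ Mok 29 ∪ KMSW's Mok import (C271: by name,
through C41 and through C226; C272: through C44 and through C226) — a 2024/2025 preprint's weighted equidistribution theorem over the type-(G) newforms inherits exactly the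
book's open leaves (the 2024–2026 preprint layer, the general and the non-standard weighted fundamental lemmas), its non-vanishing corollary and a 2025 J. London Math. Soc.
Fourier-coefficient bound (with its GRH sup-norm corollary) inherit in addition Mok's open leaves and KMSW's general weighted fundamental lemma, through Furusawa – Morimoto
2024.

**What this module certifies (v3 = section 110, hundred-and-seventh tranche).**  The PARAMETRISED canonical reading `canon₁₀₇W ν c₈₉` (C226's Corollary 1.1 := the value
of C226's Theorem 1.2, `c₈₉.FMrefined`; C271's Corollary 1.4 := the book at all ranks ∧ that value), whose two edges hold for every ν and every assignment of tranche 89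
(`canon_implications₁₀₇W`), and its canonical instance `canon₁₀₇ ν μ κ` over section 92's `canon₈₉W` (over `canon`, `canon₈no`, `canon₃₄`: C226's Theorem 1.2 := Mok ∧ C67's
value ∧ C24's value) (`canon_implications₁₀₇`): at the top both new nodes hold (`hundredseventh_holds_top`, through the tranche's `hundredseventh_of_inputs` fed by
`canon_implications₈₉W` and `canon_implications₃₄`); in each of the 24 book countermodels (tranches 89 / 107 read canonically over it, both edges valid) C271's Corollary 1.4
FAILS — by name, [read: since σπ is a cuspidal automorphic representation of G(A), it belongs to some global A-packet] — while C226's Corollary 1.1 HOLDS (`c107_book_cm`: no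
book leaf in its support); with C226's Theorem 1.2 denied at the top (`c107_rows_denied_top`, over section 108's `c₈₉noR`) BOTH FAIL ([read: is immediate from Theorem 1.2];
[read: By [8, Corollary 1.1]]); in every Mok countermodel (`c107_mok_cm`) and with KMSW's Mok import denied (`c107_kmsw` I) BOTH FAIL; in KMSW's countermodel of each
only-full leaf (the unwritten sequels, `AubertSS`) the proved scope holds and BOTH HOLD (`c107_kmsw` II: the sequels are not in the support).  In one statement
(`c107_regraded`): support(`FMggpEquiv`) = Mok 29 ∪ KMSW's Mok import (through Theorem 1.2; NO book leaf — the (SO(5), SO(2)) GGP equivalence of a 2024 Compositio paper,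
stated for every tempered π on every inner form G_D, inherits exactly Mok's open leaves (the 2024–2026 preprint layer, Mok's general and non-standard weighted fundamental
lemmas) and KMSW's general weighted fundamental lemma, and nothing of the book's own DAG); support(`KTrationality`) = book 24 ∪ Mok 29 ∪ KMSW's Mok import (by name and
through [8, Corollary 1.1] — a 2025 preprint's arithmetic application, cuspidal Π on GL₄ with growing field of rationality, inherits the book's open leaves AND Mok's).

**What this module certifies (v4 = section 111, hundred-and-eighth tranche).**  The PARAMETRISED canonical reading `canon₁₀₈W c₁₈ c₂₈` (the six C191-supported
statements — C273's Theorem 1.3 (j = 2) / Cors 3.6–3.7 and Theorems 7.1–7.2, C274's modularity examples, C275's compatibility node and Theorem 4.2, C276's Theorems 1 / 2, C277's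
Theorem 1.1 — := the value of row C191 `c₂₈.MokGSp4`; C273's Theorem 1.6 for n = 5,…,8 := the value of row C177 `c₁₈.ClozelThorne2`), whose edges hold for every assignment of
tranches 18 / 28 (`canon_implications₁₀₈W`), and its canonical instance `canon₁₀₈ ν μ κ` over section 22's `canon₁₈` (C177 := Mok at all ranks ∧ KMSW's node `StabOrdI`) and over
the reading `canon₂₈` of section 31 (C191 := the book at all ranks ∧ row A4 := the book) (`canon_implications₁₀₈`): at the top all eight fields hold (`hundredeighth_holds_top`, through the
tranche's `hundredeighth_of_inputs` fed by `canon_implications₂₈`, `canon_implications`, `canon_implications₁₈`); in each of the 24 book countermodels (tranches 1 / 18 / 28 / 108 read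
canonically over it, all edges valid) the SIX C191-supported statements and C275's node FAIL — every book leaf is load-bearing through Mok 2014's transfer GSp₄ → GL₄ ([read:
has also been established [Mok14]]; [read: Galois representations constructed in [Mok14]]; [read: Sorensen (see [24]) and Mok (see Theorem 3.1 of [19])]; [read: [Sor10] and
[Mo14]]; [read: [Sor] and [Mok]]) — while C273's third statement HOLDS (`c108_book_cm`); with row C191 denied at the top (section 31's `canon₂₈noC191`) the six and the node FAIL and
the third HOLDS, with row C177 denied (`c₁₈noCT2`, defined here) only the third FAILS (`c108_rows_denied_top`); in every Mok countermodel the third FAILS ([read: This theorem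
applies for n = 5, 6, 7, 8 by [CT15]] — Clozel – Thorne II [read: conditional on the results in [Mok]]) and the six HOLD (`c108_mok_cm`); in KMSW's countermodel of ANY leaf the
third holds EXACTLY when the leaf is not one of the five premises of the inner-form stabilisation `StabOrdI` (the first file's `stabOrdI_cm_iff`, as section 22 certified for C177
itself) and the six hold (`c108_kmsw`).  In one statement (`c108_regraded`): support(`HTunitaryU4`) = support(`HTstandardGSp4`) = support(`JonesQzeta12`) = support(`TJlgc`) =
support(`TJdescent`) = support(`HWangLevelLowering`) = support(`BMSWunobstructed`) = book 24 (through Mok 2014 and Gee – Taïbi; nothing of Mok 2015 or KMSW) — a 2020 J. Inst.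
Math. Jussieu congruence-ideal theorem for U(4) and for the standard representation of GSp(4), the first proven modular elliptic curves over a quartic CM field (LMS J. Comput.
Math. 2016), a 2019 J. Number Theory descent theorem for theta-lift congruences (under its printed compatibility assumption, supplied by Mok 2014), and two GSp(4) preprints
(level lowering 2019/2022; unobstructedness 2020) inherit exactly the book's open leaves (the 2024–2026 preprint layer, the general and the non-standard weighted fundamental
lemmas) through a 2014 Compositio paper whose own text says [read: conditional on the results of Arthur]; support(`HTsymTower`) = Mok 29 ∪ KMSW's five `StabOrdI` premises
(no book leaf, no KMSW chapter or sequel) — exactly Clozel – Thorne II's residue.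

**What this module certifies (v5 = section 112, hundred-and-ninth tranche).**  The PARAMETRISED canonical reading `canon₁₀₉W c₁₈ c₆₄` (C278's Theorems 1.1 / 1.2, C280's
symmetric-power application, C281's functoriality node and its Theorem 4.27 := the value of row C177 `c₁₈.ClozelThorne2` ∧ the value of row C29 `c₆₄.ClozelThorneIII`; C279's
Theorem 1.8 (case N = 8 over ℚ) := the value of row C29 alone, as cited), whose edges hold for every assignment of tranches 18 / 64 (`canon_implications₁₀₉W`), and its
canonical instance `canon₁₀₉ ν μ κ` over section 22's `canon₁₈` (C177 := Mok at all ranks ∧ KMSW's node `StabOrdI`) and section 67's `canon₆₄` (C29 := Mok ∧ `StabOrdI` ∧ E43's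
five published book leaves ∧ C177's value) (`canon_implications₁₀₉`): at the top all five fields hold (`hundredninth_holds_top`, through the tranche's `hundredninth_of_inputs` fed by
`canon_implications₆₄`, `canon_implications₁₈`, `canon_implications₄₅`); in each of the 24 book countermodels (tranches 18 / 45 / 64 / 109 read canonically over it, all edges
valid) each of the five statements holds IF AND ONLY IF E43's canonical value does (`c109_book_cm`, through section 67's `galoisII_book_cm`) — hence it HOLDS at the countermodel
of every OPEN leaf (the seven 2024–2026 preprint leaves and the two unwritten weighted fundamental lemmas among them: `c109_book_open_leaves`, section 47's
`moeglinUnitaryDS_cm_holds`) and FAILS only at the five PUBLISHED leaves LLC_GLN, FL, Transfer, InvariantTF, TwistedTF (`c109_book_published_leaves`,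
`moeglinUnitaryDS_cm_fails`) — the book contributes NO open leaf to the tranche ([read: ℓ ∈ {5,6,7,8} to Clozel and Thorne [CT15, CT17]]; [read: By recent work of Clozel and Thorne
[ClozelThorne]]; [read: Thanks to recent progress by Clozel-Thorne]; [read: Note that by [ClozelThorne2014, ClozelThorne2015, ClozelThorne2017], for p > 7]); with row C29 denied at
the top (`c₆₄noCT3`, defined here) all five FAIL, with row C177 denied (section 111's `c₁₈noCT2`) all but C279's FAIL (`c109_rows_denied_top` — C279 is bound to part III alone,
exactly as its bibliography has it); in every Mok countermodel all five FAIL (`c109_mok_cm` — [read: the whole paper as conditional on the results in [Mok]], parts II and III);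
in KMSW's countermodel of ANY leaf each holds EXACTLY when the leaf is not one of the five premises of the inner-form stabilisation `StabOrdI` (`c109_kmsw`, the first file's
`stabOrdI_cm_iff`, as sections 22 / 67 certified for the two parts themselves).  In one statement (`c109_regraded`): support(`GKPPSsatoTateGaps`) = support(`LOTeffectiveST8`) =
support(`JanuszewskiSymPadicL`) = support(`ZhangSymLayers`) = support(`ZhangSelmerTower`) = Mok 29 ∪ KMSW's five `StabOrdI` premises ∪ the book's five PUBLISHED leaves of E43 —
a 2020 Res. Number Theory bounded-gaps theorem inside Sato – Tate prime sets, a 2019 IMRN effective short-interval Sato – Tate asymptotic (its case N = 8), a 2024 Amer. J.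
Math. family of p-adic L-functions for Sym^n f (n ≤ 8) and a 2021 Amer. J. Math. Iwasawa-theoretic congruence-ideal theorem (under its printed functoriality assumption, supplied
for n ≤ 9 by Clozel – Thorne) inherit exactly parts II / III's residue: Mok's 2024–2026 preprint layer, Mok's general and non-standard weighted fundamental lemmas, KMSW's
general weighted fundamental lemma — and nothing open of the book.

**What this module certifies (v6 = section 113, hundred-and-tenth tranche).**  The PARAMETRISED canonical reading `canon₁₁₀W c₂ c₄` (C282's node `STcupProduct` = its
Theorem 3.3, its Theorem 1.2 `STcentralRF` and Proposition 5.1 / Theorem 1.5 `STbranchedCovers`, and C283's Theorem 1.1 `LIPexoticKernels` := the value of row C17-Acta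
`c₄.BMMball`; C284's Theorem 2.2 `PetersenVanishing` and C285's Theorem 3.1.1 `LOGpicardRank` := the value of row C99 `c₂.BLMM`), whose edges hold for every assignment of
tranches 2 / 4 (`canon_implications₁₁₀W`), and its canonical instance `canon₁₁₀ ν μ κ` over the first support file's `canon₂` (C99 := everything the book establishes) and
`canon₄` (C17-Acta := Mok at all ranks ∧ KMSW's node `StabOrdI`) (`canon_implications₁₁₀`): at the top all six fields hold (`hundredtenth_holds_top`, through the tranche's
`hundredtenth_of_inputs` fed by `canon_implications`, `canon_implications₂`, `canon_implications₄`); in each of the 24 book countermodels (tranches 2 / 4 / 110 read canonically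
over it, all edges valid) the two K3-MODULI statements FAIL and the four BALL-QUOTIENT statements HOLD (`c110_book_cm`, the first file's `not_B_cm`) — ALL 24 leaves of the
book are load-bearing for C284 / C285 and NONE for C282 / C283 ([read: after [bergeronlimillsonmoeglin]]; [read: Recent work of Bergeron et al. establishes that this is in fact an
isomorphism]; [read: begins by using work of Bergeron, Millson, and Moeglin [Acta]]; [read: Theorem (thm:StoverToledo) implies]); with row C17-Acta denied at the top (`c₄noBMMball`,
defined here) the ball-quotient line FAILS and the K3-moduli line holds, with row C99 denied (`c₂noBLMM`, defined here) conversely (`c110_rows_denied_top` — the two lines are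
independent; C282's [Invent] names a method, not a theorem); in every Mok countermodel the ball-quotient line FAILS and the K3-moduli line holds (`c110_mok_cm`, `not_M_cm` — all
29 Mok leaves load-bearing for C282 / C283); in KMSW's countermodel of ANY leaf the ball-quotient line holds EXACTLY when the leaf is not one of the five premises of the inner-form
stabilisation `StabOrdI` (`c110_kmsw`, the first file's `stabOrdI_cm_iff`, as `kmsw_ballLine_iff` certified for the Acta paper and row C164) and the K3-moduli line holds.  In one
statement (`c110_regraded`): support(`PetersenVanishing`) = support(`LOGpicardRank`) = ALL 24 leaves of the book (the general weighted FL a second time through the inner-form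
stabilisation) — a 2019 Amer. J. Math. vanishing theorem for the tautological cohomology ring of the moduli of K3 surfaces and a 2019 Compositio computation of the Picard ranks of
the period spaces of quartic K3 surfaces inherit exactly the Inventiones paper's residue: the 2024–2026 preprint layer and the two unwritten weighted fundamental lemmas;
support(`STcupProduct`) = support(`STcentralRF`) = support(`STbranchedCovers`) = support(`LIPexoticKernels`) = Mok 29 ∪ KMSW's five `StabOrdI` premises ∪ AMR-unitary and NO
leaf of the book — a 2022 Pure Appl. Math. Q. residual-finiteness theorem for central extensions of arithmetic lattices in PU(n,1) with its negatively curved branched covers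
and a 2025 J. Topol. family of Kähler groups with exotic finiteness properties inherit exactly the Acta paper's residue: Mok's 2024–2026 preprint layer, Mok's general and
non-standard weighted fundamental lemmas, KMSW's general weighted fundamental lemma.

**What this module certifies (v7 = section 114, hundred-and-eleventh tranche).**  The PARAMETRISED canonical reading `canon₁₁₁W c₂ c₄` (C286's node `BLspecialCycles` =
the theta-surjectivity theorems with coefficients of the Duke text, its generalized Franchetta theorem `BLfranchetta`, the Erratum's tautological theorem `BLtautological`, and
C287's Theorem 1.0.1 `LZdeligneBeilinson` := the value of row C99 ∧ row C17-IMRN, `c₂.BLMM ∧ c₄.BMMorth`, as the node is typed; C288's main theorem `DFVintegralPicard`, C289's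
node `BZheegnerSpan` (Corollary 4.16) and Theorem 1.2 `BZprimitiveLift`, C290's Theorem 1.1 `BBFWnlCone` and Proposition 1.2 / Theorem 1.3 `BBFWuniruled`, C291's Theorem 1.3
`HLMYpicardOne` and Theorem 1.1 `HLMYbailyBorel` := the value of row C99 `c₂.BLMM`), whose edges hold for every assignment of tranches 2 / 4 (`canon_implications₁₁₁W`), and its
canonical instance `canon₁₁₁ ν μ κ` over the first support file's `canon₂` (C99 := everything the book establishes) and `canon₄` (C17-IMRN := everything the book establishes)
(`canon_implications₁₁₁`): at the top all eleven fields hold (`hundredeleventh_holds_top`, through the tranche's `hundredeleventh_of_inputs` fed by `canon_implications`,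
`canon_implications₂`, `canon_implications₄`, `bookInputs_top`); in each of the 24 book countermodels (tranches 2 / 4 / 111 read canonically over it, all edges valid) ALL
ELEVEN statements FAIL (`c111_book_cm`, the first file's `not_B_cm`) — ALL 24 leaves of the book are load-bearing for C286 – C291 ([read: simply refer to [BLMM16] for the
proof]; [read: precisely the main result of [BLMM16]]; [read: according to [BL17]]; [read: whose rank is known [BLMM]]; [read: proved in [BLMM17], Theorem 1.2 can be reduced to
showing]; [read: The surjectivity is Theorem (thm:sec2:BLMM17)]; [read: By [BLMM17], the first Chern class map induces an isomorphism]); with row C17-IMRN denied at the top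
(`c₄noBMMorth`, defined here) C286's node, its two theorems and C287 FAIL while C288 – C291 hold, and with row C99 denied (section 113's `c₂noBLMM`) all eleven FAIL
(`c111_rows_denied_top` — the typed premises are load-bearing exactly as typed); in every Mok countermodel and in KMSW's countermodel of ANY leaf every edge holds and all
eleven statements HOLD (`c111_mok_cm`, `c111_kmsw` — no Mok / KMSW leaf in the supports beyond the book's own record of the inner-form stabilisation).  In one statement
(`c111_regraded`): the support of each of the eleven statements = ALL 24 leaves of the book (the general weighted FL a second time through the inner-form stabilisation) and
nothing else — a 2019 Duke theorem on the tautological classes of moduli of hyper-Kähler manifolds with its cohomological generalized Franchetta theorem (the tautological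
statement as corrected: arXiv Erratum 2021, whose Theorem 3 is Theorem 3.1 of the *Complement*, Ann. Fac. Sci. Toulouse Math. (6) 32 (2023) 839–854 [read: The first part
is precisely the main result of [4]] — the version of record, held and read after `Downstream33.lean` v1 was filed citing the Duke Erratum 171 (2022) 243–245, which is the notice), a
2022 Forum Math. Sigma refinement in Deligne – Beilinson cohomology, the 2024 Bull. LMS integral Picard groups of the moduli of polarized K3 surfaces, the 2026 Proc. LMS
Lefschetz decomposition of the Kudla – Millson theta function with the primitivity of the Kudla – Millson lift, the 2026 Math. Ann. Noether – Lefschetz and Heegner cones with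
the uniruledness of moduli of OG6- and Kum_n-type hyperkähler manifolds, and a 2024 / 2025 preprint's Picard group of the Baily – Borel compactification of the moduli of
quasi-polarized K3 surfaces inherit exactly the Inventiones paper's residue: the 2024–2026 preprint layer and the two unwritten weighted fundamental lemmas.

**Deliberately not here.**  Any claim about the content or truth of a downstream statement; no new named fact (every
canonical value is written out); no Mathlib, no `axiom`, no `sorry`, no `opaque`.
-/

set_option autoImplicit false

namespace Literature.NumberTheory.Automorphic.Arthur2013

namespace Downstream

namespace Support
/-! ## 108. Hundred-and-fifth tranche (v1 of this file, after `Downstream31.lean` v3; unit `pub-arthur-down-g41`): supports of THE PERIOD-FORMULA VEIN — C265 `NelsonBranching`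
(premise-free) / `NelsonSubconvex` (⇐ it ∧ C26), C266 `DimitrakopoulouPadicL` (⇐ C26), C267 `HMdecorrelation` (⇐ C41 ∧ C226), C268 `WeiNonvanishing` (⇐ C41), C269
`TsuzukiNonvanishing` (⇐ C41), C270 `HYtheta` (⇐ book ∧ nodes `HYjl`, `HYboch`); see the module docstring for the summary of what is certified. -/

section Canon105

variable (ν : Nodes) (μ : Mok2015.Nodes) (κ : KMSW2014.Nodes)

/-- The parametrised canonical reading of the hundred-and-fifth tranche: ν, the assignments `c₂`, `c₆₇`, `c₈₉` of tranches 2 / 67 / 89 and the truth values `j`, `k` given to C270's two hypothesis nodes are the parameters; C265's Theorem 1 := True (premise-free); C265's Corollary 2 := True ∧ C26; C266 := C26; C267 := C41 ∧ C226; C268, C269 := C41; C270's nodes := `j`, `k`; C270's Theorem 1.2 := book ∧ `j` ∧ `k`. [cite: Nelson2023SpectralAspect, Thm 1, Cor. 2; Dimitrakopoulou2026Anticyclotomic, Thm 1.1; HuaMiao2025Decorrelation, Thm 1.1; Wei2023PoincareSpinor, Cor. 1.3; Tsuzuki2020WeightedEquidistribution, Cor. 1.5; HsiehYamana2024BesselPeriods,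 Thm 1.2 (canonical model; bookkeeping)] -/
abbrev canon₁₀₅W (c₂ : Consumers2) (c₆₇ : Consumers67) (c₈₉ : Consumers89) (j k : Prop) : Consumers105 where
  NelsonBranching := True
  NelsonSubconvex := True ∧ c₂.BPCZii
  DimitrakopoulouPadicL := c₂.BPCZii
  HMdecorrelation := c₆₇.FMBessel ∧ c₈₉.FMrefined
  WeiNonvanishing := c₆₇.FMBessel
  TsuzukiNonvanishing := c₆₇.FMBessel
  HYjl := j
  HYboch := k
  HYtheta := (∀ N, ν.Everything N) ∧ j ∧ k

/-- The canonical instance over `canon₂`, section 70's `canon₆₇` (tranche-67 nodes granted) and section 92's `canon₈₉W` over `canon` / `canon₈no` / `canon₃₄` (as in section 107), with C270's two nodes GRANTED: there C26 := Mok ∧ KMSW-scope, C41 := the book at all ranks, C226 := Mok ∧ C67's value ∧ C24's value. [cite: Nelson2023SpectralAspect, Cor. 2; HuaMiao2025Decorrelation, Thm 1.1; HsiehYamana2024BesselPeriods, Thm 1.2 (canonical model; bookkeeping)] -/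
abbrev canon₁₀₅ : Consumers105 := canon₁₀₅W ν (canon₂ ν μ κ) (canon₆₇ ν μ κ) (canon₈₉W ν μ (canon ν μ κ) (canon₈no ν μ) (canon₃₄ μ κ)) True True

/-- Every hundred-and-fifth-tranche edge holds in the parametrised reading, for EVERY ν, every assignment of tranches 2 / 67 / 89 and every truth value of the two nodes. [cite: Nelson2023SpectralAspect, Thm 1, Cor. 2; Dimitrakopoulou2026Anticyclotomic, Thm 1.1; HuaMiao2025Decorrelation, Thm 1.1; Wei2023PoincareSpinor, Cor. 1.3; Tsuzuki2020WeightedEquidistribution, Cor. 1.5; HsiehYamana2024BesselPeriods, Thm 1.2 (bookkeeping proved here)] -/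
theorem canon_implications₁₀₅W (c₂ : Consumers2) (c₆₇ : Consumers67) (c₈₉ : Consumers89) (j k : Prop) : Implications105 ν c₂ c₆₇ c₈₉ (canon₁₀₅W ν c₂ c₆₇ c₈₉ j k) where
  nelsonB := True.intro
  nelson := fun t h => ⟨t, h⟩
  dimi := fun h => h
  hm := fun a r => ⟨a, r⟩
  wei := fun a => a
  tsu := fun a => a
  hy := fun b hj hk => ⟨b, hj, hk⟩

/-- Every hundred-and-fifth-tranche edge holds in the canonical instance, for arbitrary ν, μ, κ. [cite: Nelson2023SpectralAspect, Cor. 2; HsiehYamana2024BesselPeriods, Thm 1.2 (bookkeeping proved here)] -/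
theorem canon_implications₁₀₅ : Implications105 ν (canon₂ ν μ κ) (canon₆₇ ν μ κ) (canon₈₉W ν μ (canon ν μ κ) (canon₈no ν μ) (canon₃₄ μ κ)) (canon₁₀₅ ν μ κ) :=
  canon_implications₁₀₅W _ _ _ _ _ _

/-- In the parametrised reading all nine fields hold as soon as row C26 holds, row C41 holds, C226's Theorem 1.2 holds, the book holds at all ranks and both nodes are granted — through the tranche's own `unitaryII105_of_rows`, `bocherer105_of_rows`, `hyTheta_of_book_and_nodes`. [cite: Nelson2023SpectralAspect, Thm 1, Cor. 2; Dimitrakopoulou2026Anticyclotomic, Thm 1.1; HuaMiao2025Decorrelation, Thm 1.1; Wei2023PoincareSpinor, Cor. 1.3; Tsuzuki2020WeightedEquidistribution, Cor. 1.5; HsiehYamana2024BesselPeriods, Thm 1.2 (bookkeeping proved here)] -/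
theorem c105_all_of (c₂ : Consumers2) (c₆₇ : Consumers67) (c₈₉ : Consumers89) (j k : Prop) (h₂₆ : c₂.BPCZii) (h₄₁ : c₆₇.FMBessel) (hR : c₈₉.FMrefined)
    (hν : ∀ N, ν.Everything N) (hj : j) (hk : k) :
    (canon₁₀₅W ν c₂ c₆₇ c₈₉ j k).NelsonBranching ∧ ((canon₁₀₅W ν c₂ c₆₇ c₈₉ j k).NelsonSubconvex ∧ (canon₁₀₅W ν c₂ c₆₇ c₈₉ j k).DimitrakopoulouPadicL) ∧
      ((canon₁₀₅W ν c₂ c₆₇ c₈₉ j k).HMdecorrelation ∧ (canon₁₀₅W ν c₂ c₆₇ c₈₉ j k).WeiNonvanishing ∧ (canon₁₀₅W ν c₂ c₆₇ c₈₉ j k).TsuzukiNonvanishing) ∧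
      ((canon₁₀₅W ν c₂ c₆₇ c₈₉ j k).HYjl ∧ (canon₁₀₅W ν c₂ c₆₇ c₈₉ j k).HYboch ∧ (canon₁₀₅W ν c₂ c₆₇ c₈₉ j k).HYtheta) :=
  have X := canon_implications₁₀₅W ν c₂ c₆₇ c₈₉ j k
  ⟨nelsonBranching_inherits_nothing X, unitaryII105_of_rows X h₂₆, bocherer105_of_rows X h₄₁ hR, ⟨hj, hk, hyTheta_of_book_and_nodes X hν hj hk⟩⟩

end Canon105

/-- At the top (every input of the three DAGs; the Chapter-9 leaf denied in section 92's reading of C226, which this tranche does not use; C270's nodes granted) all nine fields hold —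
through the tranche's own `hundredfifth_of_inputs` fed by `canon_implications₂`, section 70's `canon_implications₆₇`, section 92's `canon_implications₈₉W` and tranche 34's
`canon_implications₃₄`. [cite: Nelson2023SpectralAspect, Thm 1, Cor. 2; Dimitrakopoulou2026Anticyclotomic, Thm 1.1; HuaMiao2025Decorrelation, Thm 1.1; Wei2023PoincareSpinor, Cor. 1.3; Tsuzuki2020WeightedEquidistribution, Cor. 1.5; HsiehYamana2024BesselPeriods, Thm 1.2 (bookkeeping proved here)] [claim: KalethaMinguezShinWhite2014, under-review] -/
theorem hundredfifth_holds_top :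
    (canon₁₀₅ νtop μtop κtop).NelsonBranching ∧ ((canon₁₀₅ νtop μtop κtop).NelsonSubconvex ∧ (canon₁₀₅ νtop μtop κtop).DimitrakopoulouPadicL) ∧
      ((canon₁₀₅ νtop μtop κtop).HMdecorrelation ∧ (canon₁₀₅ νtop μtop κtop).WeiNonvanishing ∧ (canon₁₀₅ νtop μtop κtop).TsuzukiNonvanishing) ∧
      (canon₁₀₅ νtop μtop κtop).HYtheta :=
  hundredfifth_of_inputs (canon_implications₁₀₅ νtop μtop κtop) (canon_implications₂ νtop μtop κtop) (canon_implications₆₇ νtop μtop κtop)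
    (canon_implications₈₉W νtop μtop (canon νtop μtop κtop) (canon₈no νtop μtop) (canon₃₄ μtop κtop)) (canon_implications₃₄ νtop μtop κtop)
    bookInputs_top mokInputs_top (kmswInputs_top μtop).1 True.intro True.intro

/-- BOOK SIDE, EXACT SUPPORT: in each of the 24 book countermodels (Mok and KMSW at the top; tranches 1 / 2 / 67 / 89 / 105 read canonically over it, ALL the edges of tranches 1 / 2 / 67 /
105 valid; nodes granted) C267, C268, C269 and C270's Theorem 1.2 FAIL — every book leaf is load-bearing, through C41 ([read: proved by Furusawa and Morimoto]) for the three Böcherer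
consumers and by name ([read: thanks to the work of Arthur]) for C270 — while C265's two statements and C266 HOLD (their only premise, C26, reads Mok ∧ KMSW-scope: the book is NOT in
their support). [cite: HuaMiao2025Decorrelation, §3; Wei2023PoincareSpinor, §1; Tsuzuki2020WeightedEquidistribution, §1 Cor. 1.5; HsiehYamana2024BesselPeriods, §9.1; Nelson2023SpectralAspect, proof of Cor. 2; Dimitrakopoulou2026Anticyclotomic, §5; with FurusawaMorimoto2021Bessel §1 and Arthur2013 §1.5 (bookkeeping proved here)] -/
theorem c105_book_cm (l : LeafSupport.Leaf) :
    LeafSupport.Systems (LeafSupport.mkN (LeafSupport.cm l)) (LeafSupport.mkW (LeafSupport.cm l)) (LeafSupport.mkG (LeafSupport.cm l)) ∧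
      (∀ l', l' ≠ l → (LeafSupport.mkN (LeafSupport.cm l)).leaf l') ∧ ¬ (LeafSupport.mkN (LeafSupport.cm l)).leaf l ∧
      (Implications (LeafSupport.mkN (LeafSupport.cm l)) μtop κtop (canon (LeafSupport.mkN (LeafSupport.cm l)) μtop κtop) ∧
        Implications2 (LeafSupport.mkN (LeafSupport.cm l)) μtop κtop (canon (LeafSupport.mkN (LeafSupport.cm l)) μtop κtop) (canon₂ (LeafSupport.mkN (LeafSupport.cm l)) μtop κtop) ∧
        Implications67 (LeafSupport.mkN (LeafSupport.cm l)) μtop κtop (canon (LeafSupport.mkN (LeafSupport.cm l)) μtop κtop) (canon₆ (LeafSupport.mkN (LeafSupport.cm l)) μtop)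
          (canon₈ (LeafSupport.mkN (LeafSupport.cm l)) μtop κtop) (canon₆₇ (LeafSupport.mkN (LeafSupport.cm l)) μtop κtop) ∧
        Implications105 (LeafSupport.mkN (LeafSupport.cm l)) (canon₂ (LeafSupport.mkN (LeafSupport.cm l)) μtop κtop) (canon₆₇ (LeafSupport.mkN (LeafSupport.cm l)) μtop κtop)
          (canon₈₉W (LeafSupport.mkN (LeafSupport.cm l)) μtop (canon (LeafSupport.mkN (LeafSupport.cm l)) μtop κtop) (canon₈no (LeafSupport.mkN (LeafSupport.cm l)) μtop) (canon₃₄ μtop κtop))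
          (canon₁₀₅ (LeafSupport.mkN (LeafSupport.cm l)) μtop κtop)) ∧
      (¬ (canon₁₀₅ (LeafSupport.mkN (LeafSupport.cm l)) μtop κtop).HMdecorrelation ∧ ¬ (canon₁₀₅ (LeafSupport.mkN (LeafSupport.cm l)) μtop κtop).WeiNonvanishing ∧
        ¬ (canon₁₀₅ (LeafSupport.mkN (LeafSupport.cm l)) μtop κtop).TsuzukiNonvanishing ∧ ¬ (canon₁₀₅ (LeafSupport.mkN (LeafSupport.cm l)) μtop κtop).HYtheta) ∧
      ((canon₁₀₅ (LeafSupport.mkN (LeafSupport.cm l)) μtop κtop).NelsonBranching ∧ (canon₁₀₅ (LeafSupport.mkN (LeafSupport.cm l)) μtop κtop).NelsonSubconvex ∧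
        (canon₁₀₅ (LeafSupport.mkN (LeafSupport.cm l)) μtop κtop).DimitrakopoulouPadicL) :=
  have cmod := LeafSupport.countermodel l
  have nb := not_B_cm l
  have m : ∀ N, μtop.Everything N := mokInputs_top.everything
  have s : ∀ N, κtop.Scope N := (kmswInputs_top μtop).1.scope mokInputs_top
  ⟨cmod.1, cmod.2.1, cmod.2.2.1, ⟨canon_implications _ _ _, canon_implications₂ _ _ _, canon_implications₆₇ _ _ _, canon_implications₁₀₅ _ _ _⟩,
    ⟨fun h => nb h.1, fun h => nb h, fun h => nb h, fun h => nb h.1⟩, ⟨True.intro, ⟨True.intro, m, s⟩, ⟨m, s⟩⟩⟩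

/-- Row C41 DENIED (`FMBessel := False`; the other tranche-67 fields as in `canon₆₇` at the top): a reading of `Consumers67` used only to deny Furusawa – Morimoto's 2021 formula; no tranche-67 edge is claimed for it. [cite: FurusawaMorimoto2021Bessel, Thms 1-2 (separating model; bookkeeping)] -/
abbrev c₆₇noFM : Consumers67 := { canon₆₇ νtop μtop κtop with FMBessel := False }

/-- Row C226's Theorem 1.2 DENIED (`FMrefined := False`; the other tranche-89 fields as in section 92's reading at the top): a reading of `Consumers89` used only to deny Furusawa – Morimoto's refined formula; no tranche-89 edge is claimed for it. [cite: FurusawaMorimoto2024SO5, Thm 1.2 (separating model; bookkeeping)] -/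
abbrev c₈₉noR : Consumers89 := { canon₈₉W νtop μtop (canon νtop μtop κtop) (canon₈no νtop μtop) (canon₃₄ μtop κtop) with FMrefined := False }

/-- THE TYPED PREMISES ARE LOAD-BEARING EXACTLY AS TYPED (reading-level separation at the top, nodes granted): (a) C26 DENIED (section 93's `c₂noIINH`: `BPLZZii`, `BPCZii := False`) ⇒
C265's Corollary 2 and C266 FAIL, C265's Theorem 1 and the four book-side statements HOLD; (b) C41 DENIED (`c₆₇noFM`) ⇒ C267, C268, C269 FAIL, the unitary pair and C270 HOLD; (c)
C226's Theorem 1.2 DENIED (`c₈₉noR`) ⇒ only C267 FAILS.  Every hundred-and-fifth edge holds over each denied assignment. [cite: Nelson2023SpectralAspect, proof of Cor. 2 ([2020arXiv200705601B]); Dimitrakopoulou2026Anticyclotomic, §5 ([BPCZ22, Theorem 1.1.6.1]); HuaMiao2025Decorrelation, §3 ([FurusawaMorimoto2021], [FurusawaMorimoto2024]); Wei2023PoincareSpinor, §1 ([FM]); Tsuzuki2020WeightedEquidistribution, Thm 1.4 ([FurusawaMorimoto]) (separating models; bookkeeping proved here)] -/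
theorem c105_rows_denied_top :
    (Implications105 νtop c₂noIINH (canon₆₇ νtop μtop κtop) (canon₈₉W νtop μtop (canon νtop μtop κtop) (canon₈no νtop μtop) (canon₃₄ μtop κtop))
        (canon₁₀₅W νtop c₂noIINH (canon₆₇ νtop μtop κtop) (canon₈₉W νtop μtop (canon νtop μtop κtop) (canon₈no νtop μtop) (canon₃₄ μtop κtop)) True True) ∧
        (canon₁₀₅W νtop c₂noIINH (canon₆₇ νtop μtop κtop) (canon₈₉W νtop μtop (canon νtop μtop κtop) (canon₈no νtop μtop) (canon₃₄ μtop κtop)) True True).NelsonBranching ∧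
        ¬ (canon₁₀₅W νtop c₂noIINH (canon₆₇ νtop μtop κtop) (canon₈₉W νtop μtop (canon νtop μtop κtop) (canon₈no νtop μtop) (canon₃₄ μtop κtop)) True True).NelsonSubconvex ∧
        ¬ (canon₁₀₅W νtop c₂noIINH (canon₆₇ νtop μtop κtop) (canon₈₉W νtop μtop (canon νtop μtop κtop) (canon₈no νtop μtop) (canon₃₄ μtop κtop)) True True).DimitrakopoulouPadicL ∧
        (canon₁₀₅W νtop c₂noIINH (canon₆₇ νtop μtop κtop) (canon₈₉W νtop μtop (canon νtop μtop κtop) (canon₈no νtop μtop) (canon₃₄ μtop κtop)) True True).HMdecorrelation ∧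
        (canon₁₀₅W νtop c₂noIINH (canon₆₇ νtop μtop κtop) (canon₈₉W νtop μtop (canon νtop μtop κtop) (canon₈no νtop μtop) (canon₃₄ μtop κtop)) True True).WeiNonvanishing ∧
        (canon₁₀₅W νtop c₂noIINH (canon₆₇ νtop μtop κtop) (canon₈₉W νtop μtop (canon νtop μtop κtop) (canon₈no νtop μtop) (canon₃₄ μtop κtop)) True True).HYtheta) ∧
      (Implications105 νtop (canon₂ νtop μtop κtop) c₆₇noFM (canon₈₉W νtop μtop (canon νtop μtop κtop) (canon₈no νtop μtop) (canon₃₄ μtop κtop))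
        (canon₁₀₅W νtop (canon₂ νtop μtop κtop) c₆₇noFM (canon₈₉W νtop μtop (canon νtop μtop κtop) (canon₈no νtop μtop) (canon₃₄ μtop κtop)) True True) ∧
        ¬ (canon₁₀₅W νtop (canon₂ νtop μtop κtop) c₆₇noFM (canon₈₉W νtop μtop (canon νtop μtop κtop) (canon₈no νtop μtop) (canon₃₄ μtop κtop)) True True).HMdecorrelation ∧
        ¬ (canon₁₀₅W νtop (canon₂ νtop μtop κtop) c₆₇noFM (canon₈₉W νtop μtop (canon νtop μtop κtop) (canon₈no νtop μtop) (canon₃₄ μtop κtop)) True True).WeiNonvanishing ∧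
        ¬ (canon₁₀₅W νtop (canon₂ νtop μtop κtop) c₆₇noFM (canon₈₉W νtop μtop (canon νtop μtop κtop) (canon₈no νtop μtop) (canon₃₄ μtop κtop)) True True).TsuzukiNonvanishing ∧
        (canon₁₀₅W νtop (canon₂ νtop μtop κtop) c₆₇noFM (canon₈₉W νtop μtop (canon νtop μtop κtop) (canon₈no νtop μtop) (canon₃₄ μtop κtop)) True True).NelsonSubconvex ∧
        (canon₁₀₅W νtop (canon₂ νtop μtop κtop) c₆₇noFM (canon₈₉W νtop μtop (canon νtop μtop κtop) (canon₈no νtop μtop) (canon₃₄ μtop κtop)) True True).DimitrakopoulouPadicL ∧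
        (canon₁₀₅W νtop (canon₂ νtop μtop κtop) c₆₇noFM (canon₈₉W νtop μtop (canon νtop μtop κtop) (canon₈no νtop μtop) (canon₃₄ μtop κtop)) True True).HYtheta) ∧
      (Implications105 νtop (canon₂ νtop μtop κtop) (canon₆₇ νtop μtop κtop) c₈₉noR (canon₁₀₅W νtop (canon₂ νtop μtop κtop) (canon₆₇ νtop μtop κtop) c₈₉noR True True) ∧
        ¬ (canon₁₀₅W νtop (canon₂ νtop μtop κtop) (canon₆₇ νtop μtop κtop) c₈₉noR True True).HMdecorrelation ∧
        (canon₁₀₅W νtop (canon₂ νtop μtop κtop) (canon₆₇ νtop μtop κtop) c₈₉noR True True).WeiNonvanishing ∧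
        (canon₁₀₅W νtop (canon₂ νtop μtop κtop) (canon₆₇ νtop μtop κtop) c₈₉noR True True).TsuzukiNonvanishing ∧
        (canon₁₀₅W νtop (canon₂ νtop μtop κtop) (canon₆₇ νtop μtop κtop) c₈₉noR True True).NelsonSubconvex) :=
  have b : ∀ N, νtop.Everything N := bookInputs_top.everything
  have m : ∀ N, μtop.Everything N := mokInputs_top.everything
  have s : ∀ N, κtop.Scope N := (kmswInputs_top μtop).1.scope mokInputs_top
  have r : (∀ N, μtop.Everything N) ∧ (canon₃₄ μtop κtop).FurusawaMorimoto ∧ (canon₃₄ μtop κtop).BPlocalGGP := ⟨m, ⟨m, s, ⟨m, s⟩⟩, ⟨m, s⟩⟩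
  ⟨⟨canon_implications₁₀₅W _ _ _ _ _ _, True.intro, fun h => h.2, fun h => h, ⟨b, r⟩, b, ⟨b, True.intro, True.intro⟩⟩,
    ⟨canon_implications₁₀₅W _ _ _ _ _ _, fun h => h.1, fun h => h, fun h => h, ⟨True.intro, m, s⟩, ⟨m, s⟩, ⟨b, True.intro, True.intro⟩⟩,
    ⟨canon_implications₁₀₅W _ _ _ _ _ _, fun h => h.2, b, b, ⟨True.intro, m, s⟩⟩⟩

/-- C270's HYPOTHESIS NODES ARE LOAD-BEARING AS TYPED: at the top with (JL) DENIED, resp. (Böch) DENIED (the other node granted), every edge holds, Theorem 1.2 FAILS and every other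
typed statement of the tranche HOLDS — the nodes have no supplier in the register ([read: Arthur's project will establish this hypothesis]; Furusawa – Morimoto supply (Böch) for
the trivial character only). [cite: HsiehYamana2024BesselPeriods, §1.3 (JL), (Böch), Rem. 1.3 (separating models; bookkeeping proved here)] -/
theorem c105_nodes_denied_top :
    (Implications105 νtop (canon₂ νtop μtop κtop) (canon₆₇ νtop μtop κtop) (canon₈₉W νtop μtop (canon νtop μtop κtop) (canon₈no νtop μtop) (canon₃₄ μtop κtop))
        (canon₁₀₅W νtop (canon₂ νtop μtop κtop) (canon₆₇ νtop μtop κtop) (canon₈₉W νtop μtop (canon νtop μtop κtop) (canon₈no νtop μtop) (canon₃₄ μtop κtop)) False True) ∧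
        ¬ (canon₁₀₅W νtop (canon₂ νtop μtop κtop) (canon₆₇ νtop μtop κtop) (canon₈₉W νtop μtop (canon νtop μtop κtop) (canon₈no νtop μtop) (canon₃₄ μtop κtop)) False True).HYtheta ∧
        (canon₁₀₅W νtop (canon₂ νtop μtop κtop) (canon₆₇ νtop μtop κtop) (canon₈₉W νtop μtop (canon νtop μtop κtop) (canon₈no νtop μtop) (canon₃₄ μtop κtop)) False True).HMdecorrelation ∧
        (canon₁₀₅W νtop (canon₂ νtop μtop κtop) (canon₆₇ νtop μtop κtop) (canon₈₉W νtop μtop (canon νtop μtop κtop) (canon₈no νtop μtop) (canon₃₄ μtop κtop)) False True).NelsonSubconvex) ∧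
      (Implications105 νtop (canon₂ νtop μtop κtop) (canon₆₇ νtop μtop κtop) (canon₈₉W νtop μtop (canon νtop μtop κtop) (canon₈no νtop μtop) (canon₃₄ μtop κtop))
        (canon₁₀₅W νtop (canon₂ νtop μtop κtop) (canon₆₇ νtop μtop κtop) (canon₈₉W νtop μtop (canon νtop μtop κtop) (canon₈no νtop μtop) (canon₃₄ μtop κtop)) True False) ∧
        ¬ (canon₁₀₅W νtop (canon₂ νtop μtop κtop) (canon₆₇ νtop μtop κtop) (canon₈₉W νtop μtop (canon νtop μtop κtop) (canon₈no νtop μtop) (canon₃₄ μtop κtop)) True False).HYtheta ∧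
        (canon₁₀₅W νtop (canon₂ νtop μtop κtop) (canon₆₇ νtop μtop κtop) (canon₈₉W νtop μtop (canon νtop μtop κtop) (canon₈no νtop μtop) (canon₃₄ μtop κtop)) True False).TsuzukiNonvanishing ∧
        (canon₁₀₅W νtop (canon₂ νtop μtop κtop) (canon₆₇ νtop μtop κtop) (canon₈₉W νtop μtop (canon νtop μtop κtop) (canon₈no νtop μtop) (canon₃₄ μtop κtop)) True False).DimitrakopoulouPadicL) :=
  have b : ∀ N, νtop.Everything N := bookInputs_top.everything
  have m : ∀ N, μtop.Everything N := mokInputs_top.everything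
  have s : ∀ N, κtop.Scope N := (kmswInputs_top μtop).1.scope mokInputs_top
  have r : (∀ N, μtop.Everything N) ∧ (canon₃₄ μtop κtop).FurusawaMorimoto ∧ (canon₃₄ μtop κtop).BPlocalGGP := ⟨m, ⟨m, s, ⟨m, s⟩⟩, ⟨m, s⟩⟩
  ⟨⟨canon_implications₁₀₅W _ _ _ _ _ _, fun h => h.2.1, ⟨b, r⟩, ⟨True.intro, m, s⟩⟩,
    ⟨canon_implications₁₀₅W _ _ _ _ _ _, fun h => h.2.2, b, ⟨m, s⟩⟩⟩

/-- MOK SIDE: in the Mok countermodel of ANY leaf `l` (book and KMSW at the top; tranches 2 / 67 / 89 / 105 read over it; nodes granted) every hundred-and-fifth edge holds; C265's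
Corollary 2, C266 and C267 FAIL — through C26 ([read: By [Mok], [KMSW]]) and through C226's Theorem 1.2 ([read: by Mok [82]]) — while C265's Theorem 1, C268, C269 and C270's
Theorem 1.2 HOLD. [cite: Nelson2023SpectralAspect, proof of Cor. 2; Dimitrakopoulou2026Anticyclotomic, §5; HuaMiao2025Decorrelation, §3; Mok2012, Thm 2.5.2; FurusawaMorimoto2024SO5, §7 (bookkeeping proved here)] -/
theorem c105_mok_cm (l : Mok2015.LeafSupport.Leaf) :
    ¬ (Mok2015.LeafSupport.mkN (Mok2015.LeafSupport.cm l)).leaf l ∧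
      Implications105 νtop (canon₂ νtop (Mok2015.LeafSupport.mkN (Mok2015.LeafSupport.cm l)) κtop) (canon₆₇ νtop (Mok2015.LeafSupport.mkN (Mok2015.LeafSupport.cm l)) κtop)
        (canon₈₉W νtop (Mok2015.LeafSupport.mkN (Mok2015.LeafSupport.cm l)) (canon νtop (Mok2015.LeafSupport.mkN (Mok2015.LeafSupport.cm l)) κtop) (canon₈no νtop (Mok2015.LeafSupport.mkN (Mok2015.LeafSupport.cm l))) (canon₃₄ (Mok2015.LeafSupport.mkN (Mok2015.LeafSupport.cm l)) κtop))
        (canon₁₀₅ νtop (Mok2015.LeafSupport.mkN (Mok2015.LeafSupport.cm l)) κtop) ∧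
      (¬ (canon₁₀₅ νtop (Mok2015.LeafSupport.mkN (Mok2015.LeafSupport.cm l)) κtop).NelsonSubconvex ∧ ¬ (canon₁₀₅ νtop (Mok2015.LeafSupport.mkN (Mok2015.LeafSupport.cm l)) κtop).DimitrakopoulouPadicL ∧
        ¬ (canon₁₀₅ νtop (Mok2015.LeafSupport.mkN (Mok2015.LeafSupport.cm l)) κtop).HMdecorrelation) ∧
      ((canon₁₀₅ νtop (Mok2015.LeafSupport.mkN (Mok2015.LeafSupport.cm l)) κtop).NelsonBranching ∧ (canon₁₀₅ νtop (Mok2015.LeafSupport.mkN (Mok2015.LeafSupport.cm l)) κtop).WeiNonvanishing ∧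
        (canon₁₀₅ νtop (Mok2015.LeafSupport.mkN (Mok2015.LeafSupport.cm l)) κtop).TsuzukiNonvanishing ∧ (canon₁₀₅ νtop (Mok2015.LeafSupport.mkN (Mok2015.LeafSupport.cm l)) κtop).HYtheta) :=
  have cmod := Mok2015.LeafSupport.countermodel l
  have nm := not_M_cm l
  have b : ∀ N, νtop.Everything N := bookInputs_top.everything
  ⟨cmod.2.2.1, canon_implications₁₀₅W _ _ _ _ _ _, ⟨fun h => nm h.2.1, fun h => nm h.1, fun h => nm h.2.1⟩, ⟨True.intro, b, b, ⟨b, True.intro, True.intro⟩⟩⟩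

/-- KMSW SIDE.  I (the import): with the book and Mok at the top and KMSW's Mok import DENIED (`κnoMok`: the proved scope fails at every rank) every edge holds; C265's Corollary 2, C266
and C267 FAIL (C26 reads KMSW's proved scope; C226's Theorem 1.2 reads it through rows C67 / C24) while C268, C269, C270 HOLD.  II (the sequels are NOT in the support): in KMSW's
countermodel of ANY leaf feeding only the starred statements in full (`l.onlyFull = true`: the unwritten sequels and `AubertSS`) the proved scope holds and C265's Corollary 2,
C266 and C267 HOLD.  III: in every KMSW leaf countermodel the four book-side statements hold. [cite: Nelson2023SpectralAspect, proof of Cor. 2; Dimitrakopoulou2026Anticyclotomic, §5; HuaMiao2025Decorrelation, §3; BeuzartplessisChaudouardZydor2022, §10.3 (bookkeeping proved here)] [claim: KalethaMinguezShinWhite2014, under-review] -/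
theorem c105_kmsw (l' : KMSW2014.LeafSupport.Leaf) :
    ((∀ N, ¬ κnoMok.Scope N) ∧
        Implications105 νtop (canon₂ νtop μtop κnoMok) (canon₆₇ νtop μtop κnoMok) (canon₈₉W νtop μtop (canon νtop μtop κnoMok) (canon₈no νtop μtop) (canon₃₄ μtop κnoMok)) (canon₁₀₅ νtop μtop κnoMok) ∧
        (¬ (canon₁₀₅ νtop μtop κnoMok).NelsonSubconvex ∧ ¬ (canon₁₀₅ νtop μtop κnoMok).DimitrakopoulouPadicL ∧ ¬ (canon₁₀₅ νtop μtop κnoMok).HMdecorrelation) ∧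
        ((canon₁₀₅ νtop μtop κnoMok).WeiNonvanishing ∧ (canon₁₀₅ νtop μtop κnoMok).TsuzukiNonvanishing ∧ (canon₁₀₅ νtop μtop κnoMok).HYtheta)) ∧
      (l'.onlyFull = true →
        (canon₁₀₅ νtop μtop (KMSW2014.LeafSupport.mkN (KMSW2014.LeafSupport.cm l'))).NelsonSubconvex ∧ (canon₁₀₅ νtop μtop (KMSW2014.LeafSupport.mkN (KMSW2014.LeafSupport.cm l'))).DimitrakopoulouPadicL ∧
          (canon₁₀₅ νtop μtop (KMSW2014.LeafSupport.mkN (KMSW2014.LeafSupport.cm l'))).HMdecorrelation) ∧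
      ((canon₁₀₅ νtop μtop (KMSW2014.LeafSupport.mkN (KMSW2014.LeafSupport.cm l'))).WeiNonvanishing ∧ (canon₁₀₅ νtop μtop (KMSW2014.LeafSupport.mkN (KMSW2014.LeafSupport.cm l'))).TsuzukiNonvanishing ∧
        (canon₁₀₅ νtop μtop (KMSW2014.LeafSupport.mkN (KMSW2014.LeafSupport.cm l'))).HYtheta) :=
  have ns : ∀ N, ¬ κnoMok.Scope N := κnoMok_facts.2.2.2.2.2.1
  have b : ∀ N, νtop.Everything N := bookInputs_top.everything
  have m : ∀ N, μtop.Everything N := mokInputs_top.everything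
  ⟨⟨ns, canon_implications₁₀₅W _ _ _ _ _ _, ⟨fun h => ns 0 (h.2.2 0), fun h => ns 0 (h.2 0), fun h => ns 0 (h.2.2.2.2 0)⟩, ⟨b, b, ⟨b, True.intro, True.intro⟩⟩⟩,
    fun hl =>
      have s : ∀ N, (KMSW2014.LeafSupport.mkN (KMSW2014.LeafSupport.cm l')).Scope N := scope_of_onlyFull l' hl
      ⟨⟨True.intro, m, s⟩, ⟨m, s⟩, ⟨b, m, ⟨m, s, ⟨m, s⟩⟩, ⟨m, s⟩⟩⟩,
    ⟨b, b, ⟨b, True.intro, True.intro⟩⟩⟩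

/-- THE HUNDRED-AND-FIFTH TRANCHE REGRADED, in one statement: (i) at the top (nodes granted) all seven statements hold; (ii) in the book countermodel of ANY leaf the three Böcherer
consumers and C270's Theorem 1.2 fail while C265 / C266 hold; (iii) C26 denied: C265's Corollary 2 and C266 fail, C265's Theorem 1 holds; C41 denied: C267 – C269 fail; C226's
Theorem 1.2 denied: only C267 fails; (iv) a node of C270 denied: only its Theorem 1.2 fails; (v) in every Mok countermodel and (vi) with KMSW's Mok import denied C265's Corollary 2,
C266 and C267 fail, the book-side rows hold; in KMSW's only-full leaf countermodels the three unitary-supported statements hold.  Supports: ∅ for `NelsonBranching`; Mok 29 ∪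
KMSW's import for `NelsonSubconvex`, `DimitrakopoulouPadicL` (through C26; NO book leaf); book 24 for `WeiNonvanishing`, `TsuzukiNonvanishing` (through C41); book 24 ∪ Mok 29 ∪
KMSW's import for `HMdecorrelation` (through C41 and C226); book 24 ∪ {(JL), (Böch)} for `HYtheta`. [cite: Nelson2023SpectralAspect, Thm 1, Cor. 2; Dimitrakopoulou2026Anticyclotomic, Thms 1.1-1.2; HuaMiao2025Decorrelation, Thm 1.1; Wei2023PoincareSpinor, Cor. 1.3; Tsuzuki2020WeightedEquidistribution, Cor. 1.5; HsiehYamana2024BesselPeriods, Thm 1.2 (bookkeeping proved here)] [claim: KalethaMinguezShinWhite2014, under-review] -/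
theorem c105_regraded :
    ((canon₁₀₅ νtop μtop κtop).NelsonBranching ∧ ((canon₁₀₅ νtop μtop κtop).NelsonSubconvex ∧ (canon₁₀₅ νtop μtop κtop).DimitrakopoulouPadicL) ∧
        ((canon₁₀₅ νtop μtop κtop).HMdecorrelation ∧ (canon₁₀₅ νtop μtop κtop).WeiNonvanishing ∧ (canon₁₀₅ νtop μtop κtop).TsuzukiNonvanishing) ∧ (canon₁₀₅ νtop μtop κtop).HYtheta) ∧
      (∀ l : LeafSupport.Leaf, ¬ (LeafSupport.mkN (LeafSupport.cm l)).leaf l ∧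
        ¬ (canon₁₀₅ (LeafSupport.mkN (LeafSupport.cm l)) μtop κtop).HMdecorrelation ∧ ¬ (canon₁₀₅ (LeafSupport.mkN (LeafSupport.cm l)) μtop κtop).WeiNonvanishing ∧
        ¬ (canon₁₀₅ (LeafSupport.mkN (LeafSupport.cm l)) μtop κtop).TsuzukiNonvanishing ∧ ¬ (canon₁₀₅ (LeafSupport.mkN (LeafSupport.cm l)) μtop κtop).HYtheta ∧
        (canon₁₀₅ (LeafSupport.mkN (LeafSupport.cm l)) μtop κtop).NelsonSubconvex ∧ (canon₁₀₅ (LeafSupport.mkN (LeafSupport.cm l)) μtop κtop).DimitrakopoulouPadicL) ∧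
      (¬ (canon₁₀₅W νtop c₂noIINH (canon₆₇ νtop μtop κtop) (canon₈₉W νtop μtop (canon νtop μtop κtop) (canon₈no νtop μtop) (canon₃₄ μtop κtop)) True True).NelsonSubconvex ∧
        ¬ (canon₁₀₅W νtop c₂noIINH (canon₆₇ νtop μtop κtop) (canon₈₉W νtop μtop (canon νtop μtop κtop) (canon₈no νtop μtop) (canon₃₄ μtop κtop)) True True).DimitrakopoulouPadicL ∧
        (canon₁₀₅W νtop c₂noIINH (canon₆₇ νtop μtop κtop) (canon₈₉W νtop μtop (canon νtop μtop κtop) (canon₈no νtop μtop) (canon₃₄ μtop κtop)) True True).NelsonBranching ∧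
        ¬ (canon₁₀₅W νtop (canon₂ νtop μtop κtop) c₆₇noFM (canon₈₉W νtop μtop (canon νtop μtop κtop) (canon₈no νtop μtop) (canon₃₄ μtop κtop)) True True).HMdecorrelation ∧
        ¬ (canon₁₀₅W νtop (canon₂ νtop μtop κtop) c₆₇noFM (canon₈₉W νtop μtop (canon νtop μtop κtop) (canon₈no νtop μtop) (canon₃₄ μtop κtop)) True True).WeiNonvanishing ∧
        ¬ (canon₁₀₅W νtop (canon₂ νtop μtop κtop) c₆₇noFM (canon₈₉W νtop μtop (canon νtop μtop κtop) (canon₈no νtop μtop) (canon₃₄ μtop κtop)) True True).TsuzukiNonvanishing ∧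
        ¬ (canon₁₀₅W νtop (canon₂ νtop μtop κtop) (canon₆₇ νtop μtop κtop) c₈₉noR True True).HMdecorrelation ∧
        (canon₁₀₅W νtop (canon₂ νtop μtop κtop) (canon₆₇ νtop μtop κtop) c₈₉noR True True).WeiNonvanishing) ∧
      (¬ (canon₁₀₅W νtop (canon₂ νtop μtop κtop) (canon₆₇ νtop μtop κtop) (canon₈₉W νtop μtop (canon νtop μtop κtop) (canon₈no νtop μtop) (canon₃₄ μtop κtop)) False True).HYtheta ∧
        ¬ (canon₁₀₅W νtop (canon₂ νtop μtop κtop) (canon₆₇ νtop μtop κtop) (canon₈₉W νtop μtop (canon νtop μtop κtop) (canon₈no νtop μtop) (canon₃₄ μtop κtop)) True False).HYtheta) ∧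
      (∀ l : Mok2015.LeafSupport.Leaf, ¬ (Mok2015.LeafSupport.mkN (Mok2015.LeafSupport.cm l)).leaf l ∧
        ¬ (canon₁₀₅ νtop (Mok2015.LeafSupport.mkN (Mok2015.LeafSupport.cm l)) κtop).NelsonSubconvex ∧ ¬ (canon₁₀₅ νtop (Mok2015.LeafSupport.mkN (Mok2015.LeafSupport.cm l)) κtop).HMdecorrelation ∧
        (canon₁₀₅ νtop (Mok2015.LeafSupport.mkN (Mok2015.LeafSupport.cm l)) κtop).WeiNonvanishing ∧ (canon₁₀₅ νtop (Mok2015.LeafSupport.mkN (Mok2015.LeafSupport.cm l)) κtop).HYtheta) ∧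
      ((∀ N, ¬ κnoMok.Scope N) ∧ ¬ (canon₁₀₅ νtop μtop κnoMok).NelsonSubconvex ∧ ¬ (canon₁₀₅ νtop μtop κnoMok).HMdecorrelation ∧ (canon₁₀₅ νtop μtop κnoMok).TsuzukiNonvanishing ∧
        ∀ l' : KMSW2014.LeafSupport.Leaf, l'.onlyFull = true →
          (canon₁₀₅ νtop μtop (KMSW2014.LeafSupport.mkN (KMSW2014.LeafSupport.cm l'))).NelsonSubconvex ∧ (canon₁₀₅ νtop μtop (KMSW2014.LeafSupport.mkN (KMSW2014.LeafSupport.cm l'))).HMdecorrelation) :=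
  have ⟨⟨_, aB, aN, aD, _, _, _⟩, ⟨_, bH, bW, bT, _, _, _⟩, ⟨_, cH, cW, _, _⟩⟩ := c105_rows_denied_top
  have ⟨⟨_, dJ, _, _⟩, ⟨_, dB, _, _⟩⟩ := c105_nodes_denied_top
  have k := c105_kmsw .MokMain
  ⟨hundredfifth_holds_top,
    fun l => have h := c105_book_cm l
      ⟨h.2.2.1, h.2.2.2.2.1.1, h.2.2.2.2.1.2.1, h.2.2.2.2.1.2.2.1, h.2.2.2.2.1.2.2.2, h.2.2.2.2.2.2.1, h.2.2.2.2.2.2.2⟩,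
    ⟨aN, aD, aB, bH, bW, bT, cH, cW⟩,
    ⟨dJ, dB⟩,
    fun l => have h := c105_mok_cm l
      ⟨h.1, h.2.2.1.1, h.2.2.1.2.2, h.2.2.2.2.1, h.2.2.2.2.2.2⟩,
    ⟨k.1.1, k.1.2.2.1.1, k.1.2.2.1.2.2, k.1.2.2.2.2.1, fun l' hl => have h := (c105_kmsw l').2.1 hl
      ⟨h.1, h.2.2⟩⟩⟩

/-! ## 109. Hundred-and-sixth tranche (v2 of this file, after `Downstream31.lean` v4; unit `pub-arthur-down-g41`): supports of THE BÖCHERER-FORMULA APPLIERS, second batch —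
C271 `KTequidist` (⇐ book by name) / `KTnonvanishing` (⇐ it ∧ C41 ∧ C226), C272 `CMSfourier` (⇐ C44 ∧ C226) / `CMSsupnorm` (⇐ it); see the module docstring for the summary of
what is certified. -/

section Canon106

variable (ν : Nodes) (μ : Mok2015.Nodes) (κ : KMSW2014.Nodes)

/-- The parametrised canonical reading of the hundred-and-sixth tranche: ν and the assignments `c₂₁`, `c₆₇`, `c₈₉` of tranches 21 / 67 / 89 are the parameters; C271's Theorem 1.2 := the book at all ranks; C271's Corollary 1.3 := book ∧ C41 ∧ C226; C272's Theorem 1.1 := C44 ∧ C226; C272's Corollary 1.2 / Theorem 1.3 := the same conjunction (its only premise is Theorem 1.1). [cite: KugaTsuzuki2024SpectralAverage, Thm 1.2, Cor. 1.3; ComtatMarzecballesterosSaha2025, Thm 1.1, Cor. 1.2, Thm 1.3 (canonical model; bookkeeping)] -/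
abbrev canon₁₀₆W (c₂₁ : Consumers21) (c₆₇ : Consumers67) (c₈₉ : Consumers89) : Consumers106 where
  KTequidist := ∀ N, ν.Everything N
  KTnonvanishing := (∀ N, ν.Everything N) ∧ c₆₇.FMBessel ∧ c₈₉.FMrefined
  CMSfourier := c₂₁.PaulSaha ∧ c₈₉.FMrefined
  CMSsupnorm := c₂₁.PaulSaha ∧ c₈₉.FMrefined

/-- The canonical instance over section 25's `canon₂₁` (itself over `canon₁₉`, `canon₂₀`), section 70's `canon₆₇` and section 92's `canon₈₉W` over `canon` / `canon₈no` / `canon₃₄` (as in sections 107 / 108): there C44 := book ∧ C180 ∧ C182 (each := book), C41 := the book at all ranks, C226 := Mok ∧ C67's value ∧ C24's value. [cite: KugaTsuzuki2024SpectralAverage, Cor. 1.3; ComtatMarzecballesterosSaha2025, Thm 1.1 (canonical model; bookkeeping)] -/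
abbrev canon₁₀₆ : Consumers106 := canon₁₀₆W ν (canon₂₁ ν μ κ) (canon₆₇ ν μ κ) (canon₈₉W ν μ (canon ν μ κ) (canon₈no ν μ) (canon₃₄ μ κ))

/-- Every hundred-and-sixth-tranche edge holds in the parametrised reading, for EVERY ν and every assignment of tranches 21 / 67 / 89. [cite: KugaTsuzuki2024SpectralAverage, Thm 1.2, Cor. 1.3; ComtatMarzecballesterosSaha2025, Thm 1.1, Cor. 1.2, Thm 1.3 (bookkeeping proved here)] -/
theorem canon_implications₁₀₆W (c₂₁ : Consumers21) (c₆₇ : Consumers67) (c₈₉ : Consumers89) : Implications106 ν c₂₁ c₆₇ c₈₉ (canon₁₀₆W ν c₂₁ c₆₇ c₈₉) where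
  ktE := fun b => b
  ktN := fun b a r => ⟨b, a, r⟩
  cmsF := fun p r => ⟨p, r⟩
  cmsS := fun f => f

/-- Every hundred-and-sixth-tranche edge holds in the canonical instance, for arbitrary ν, μ, κ. [cite: KugaTsuzuki2024SpectralAverage, Cor. 1.3; ComtatMarzecballesterosSaha2025, Thm 1.1 (bookkeeping proved here)] -/
theorem canon_implications₁₀₆ : Implications106 ν (canon₂₁ ν μ κ) (canon₆₇ ν μ κ) (canon₈₉W ν μ (canon ν μ κ) (canon₈no ν μ) (canon₃₄ μ κ)) (canon₁₀₆ ν μ κ) :=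
  canon_implications₁₀₆W _ _ _ _

/-- In the parametrised reading all four fields hold as soon as the book holds at all ranks, row C44 holds, row C41 holds and C226's Theorem 1.2 holds — through the tranche's own `ktNonvanishing_of_rows` and `cms_of_rows`. [cite: KugaTsuzuki2024SpectralAverage, Thm 1.2, Cor. 1.3; ComtatMarzecballesterosSaha2025, Thm 1.1, Thm 1.3 (bookkeeping proved here)] -/
theorem c106_all_of (c₂₁ : Consumers21) (c₆₇ : Consumers67) (c₈₉ : Consumers89) (hν : ∀ N, ν.Everything N) (h₄₄ : c₂₁.PaulSaha) (h₄₁ : c₆₇.FMBessel) (hR : c₈₉.FMrefined) :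
    ((canon₁₀₆W ν c₂₁ c₆₇ c₈₉).KTequidist ∧ (canon₁₀₆W ν c₂₁ c₆₇ c₈₉).KTnonvanishing) ∧ ((canon₁₀₆W ν c₂₁ c₆₇ c₈₉).CMSfourier ∧ (canon₁₀₆W ν c₂₁ c₆₇ c₈₉).CMSsupnorm) :=
  have X := canon_implications₁₀₆W ν c₂₁ c₆₇ c₈₉
  ⟨⟨ktEquidist_of_book X hν, ktNonvanishing_of_rows X hν h₄₁ hR⟩, cms_of_rows X h₄₄ hR⟩

end Canon106

/-- At the top (every input of the three DAGs; the Chapter-9 leaf denied in section 92's reading of C226, which this tranche does not use) all four fields hold — through the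
tranche's own `hundredsixth_of_inputs` fed by section 25's `canon_implications₂₁` / `canon_implications₂₀` / `canon_implications₁₉`, section 70's `canon_implications₆₇`, and
by section 92's `canon_implications₈₉W` and tranche 34's `canon_implications₃₄`. [cite: KugaTsuzuki2024SpectralAverage, Thm 1.2, Cor. 1.3; ComtatMarzecballesterosSaha2025, Thm 1.1, Thm 1.3 (bookkeeping proved here)] [claim: KalethaMinguezShinWhite2014, under-review] -/
theorem hundredsixth_holds_top :
    ((canon₁₀₆ νtop μtop κtop).KTequidist ∧ (canon₁₀₆ νtop μtop κtop).KTnonvanishing) ∧ ((canon₁₀₆ νtop μtop κtop).CMSfourier ∧ (canon₁₀₆ νtop μtop κtop).CMSsupnorm) :=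
  hundredsixth_of_inputs (canon_implications₁₀₆ νtop μtop κtop) (canon_implications₂₁ νtop μtop κtop) (canon_implications₂₀ νtop μtop κtop) (canon_implications₁₉ νtop μtop κtop)
    (canon_implications₆₇ νtop μtop κtop) (canon_implications₈₉W νtop μtop (canon νtop μtop κtop) (canon₈no νtop μtop) (canon₃₄ μtop κtop)) (canon_implications₃₄ νtop μtop κtop)
    bookInputs_top mokInputs_top (kmswInputs_top μtop).1

/-- BOOK SIDE, EXACT SUPPORT: in each of the 24 book countermodels (Mok and KMSW at the top; tranches 1 / 19 / 20 / 21 / 67 / 89 / 106 read canonically over it, ALL the edges of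
tranches 1 / 19 / 20 / 21 / 67 / 106 valid) ALL FOUR typed statements FAIL — every book leaf is load-bearing: by name for C271's Theorem 1.2 ([read: due to Arthur [Arthur]]), by
name and through C41 for its Corollary 1.3, through C44 ([read: see, e.g., Proposition 2.3.1 of [ps22]]) for C272 — while the two typed PREMISES read through Mok hold there
(C226's Theorem 1.2 reads Mok ∧ KMSW-scope ∧ …; shown for contrast). [cite: KugaTsuzuki2024SpectralAverage, §6.5 (ii); ComtatMarzecballesterosSaha2025, §3.1, §3.3; with PaulSaha2022 Prop. 2.3.1, FurusawaMorimoto2021Bessel §1 and Arthur2013 §1.5 (bookkeeping proved here)] -/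
theorem c106_book_cm (l : LeafSupport.Leaf) :
    LeafSupport.Systems (LeafSupport.mkN (LeafSupport.cm l)) (LeafSupport.mkW (LeafSupport.cm l)) (LeafSupport.mkG (LeafSupport.cm l)) ∧
      (∀ l', l' ≠ l → (LeafSupport.mkN (LeafSupport.cm l)).leaf l') ∧ ¬ (LeafSupport.mkN (LeafSupport.cm l)).leaf l ∧
      (Implications (LeafSupport.mkN (LeafSupport.cm l)) μtop κtop (canon (LeafSupport.mkN (LeafSupport.cm l)) μtop κtop) ∧
        Implications19 (LeafSupport.mkN (LeafSupport.cm l)) μtop κtop (canon₁₉ (LeafSupport.mkN (LeafSupport.cm l)) μtop κtop) ∧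
        Implications20 (LeafSupport.mkN (LeafSupport.cm l)) (canon₁₉ (LeafSupport.mkN (LeafSupport.cm l)) μtop κtop) (canon₂₀ (LeafSupport.mkN (LeafSupport.cm l)) μtop κtop) ∧
        Implications21 (LeafSupport.mkN (LeafSupport.cm l)) (canon₁₉ (LeafSupport.mkN (LeafSupport.cm l)) μtop κtop) (canon₂₀ (LeafSupport.mkN (LeafSupport.cm l)) μtop κtop)
          (canon₂₁ (LeafSupport.mkN (LeafSupport.cm l)) μtop κtop) ∧
        Implications67 (LeafSupport.mkN (LeafSupport.cm l)) μtop κtop (canon (LeafSupport.mkN (LeafSupport.cm l)) μtop κtop) (canon₆ (LeafSupport.mkN (LeafSupport.cm l)) μtop)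
          (canon₈ (LeafSupport.mkN (LeafSupport.cm l)) μtop κtop) (canon₆₇ (LeafSupport.mkN (LeafSupport.cm l)) μtop κtop) ∧
        Implications106 (LeafSupport.mkN (LeafSupport.cm l)) (canon₂₁ (LeafSupport.mkN (LeafSupport.cm l)) μtop κtop) (canon₆₇ (LeafSupport.mkN (LeafSupport.cm l)) μtop κtop)
          (canon₈₉W (LeafSupport.mkN (LeafSupport.cm l)) μtop (canon (LeafSupport.mkN (LeafSupport.cm l)) μtop κtop) (canon₈no (LeafSupport.mkN (LeafSupport.cm l)) μtop) (canon₃₄ μtop κtop))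
          (canon₁₀₆ (LeafSupport.mkN (LeafSupport.cm l)) μtop κtop)) ∧
      (¬ (canon₁₀₆ (LeafSupport.mkN (LeafSupport.cm l)) μtop κtop).KTequidist ∧ ¬ (canon₁₀₆ (LeafSupport.mkN (LeafSupport.cm l)) μtop κtop).KTnonvanishing ∧
        ¬ (canon₁₀₆ (LeafSupport.mkN (LeafSupport.cm l)) μtop κtop).CMSfourier ∧ ¬ (canon₁₀₆ (LeafSupport.mkN (LeafSupport.cm l)) μtop κtop).CMSsupnorm) ∧
      (canon₈₉W (LeafSupport.mkN (LeafSupport.cm l)) μtop (canon (LeafSupport.mkN (LeafSupport.cm l)) μtop κtop) (canon₈no (LeafSupport.mkN (LeafSupport.cm l)) μtop) (canon₃₄ μtop κtop)).FMrefined :=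
  have cmod := LeafSupport.countermodel l
  have nb := not_B_cm l
  have m : ∀ N, μtop.Everything N := mokInputs_top.everything
  have s : ∀ N, κtop.Scope N := (kmswInputs_top μtop).1.scope mokInputs_top
  ⟨cmod.1, cmod.2.1, cmod.2.2.1,
    ⟨canon_implications _ _ _, canon_implications₁₉ _ _ _, canon_implications₂₀ _ _ _, canon_implications₂₁ _ _ _, canon_implications₆₇ _ _ _, canon_implications₁₀₆ _ _ _⟩,
    ⟨fun h => nb h, fun h => nb h.1, fun h => nb h.1.1, fun h => nb h.1.1⟩, ⟨m, ⟨m, s, ⟨m, s⟩⟩, ⟨m, s⟩⟩⟩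

/-- Row C44 DENIED (`PaulSaha := False`; the other tranche-21 fields as in `canon₂₁` at the top): a reading of `Consumers21` used only to deny Paul – Saha's Proposition 2.3.1; no tranche-21 edge is claimed for it (the readings `canon₂₁noC180` / `canon₂₁noC182` of section 25 deny it together with its conduits; here it is denied alone). [cite: PaulSaha2022, Prop. 2.3.1 (separating model; bookkeeping)] -/
abbrev c₂₁noPS : Consumers21 := { canon₂₁ νtop μtop κtop with PaulSaha := False }

/-- THE TYPED PREMISES ARE LOAD-BEARING EXACTLY AS TYPED (reading-level separation at the top): (a) C44 DENIED (`c₂₁noPS`) ⇒ C272's two statements FAIL, C271's two HOLD; (b) C41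
DENIED (section 108's `c₆₇noFM`) ⇒ only C271's Corollary 1.3 FAILS; (c) C226's Theorem 1.2 DENIED (section 108's `c₈₉noR`) ⇒ C271's Corollary 1.3 and C272's two statements FAIL,
C271's Theorem 1.2 HOLDS.  Every hundred-and-sixth edge holds over each denied assignment. [cite: KugaTsuzuki2024SpectralAverage, §6.5 (iii) ([FurusawaMorimoto1], [FurusawaMorimoto2] / [8]); ComtatMarzecballesterosSaha2025, §3.1 ([ps22]), §3.3 ([FM22]) (separating models; bookkeeping proved here)] -/
theorem c106_rows_denied_top :
    (Implications106 νtop c₂₁noPS (canon₆₇ νtop μtop κtop) (canon₈₉W νtop μtop (canon νtop μtop κtop) (canon₈no νtop μtop) (canon₃₄ μtop κtop))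
        (canon₁₀₆W νtop c₂₁noPS (canon₆₇ νtop μtop κtop) (canon₈₉W νtop μtop (canon νtop μtop κtop) (canon₈no νtop μtop) (canon₃₄ μtop κtop))) ∧
        ¬ (canon₁₀₆W νtop c₂₁noPS (canon₆₇ νtop μtop κtop) (canon₈₉W νtop μtop (canon νtop μtop κtop) (canon₈no νtop μtop) (canon₃₄ μtop κtop))).CMSfourier ∧
        ¬ (canon₁₀₆W νtop c₂₁noPS (canon₆₇ νtop μtop κtop) (canon₈₉W νtop μtop (canon νtop μtop κtop) (canon₈no νtop μtop) (canon₃₄ μtop κtop))).CMSsupnorm ∧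
        (canon₁₀₆W νtop c₂₁noPS (canon₆₇ νtop μtop κtop) (canon₈₉W νtop μtop (canon νtop μtop κtop) (canon₈no νtop μtop) (canon₃₄ μtop κtop))).KTequidist ∧
        (canon₁₀₆W νtop c₂₁noPS (canon₆₇ νtop μtop κtop) (canon₈₉W νtop μtop (canon νtop μtop κtop) (canon₈no νtop μtop) (canon₃₄ μtop κtop))).KTnonvanishing) ∧
      (Implications106 νtop (canon₂₁ νtop μtop κtop) c₆₇noFM (canon₈₉W νtop μtop (canon νtop μtop κtop) (canon₈no νtop μtop) (canon₃₄ μtop κtop))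
        (canon₁₀₆W νtop (canon₂₁ νtop μtop κtop) c₆₇noFM (canon₈₉W νtop μtop (canon νtop μtop κtop) (canon₈no νtop μtop) (canon₃₄ μtop κtop))) ∧
        ¬ (canon₁₀₆W νtop (canon₂₁ νtop μtop κtop) c₆₇noFM (canon₈₉W νtop μtop (canon νtop μtop κtop) (canon₈no νtop μtop) (canon₃₄ μtop κtop))).KTnonvanishing ∧
        (canon₁₀₆W νtop (canon₂₁ νtop μtop κtop) c₆₇noFM (canon₈₉W νtop μtop (canon νtop μtop κtop) (canon₈no νtop μtop) (canon₃₄ μtop κtop))).KTequidist ∧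
        (canon₁₀₆W νtop (canon₂₁ νtop μtop κtop) c₆₇noFM (canon₈₉W νtop μtop (canon νtop μtop κtop) (canon₈no νtop μtop) (canon₃₄ μtop κtop))).CMSfourier ∧
        (canon₁₀₆W νtop (canon₂₁ νtop μtop κtop) c₆₇noFM (canon₈₉W νtop μtop (canon νtop μtop κtop) (canon₈no νtop μtop) (canon₃₄ μtop κtop))).CMSsupnorm) ∧
      (Implications106 νtop (canon₂₁ νtop μtop κtop) (canon₆₇ νtop μtop κtop) c₈₉noR (canon₁₀₆W νtop (canon₂₁ νtop μtop κtop) (canon₆₇ νtop μtop κtop) c₈₉noR) ∧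
        ¬ (canon₁₀₆W νtop (canon₂₁ νtop μtop κtop) (canon₆₇ νtop μtop κtop) c₈₉noR).KTnonvanishing ∧
        ¬ (canon₁₀₆W νtop (canon₂₁ νtop μtop κtop) (canon₆₇ νtop μtop κtop) c₈₉noR).CMSfourier ∧
        ¬ (canon₁₀₆W νtop (canon₂₁ νtop μtop κtop) (canon₆₇ νtop μtop κtop) c₈₉noR).CMSsupnorm ∧
        (canon₁₀₆W νtop (canon₂₁ νtop μtop κtop) (canon₆₇ νtop μtop κtop) c₈₉noR).KTequidist) :=
  have b : ∀ N, νtop.Everything N := bookInputs_top.everything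
  have m : ∀ N, μtop.Everything N := mokInputs_top.everything
  have s : ∀ N, κtop.Scope N := (kmswInputs_top μtop).1.scope mokInputs_top
  have r : (∀ N, μtop.Everything N) ∧ (canon₃₄ μtop κtop).FurusawaMorimoto ∧ (canon₃₄ μtop κtop).BPlocalGGP := ⟨m, ⟨m, s, ⟨m, s⟩⟩, ⟨m, s⟩⟩
  have p : (canon₂₁ νtop μtop κtop).PaulSaha := ⟨b, b, ⟨b, b⟩⟩
  ⟨⟨canon_implications₁₀₆W _ _ _ _, fun h => h.1, fun h => h.1, b, ⟨b, b, r⟩⟩,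
    ⟨canon_implications₁₀₆W _ _ _ _, fun h => h.2.1, b, ⟨p, r⟩, ⟨p, r⟩⟩,
    ⟨canon_implications₁₀₆W _ _ _ _, fun h => h.2.2, fun h => h.2, fun h => h.2, b⟩⟩

/-- MOK SIDE: in the Mok countermodel of ANY leaf `l` (book and KMSW at the top; tranches 21 / 67 / 89 / 106 read over it) every hundred-and-sixth edge holds; C271's Corollary 1.3
and C272's two statements FAIL — through C226's Theorem 1.2 ([read: by Mok [82]]) — while C271's Theorem 1.2 and row C44 itself HOLD. [cite: KugaTsuzuki2024SpectralAverage, §6.5 (iii); ComtatMarzecballesterosSaha2025, §3.3; Mok2012, Thm 2.5.2; FurusawaMorimoto2024SO5, §7 (bookkeeping proved here)] -/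
theorem c106_mok_cm (l : Mok2015.LeafSupport.Leaf) :
    ¬ (Mok2015.LeafSupport.mkN (Mok2015.LeafSupport.cm l)).leaf l ∧
      Implications106 νtop (canon₂₁ νtop (Mok2015.LeafSupport.mkN (Mok2015.LeafSupport.cm l)) κtop) (canon₆₇ νtop (Mok2015.LeafSupport.mkN (Mok2015.LeafSupport.cm l)) κtop)
        (canon₈₉W νtop (Mok2015.LeafSupport.mkN (Mok2015.LeafSupport.cm l)) (canon νtop (Mok2015.LeafSupport.mkN (Mok2015.LeafSupport.cm l)) κtop) (canon₈no νtop (Mok2015.LeafSupport.mkN (Mok2015.LeafSupport.cm l))) (canon₃₄ (Mok2015.LeafSupport.mkN (Mok2015.LeafSupport.cm l)) κtop))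
        (canon₁₀₆ νtop (Mok2015.LeafSupport.mkN (Mok2015.LeafSupport.cm l)) κtop) ∧
      (¬ (canon₁₀₆ νtop (Mok2015.LeafSupport.mkN (Mok2015.LeafSupport.cm l)) κtop).KTnonvanishing ∧ ¬ (canon₁₀₆ νtop (Mok2015.LeafSupport.mkN (Mok2015.LeafSupport.cm l)) κtop).CMSfourier ∧
        ¬ (canon₁₀₆ νtop (Mok2015.LeafSupport.mkN (Mok2015.LeafSupport.cm l)) κtop).CMSsupnorm) ∧
      ((canon₁₀₆ νtop (Mok2015.LeafSupport.mkN (Mok2015.LeafSupport.cm l)) κtop).KTequidist ∧ (canon₂₁ νtop (Mok2015.LeafSupport.mkN (Mok2015.LeafSupport.cm l)) κtop).PaulSaha) :=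
  have cmod := Mok2015.LeafSupport.countermodel l
  have nm := not_M_cm l
  have b : ∀ N, νtop.Everything N := bookInputs_top.everything
  ⟨cmod.2.2.1, canon_implications₁₀₆W _ _ _ _, ⟨fun h => nm h.2.2.1, fun h => nm h.2.1, fun h => nm h.2.1⟩, ⟨b, ⟨b, b, ⟨b, b⟩⟩⟩⟩

/-- KMSW SIDE.  I (the import): with the book and Mok at the top and KMSW's Mok import DENIED (`κnoMok`: the proved scope fails at every rank) every edge holds; C271's Corollary 1.3
and C272's two statements FAIL (C226's Theorem 1.2 reads KMSW's proved scope through rows C67 / C24) while C271's Theorem 1.2 HOLDS.  II (the sequels are NOT in the support): in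
KMSW's countermodel of ANY leaf feeding only the starred statements in full (`l.onlyFull = true`: the unwritten sequels and `AubertSS`) the proved scope holds and the three
C226-supported statements HOLD.  III: in every KMSW leaf countermodel C271's Theorem 1.2 holds. [cite: KugaTsuzuki2024SpectralAverage, §6.5; ComtatMarzecballesterosSaha2025, §3.3; FurusawaMorimoto2024SO5, §7 (bookkeeping proved here)] [claim: KalethaMinguezShinWhite2014, under-review] -/
theorem c106_kmsw (l' : KMSW2014.LeafSupport.Leaf) :
    ((∀ N, ¬ κnoMok.Scope N) ∧
        Implications106 νtop (canon₂₁ νtop μtop κnoMok) (canon₆₇ νtop μtop κnoMok) (canon₈₉W νtop μtop (canon νtop μtop κnoMok) (canon₈no νtop μtop) (canon₃₄ μtop κnoMok)) (canon₁₀₆ νtop μtop κnoMok) ∧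
        (¬ (canon₁₀₆ νtop μtop κnoMok).KTnonvanishing ∧ ¬ (canon₁₀₆ νtop μtop κnoMok).CMSfourier ∧ ¬ (canon₁₀₆ νtop μtop κnoMok).CMSsupnorm) ∧
        (canon₁₀₆ νtop μtop κnoMok).KTequidist) ∧
      (l'.onlyFull = true →
        (canon₁₀₆ νtop μtop (KMSW2014.LeafSupport.mkN (KMSW2014.LeafSupport.cm l'))).KTnonvanishing ∧ (canon₁₀₆ νtop μtop (KMSW2014.LeafSupport.mkN (KMSW2014.LeafSupport.cm l'))).CMSfourier ∧
          (canon₁₀₆ νtop μtop (KMSW2014.LeafSupport.mkN (KMSW2014.LeafSupport.cm l'))).CMSsupnorm) ∧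
      (canon₁₀₆ νtop μtop (KMSW2014.LeafSupport.mkN (KMSW2014.LeafSupport.cm l'))).KTequidist :=
  have ns : ∀ N, ¬ κnoMok.Scope N := κnoMok_facts.2.2.2.2.2.1
  have b : ∀ N, νtop.Everything N := bookInputs_top.everything
  have m : ∀ N, μtop.Everything N := mokInputs_top.everything
  ⟨⟨ns, canon_implications₁₀₆W _ _ _ _, ⟨fun h => ns 0 (h.2.2.2.2.2 0), fun h => ns 0 (h.2.2.2.2 0), fun h => ns 0 (h.2.2.2.2 0)⟩, b⟩,
    fun hl =>
      have s : ∀ N, (KMSW2014.LeafSupport.mkN (KMSW2014.LeafSupport.cm l')).Scope N := scope_of_onlyFull l' hl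
      have r : (∀ N, μtop.Everything N) ∧ (canon₃₄ μtop (KMSW2014.LeafSupport.mkN (KMSW2014.LeafSupport.cm l'))).FurusawaMorimoto ∧
          (canon₃₄ μtop (KMSW2014.LeafSupport.mkN (KMSW2014.LeafSupport.cm l'))).BPlocalGGP := ⟨m, ⟨m, s, ⟨m, s⟩⟩, ⟨m, s⟩⟩
      have p : (canon₂₁ νtop μtop (KMSW2014.LeafSupport.mkN (KMSW2014.LeafSupport.cm l'))).PaulSaha := ⟨b, b, ⟨b, b⟩⟩
      ⟨⟨b, b, r⟩, ⟨p, r⟩, ⟨p, r⟩⟩,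
    b⟩

/-- THE HUNDRED-AND-SIXTH TRANCHE REGRADED, in one statement: (i) at the top all four statements hold; (ii) in the book countermodel of ANY leaf all four fail; (iii) C44 denied:
C272's two statements fail, C271's hold; C41 denied: only C271's Corollary 1.3 fails; C226's Theorem 1.2 denied: everything but C271's Theorem 1.2 fails; (iv) in every Mok
countermodel and (v) with KMSW's Mok import denied C271's Corollary 1.3 and C272's two statements fail while C271's Theorem 1.2 holds; in KMSW's only-full leaf countermodels
the three C226-supported statements hold.  Supports: book 24 for `KTequidist` (by name); book 24 ∪ Mok 29 ∪ KMSW's Mok import for `KTnonvanishing` (by name, through C41 and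
through C226), for `CMSfourier` and for `CMSsupnorm` (through C44 and C226); no KMSW sequel in any support. [cite: KugaTsuzuki2024SpectralAverage, Thm 1.2, Cor. 1.3; ComtatMarzecballesterosSaha2025, Thm 1.1, Cor. 1.2, Thm 1.3 (bookkeeping proved here)] [claim: KalethaMinguezShinWhite2014, under-review] -/
theorem c106_regraded :
    (((canon₁₀₆ νtop μtop κtop).KTequidist ∧ (canon₁₀₆ νtop μtop κtop).KTnonvanishing) ∧ ((canon₁₀₆ νtop μtop κtop).CMSfourier ∧ (canon₁₀₆ νtop μtop κtop).CMSsupnorm)) ∧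
      (∀ l : LeafSupport.Leaf, ¬ (LeafSupport.mkN (LeafSupport.cm l)).leaf l ∧
        ¬ (canon₁₀₆ (LeafSupport.mkN (LeafSupport.cm l)) μtop κtop).KTequidist ∧ ¬ (canon₁₀₆ (LeafSupport.mkN (LeafSupport.cm l)) μtop κtop).KTnonvanishing ∧
        ¬ (canon₁₀₆ (LeafSupport.mkN (LeafSupport.cm l)) μtop κtop).CMSfourier ∧ ¬ (canon₁₀₆ (LeafSupport.mkN (LeafSupport.cm l)) μtop κtop).CMSsupnorm) ∧
      (¬ (canon₁₀₆W νtop c₂₁noPS (canon₆₇ νtop μtop κtop) (canon₈₉W νtop μtop (canon νtop μtop κtop) (canon₈no νtop μtop) (canon₃₄ μtop κtop))).CMSfourier ∧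
        ¬ (canon₁₀₆W νtop c₂₁noPS (canon₆₇ νtop μtop κtop) (canon₈₉W νtop μtop (canon νtop μtop κtop) (canon₈no νtop μtop) (canon₃₄ μtop κtop))).CMSsupnorm ∧
        (canon₁₀₆W νtop c₂₁noPS (canon₆₇ νtop μtop κtop) (canon₈₉W νtop μtop (canon νtop μtop κtop) (canon₈no νtop μtop) (canon₃₄ μtop κtop))).KTnonvanishing ∧
        ¬ (canon₁₀₆W νtop (canon₂₁ νtop μtop κtop) c₆₇noFM (canon₈₉W νtop μtop (canon νtop μtop κtop) (canon₈no νtop μtop) (canon₃₄ μtop κtop))).KTnonvanishing ∧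
        (canon₁₀₆W νtop (canon₂₁ νtop μtop κtop) c₆₇noFM (canon₈₉W νtop μtop (canon νtop μtop κtop) (canon₈no νtop μtop) (canon₃₄ μtop κtop))).CMSfourier ∧
        ¬ (canon₁₀₆W νtop (canon₂₁ νtop μtop κtop) (canon₆₇ νtop μtop κtop) c₈₉noR).KTnonvanishing ∧
        ¬ (canon₁₀₆W νtop (canon₂₁ νtop μtop κtop) (canon₆₇ νtop μtop κtop) c₈₉noR).CMSfourier ∧
        (canon₁₀₆W νtop (canon₂₁ νtop μtop κtop) (canon₆₇ νtop μtop κtop) c₈₉noR).KTequidist) ∧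
      (∀ l : Mok2015.LeafSupport.Leaf, ¬ (Mok2015.LeafSupport.mkN (Mok2015.LeafSupport.cm l)).leaf l ∧
        ¬ (canon₁₀₆ νtop (Mok2015.LeafSupport.mkN (Mok2015.LeafSupport.cm l)) κtop).KTnonvanishing ∧ ¬ (canon₁₀₆ νtop (Mok2015.LeafSupport.mkN (Mok2015.LeafSupport.cm l)) κtop).CMSfourier ∧
        (canon₁₀₆ νtop (Mok2015.LeafSupport.mkN (Mok2015.LeafSupport.cm l)) κtop).KTequidist) ∧
      ((∀ N, ¬ κnoMok.Scope N) ∧ ¬ (canon₁₀₆ νtop μtop κnoMok).KTnonvanishing ∧ ¬ (canon₁₀₆ νtop μtop κnoMok).CMSfourier ∧ (canon₁₀₆ νtop μtop κnoMok).KTequidist ∧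
        ∀ l' : KMSW2014.LeafSupport.Leaf, l'.onlyFull = true →
          (canon₁₀₆ νtop μtop (KMSW2014.LeafSupport.mkN (KMSW2014.LeafSupport.cm l'))).KTnonvanishing ∧ (canon₁₀₆ νtop μtop (KMSW2014.LeafSupport.mkN (KMSW2014.LeafSupport.cm l'))).CMSfourier) :=
  have ⟨⟨_, aF, aS, _, aN⟩, ⟨_, bN, _, bF, _⟩, ⟨_, cN, cF, _, cE⟩⟩ := c106_rows_denied_top
  have k := c106_kmsw .MokMain
  ⟨hundredsixth_holds_top,
    fun l => have h := c106_book_cm l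
      ⟨h.2.2.1, h.2.2.2.2.1.1, h.2.2.2.2.1.2.1, h.2.2.2.2.1.2.2.1, h.2.2.2.2.1.2.2.2⟩,
    ⟨aF, aS, aN, bN, bF, cN, cF, cE⟩,
    fun l => have h := c106_mok_cm l
      ⟨h.1, h.2.2.1.1, h.2.2.1.2.1, h.2.2.2.1⟩,
    ⟨k.1.1, k.1.2.2.1.1, k.1.2.2.1.2.1, k.1.2.2.2, fun l' hl => have h := (c106_kmsw l').2.1 hl
      ⟨h.1, h.2.1⟩⟩⟩

/-! ## 110. Hundred-and-seventh tranche (v3 of this file, after NEW `Downstream32.lean` v1 — hence `import …Downstream32`; unit `pub-arthur-down-g42`): supports of the two new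
nodes — row C226's `FMggpEquiv` (Corollary 1.1 ⇐ the row's Theorem 1.2 = `Consumers89.FMrefined`) and row C271's `KTrationality` (Corollary 1.4 of v2 ⇐ the book by name ∧
`FMggpEquiv`); see the module docstring for the summary of what is certified. -/

section Canon107

variable (ν : Nodes) (μ : Mok2015.Nodes) (κ : KMSW2014.Nodes)

/-- The parametrised canonical reading of the hundred-and-seventh tranche: ν and the assignment `c₈₉` of tranche 89 are the parameters; C226's Corollary 1.1 := the value of C226's Theorem 1.2; C271's Corollary 1.4 := the book at all ranks ∧ that value. [cite: FurusawaMorimoto2024SO5, Cor. 1.1; KugaTsuzuki2024SpectralAverage, Cor. 1.4 (canonical model; bookkeeping)] -/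
abbrev canon₁₀₇W (c₈₉ : Consumers89) : Consumers107 where
  FMggpEquiv := c₈₉.FMrefined
  KTrationality := (∀ N, ν.Everything N) ∧ c₈₉.FMrefined

/-- The canonical instance over section 92's `canon₈₉W` over `canon` / `canon₈no` / `canon₃₄` (as in sections 107 – 109): there C226's Theorem 1.2 := Mok ∧ C67's value ∧ C24's value, each of these := Mok at all ranks ∧ KMSW's proved scope. [cite: FurusawaMorimoto2024SO5, Cor. 1.1, Thm 1.2 (canonical model; bookkeeping)] -/
abbrev canon₁₀₇ : Consumers107 := canon₁₀₇W ν (canon₈₉W ν μ (canon ν μ κ) (canon₈no ν μ) (canon₃₄ μ κ))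

/-- Both hundred-and-seventh-tranche edges hold in the parametrised reading, for EVERY ν and every assignment of tranche 89. [cite: FurusawaMorimoto2024SO5, Cor. 1.1; KugaTsuzuki2024SpectralAverage, Cor. 1.4 (bookkeeping proved here)] -/
theorem canon_implications₁₀₇W (c₈₉ : Consumers89) : Implications107 ν c₈₉ (canon₁₀₇W ν c₈₉) where
  ggp := fun r => r
  ktR := fun b g => ⟨b, g⟩

/-- Both edges hold in the canonical instance, for arbitrary ν, μ, κ. [cite: FurusawaMorimoto2024SO5, Cor. 1.1; KugaTsuzuki2024SpectralAverage, Cor. 1.4 (bookkeeping proved here)] -/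
theorem canon_implications₁₀₇ : Implications107 ν (canon₈₉W ν μ (canon ν μ κ) (canon₈no ν μ) (canon₃₄ μ κ)) (canon₁₀₇ ν μ κ) :=
  canon_implications₁₀₇W _ _

/-- In the parametrised reading both fields hold as soon as the book holds at all ranks and C226's Theorem 1.2 holds — through the tranche's own `fmggpEquiv_of_rows` and `ktRationality_of_rows`. [cite: FurusawaMorimoto2024SO5, Cor. 1.1; KugaTsuzuki2024SpectralAverage, Cor. 1.4 (bookkeeping proved here)] -/
theorem c107_all_of (c₈₉ : Consumers89) (hν : ∀ N, ν.Everything N) (hR : c₈₉.FMrefined) :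
    (canon₁₀₇W ν c₈₉).FMggpEquiv ∧ (canon₁₀₇W ν c₈₉).KTrationality :=
  have X := canon_implications₁₀₇W ν c₈₉
  have g : (canon₁₀₇W ν c₈₉).FMggpEquiv := fmggpEquiv_of_rows X hR
  ⟨g, ktRationality_of_rows X hν g⟩

end Canon107

/-- At the top (every input of the three DAGs; the Chapter-9 leaf denied in section 92's reading of C226, which this tranche does not use) both fields hold — through the tranche's
own `hundredseventh_of_inputs` fed by section 92's `canon_implications₈₉W` and tranche 34's `canon_implications₃₄`. [cite: FurusawaMorimoto2024SO5, Cor. 1.1; KugaTsuzuki2024SpectralAverage, Cor. 1.4 (bookkeeping proved here)] [claim: KalethaMinguezShinWhite2014, under-review] -/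
theorem hundredseventh_holds_top :
    (canon₁₀₇ νtop μtop κtop).FMggpEquiv ∧ (canon₁₀₇ νtop μtop κtop).KTrationality :=
  hundredseventh_of_inputs (canon_implications₁₀₇ νtop μtop κtop)
    (canon_implications₈₉W νtop μtop (canon νtop μtop κtop) (canon₈no νtop μtop) (canon₃₄ μtop κtop)) (canon_implications₃₄ νtop μtop κtop)
    bookInputs_top mokInputs_top (kmswInputs_top μtop).1

/-- BOOK SIDE, EXACT SUPPORT: in each of the 24 book countermodels (Mok and KMSW at the top; tranches 89 / 107 read canonically over it, both hundred-and-seventh edges valid)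
C271's Corollary 1.4 FAILS — the book is load-bearing by name ([read: it belongs to some global A-packet]) — while C226's Corollary 1.1 HOLDS there (its only premise, Theorem
1.2, reads Mok ∧ KMSW-scope ∧ …: no book leaf in its support). [cite: KugaTsuzuki2024SpectralAverage, §7 proof of Lemma 7.4; FurusawaMorimoto2024SO5, Rem. 1.9; with Arthur2013 §1.5 (bookkeeping proved here)] -/
theorem c107_book_cm (l : LeafSupport.Leaf) :
    LeafSupport.Systems (LeafSupport.mkN (LeafSupport.cm l)) (LeafSupport.mkW (LeafSupport.cm l)) (LeafSupport.mkG (LeafSupport.cm l)) ∧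
      (∀ l', l' ≠ l → (LeafSupport.mkN (LeafSupport.cm l)).leaf l') ∧ ¬ (LeafSupport.mkN (LeafSupport.cm l)).leaf l ∧
      Implications107 (LeafSupport.mkN (LeafSupport.cm l))
        (canon₈₉W (LeafSupport.mkN (LeafSupport.cm l)) μtop (canon (LeafSupport.mkN (LeafSupport.cm l)) μtop κtop) (canon₈no (LeafSupport.mkN (LeafSupport.cm l)) μtop) (canon₃₄ μtop κtop))
        (canon₁₀₇ (LeafSupport.mkN (LeafSupport.cm l)) μtop κtop) ∧
      (canon₁₀₇ (LeafSupport.mkN (LeafSupport.cm l)) μtop κtop).FMggpEquiv ∧ ¬ (canon₁₀₇ (LeafSupport.mkN (LeafSupport.cm l)) μtop κtop).KTrationality :=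
  have cmod := LeafSupport.countermodel l
  have nb := not_B_cm l
  have m : ∀ N, μtop.Everything N := mokInputs_top.everything
  have s : ∀ N, κtop.Scope N := (kmswInputs_top μtop).1.scope mokInputs_top
  ⟨cmod.1, cmod.2.1, cmod.2.2.1, canon_implications₁₀₇ _ _ _, ⟨m, ⟨m, s, ⟨m, s⟩⟩, ⟨m, s⟩⟩, fun h => nb h.1⟩

/-- THE TYPED PREMISE IS LOAD-BEARING EXACTLY AS TYPED (reading-level separation at the top): C226's Theorem 1.2 DENIED (section 108's `c₈₉noR`) ⇒ BOTH new nodes FAIL (Corollary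
1.1 [read: is immediate from Theorem 1.2]; Corollary 1.4 through [read: [8, Corollary 1.1]]); both hundred-and-seventh edges hold over the denied assignment. [cite: FurusawaMorimoto2024SO5, Rem. 1.9; KugaTsuzuki2024SpectralAverage, §7 ([8, Corollary 1.1]) (separating model; bookkeeping proved here)] -/
theorem c107_rows_denied_top :
    Implications107 νtop c₈₉noR (canon₁₀₇W νtop c₈₉noR) ∧ ¬ (canon₁₀₇W νtop c₈₉noR).FMggpEquiv ∧ ¬ (canon₁₀₇W νtop c₈₉noR).KTrationality :=
  ⟨canon_implications₁₀₇W _ _, fun h => h, fun h => h.2⟩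

/-- MOK SIDE: in the Mok countermodel of ANY leaf `l` (book and KMSW at the top; tranches 89 / 107 read over it) both hundred-and-seventh edges hold and BOTH new nodes FAIL —
through C226's Theorem 1.2 ([read: by Mok [82]]). [cite: FurusawaMorimoto2024SO5, Rem. 1.9, §7; KugaTsuzuki2024SpectralAverage, §7; Mok2012, Thm 2.5.2 (bookkeeping proved here)] -/
theorem c107_mok_cm (l : Mok2015.LeafSupport.Leaf) :
    ¬ (Mok2015.LeafSupport.mkN (Mok2015.LeafSupport.cm l)).leaf l ∧
      Implications107 νtop
        (canon₈₉W νtop (Mok2015.LeafSupport.mkN (Mok2015.LeafSupport.cm l)) (canon νtop (Mok2015.LeafSupport.mkN (Mok2015.LeafSupport.cm l)) κtop) (canon₈no νtop (Mok2015.LeafSupport.mkN (Mok2015.LeafSupport.cm l))) (canon₃₄ (Mok2015.LeafSupport.mkN (Mok2015.LeafSupport.cm l)) κtop))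
        (canon₁₀₇ νtop (Mok2015.LeafSupport.mkN (Mok2015.LeafSupport.cm l)) κtop) ∧
      ¬ (canon₁₀₇ νtop (Mok2015.LeafSupport.mkN (Mok2015.LeafSupport.cm l)) κtop).FMggpEquiv ∧ ¬ (canon₁₀₇ νtop (Mok2015.LeafSupport.mkN (Mok2015.LeafSupport.cm l)) κtop).KTrationality :=
  have cmod := Mok2015.LeafSupport.countermodel l
  have nm := not_M_cm l
  ⟨cmod.2.2.1, canon_implications₁₀₇W _ _, fun h => nm h.1, fun h => nm h.2.1⟩

/-- KMSW SIDE.  I (the import): with the book and Mok at the top and KMSW's Mok import DENIED (`κnoMok`: the proved scope fails at every rank) both edges hold and BOTH new nodes FAIL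
(C226's Theorem 1.2 reads KMSW's proved scope through rows C67 / C24).  II (the sequels are NOT in the support): in KMSW's countermodel of ANY leaf feeding only the starred
statements in full (`l.onlyFull = true`: the unwritten sequels and `AubertSS`) the proved scope holds and BOTH new nodes HOLD. [cite: FurusawaMorimoto2024SO5, §7; KugaTsuzuki2024SpectralAverage, §7 (bookkeeping proved here)] [claim: KalethaMinguezShinWhite2014, under-review] -/
theorem c107_kmsw (l' : KMSW2014.LeafSupport.Leaf) :
    ((∀ N, ¬ κnoMok.Scope N) ∧
        Implications107 νtop (canon₈₉W νtop μtop (canon νtop μtop κnoMok) (canon₈no νtop μtop) (canon₃₄ μtop κnoMok)) (canon₁₀₇ νtop μtop κnoMok) ∧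
        ¬ (canon₁₀₇ νtop μtop κnoMok).FMggpEquiv ∧ ¬ (canon₁₀₇ νtop μtop κnoMok).KTrationality) ∧
      (l'.onlyFull = true →
        (canon₁₀₇ νtop μtop (KMSW2014.LeafSupport.mkN (KMSW2014.LeafSupport.cm l'))).FMggpEquiv ∧
          (canon₁₀₇ νtop μtop (KMSW2014.LeafSupport.mkN (KMSW2014.LeafSupport.cm l'))).KTrationality) :=
  have ns : ∀ N, ¬ κnoMok.Scope N := κnoMok_facts.2.2.2.2.2.1
  have b : ∀ N, νtop.Everything N := bookInputs_top.everything
  have m : ∀ N, μtop.Everything N := mokInputs_top.everything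
  ⟨⟨ns, canon_implications₁₀₇W _ _, fun h => ns 0 (h.2.2.2 0), fun h => ns 0 (h.2.2.2.2 0)⟩,
    fun hl =>
      have s : ∀ N, (KMSW2014.LeafSupport.mkN (KMSW2014.LeafSupport.cm l')).Scope N := scope_of_onlyFull l' hl
      have r : (∀ N, μtop.Everything N) ∧ (canon₃₄ μtop (KMSW2014.LeafSupport.mkN (KMSW2014.LeafSupport.cm l'))).FurusawaMorimoto ∧
          (canon₃₄ μtop (KMSW2014.LeafSupport.mkN (KMSW2014.LeafSupport.cm l'))).BPlocalGGP := ⟨m, ⟨m, s, ⟨m, s⟩⟩, ⟨m, s⟩⟩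
      ⟨r, ⟨b, r⟩⟩⟩

/-- THE HUNDRED-AND-SEVENTH TRANCHE REGRADED, in one statement: (i) at the top both new nodes hold; (ii) in the book countermodel of ANY leaf C226's Corollary 1.1 HOLDS and C271's
Corollary 1.4 FAILS; (iii) C226's Theorem 1.2 denied: both fail; (iv) in every Mok countermodel and (v) with KMSW's Mok import denied both fail; in KMSW's only-full leaf
countermodels both hold.  Supports: Mok 29 ∪ KMSW's Mok import for `FMggpEquiv` (through Theorem 1.2; NO book leaf); book 24 ∪ Mok 29 ∪ KMSW's Mok import for
`KTrationality` (by name and through [8, Corollary 1.1]); no KMSW sequel in either support. [cite: FurusawaMorimoto2024SO5, Cor. 1.1; KugaTsuzuki2024SpectralAverage, Cor. 1.4 (bookkeeping proved here)] [claim: KalethaMinguezShinWhite2014, under-review] -/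
theorem c107_regraded :
    ((canon₁₀₇ νtop μtop κtop).FMggpEquiv ∧ (canon₁₀₇ νtop μtop κtop).KTrationality) ∧
      (∀ l : LeafSupport.Leaf, ¬ (LeafSupport.mkN (LeafSupport.cm l)).leaf l ∧
        (canon₁₀₇ (LeafSupport.mkN (LeafSupport.cm l)) μtop κtop).FMggpEquiv ∧ ¬ (canon₁₀₇ (LeafSupport.mkN (LeafSupport.cm l)) μtop κtop).KTrationality) ∧
      (¬ (canon₁₀₇W νtop c₈₉noR).FMggpEquiv ∧ ¬ (canon₁₀₇W νtop c₈₉noR).KTrationality) ∧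
      (∀ l : Mok2015.LeafSupport.Leaf, ¬ (Mok2015.LeafSupport.mkN (Mok2015.LeafSupport.cm l)).leaf l ∧
        ¬ (canon₁₀₇ νtop (Mok2015.LeafSupport.mkN (Mok2015.LeafSupport.cm l)) κtop).FMggpEquiv ∧ ¬ (canon₁₀₇ νtop (Mok2015.LeafSupport.mkN (Mok2015.LeafSupport.cm l)) κtop).KTrationality) ∧
      ((∀ N, ¬ κnoMok.Scope N) ∧ ¬ (canon₁₀₇ νtop μtop κnoMok).FMggpEquiv ∧ ¬ (canon₁₀₇ νtop μtop κnoMok).KTrationality ∧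
        ∀ l' : KMSW2014.LeafSupport.Leaf, l'.onlyFull = true →
          (canon₁₀₇ νtop μtop (KMSW2014.LeafSupport.mkN (KMSW2014.LeafSupport.cm l'))).FMggpEquiv ∧
            (canon₁₀₇ νtop μtop (KMSW2014.LeafSupport.mkN (KMSW2014.LeafSupport.cm l'))).KTrationality) :=
  have d := c107_rows_denied_top
  have k := c107_kmsw .MokMain
  ⟨hundredseventh_holds_top,
    fun l => have h := c107_book_cm l
      ⟨h.2.2.1, h.2.2.2.2.1, h.2.2.2.2.2⟩,
    ⟨d.2.1, d.2.2⟩,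
    fun l => have h := c107_mok_cm l
      ⟨h.1, h.2.2.1, h.2.2.2⟩,
    ⟨k.1.1, k.1.2.2.1, k.1.2.2.2, fun l' hl => (c107_kmsw l').2 hl⟩⟩

/-! ## 111. Hundred-and-eighth tranche (v4 of this file, after `Downstream32.lean` v2; unit `pub-arthur-down-g42`): supports of THE MOK-2014 CONDUIT VEIN — C273 `HTunitaryU4` /
`HTstandardGSp4` (⇐ C191), `HTsymTower` (⇐ C177), C274 `JonesQzeta12` (⇐ C191), C275 node `TJlgc` (⇐ C191) / `TJdescent` (⇐ it), C276 `HWangLevelLowering` (⇐ C191), C277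
`BMSWunobstructed` (⇐ C191); see the module docstring for the summary of what is certified. -/

section Canon108

variable (ν : Nodes) (μ : Mok2015.Nodes) (κ : KMSW2014.Nodes)

/-- The parametrised canonical reading of the hundred-and-eighth tranche: the assignments `c₁₈`, `c₂₈` of tranches 18 / 28 are the parameters; the six C191-supported statements (and C275's node) := the value of row C191; C273's third statement := the value of row C177. [cite: HidaTilouine2020SymmetricPower, Thms 1.3, 1.6, 7.1-7.2; Jones2016TwelfthRoots, §5; TsaltasJarvis2019Descending, Thm 4.2; HWang2019LevelLowering, Thms 1-2; BroshiEtAl2020Unobstructed, Thm 1.1 (canonical model; bookkeeping)] -/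
abbrev canon₁₀₈W (c₁₈ : Consumers18) (c₂₈ : Consumers28) : Consumers108 where
  HTunitaryU4 := c₂₈.MokGSp4
  HTstandardGSp4 := c₂₈.MokGSp4
  HTsymTower := c₁₈.ClozelThorne2
  JonesQzeta12 := c₂₈.MokGSp4
  TJlgc := c₂₈.MokGSp4
  TJdescent := c₂₈.MokGSp4
  HWangLevelLowering := c₂₈.MokGSp4
  BMSWunobstructed := c₂₈.MokGSp4

/-- The canonical instance over section 22's `canon₁₈` (C177 := Mok at all ranks ∧ KMSW's node `StabOrdI`) and section 31's `canon₂₈` (C191 := the book at all ranks ∧ row A4's value, itself := the book). [cite: Mok2014Compositio, Thm 3.1; ClozelThorne2015, Thm 1.2 (canonical model; bookkeeping)] -/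
abbrev canon₁₀₈ : Consumers108 := canon₁₀₈W (canon₁₈ ν μ κ) (canon₂₈ ν μ κ)

/-- Every hundred-and-eighth-tranche edge holds in the parametrised reading, for every assignment of tranches 18 / 28. [cite: HidaTilouine2020SymmetricPower, Thms 1.3, 1.6, 7.1-7.2; Jones2016TwelfthRoots, §5; TsaltasJarvis2019Descending, Thm 4.2; HWang2019LevelLowering, Thms 1-2; BroshiEtAl2020Unobstructed, Thm 1.1 (bookkeeping proved here)] -/
theorem canon_implications₁₀₈W (c₁₈ : Consumers18) (c₂₈ : Consumers28) : Implications108 c₁₈ c₂₈ (canon₁₀₈W c₁₈ c₂₈) where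
  htU := fun k => k
  htS7 := fun k => k
  htSym := fun t => t
  jones := fun k => k
  tjL := fun k => k
  tjD := fun l => l
  hw := fun k => k
  bmsw := fun k => k

/-- Every edge holds in the canonical instance, for arbitrary ν, μ, κ. [cite: HidaTilouine2020SymmetricPower, Thm 1.3; TsaltasJarvis2019Descending, Thm 4.2 (bookkeeping proved here)] -/
theorem canon_implications₁₀₈ : Implications108 (canon₁₈ ν μ κ) (canon₂₈ ν μ κ) (canon₁₀₈ ν μ κ) :=
  canon_implications₁₀₈W _ _

/-- In the parametrised reading all eight fields hold as soon as row C191 and row C177 hold — through the tranche's own `mok2014vein_of_row` and `htSymTower_of_row`. [cite: HidaTilouine2020SymmetricPower, Thms 1.3, 1.6, 7.1-7.2; Jones2016TwelfthRoots, §5; TsaltasJarvis2019Descending, Thm 4.2; HWang2019LevelLowering, Thms 1-2; BroshiEtAl2020Unobstructed, Thm 1.1 (bookkeeping proved here)] -/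
theorem c108_all_of (c₁₈ : Consumers18) (c₂₈ : Consumers28) (h₁₉₁ : c₂₈.MokGSp4) (h₁₇₇ : c₁₈.ClozelThorne2) :
    (((canon₁₀₈W c₁₈ c₂₈).HTunitaryU4 ∧ (canon₁₀₈W c₁₈ c₂₈).HTstandardGSp4) ∧ (canon₁₀₈W c₁₈ c₂₈).JonesQzeta12 ∧
        ((canon₁₀₈W c₁₈ c₂₈).TJlgc ∧ (canon₁₀₈W c₁₈ c₂₈).TJdescent) ∧ (canon₁₀₈W c₁₈ c₂₈).HWangLevelLowering ∧ (canon₁₀₈W c₁₈ c₂₈).BMSWunobstructed) ∧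
      (canon₁₀₈W c₁₈ c₂₈).HTsymTower :=
  have X := canon_implications₁₀₈W c₁₈ c₂₈
  ⟨mok2014vein_of_row X h₁₉₁, htSymTower_of_row X h₁₇₇⟩

end Canon108

/-- At the top (every input of the three DAGs) all eight fields hold — through the tranche's own `hundredeighth_of_inputs` fed by section 31's `canon_implications₂₈`, the first
file's `canon_implications` and section 22's `canon_implications₁₈`. [cite: HidaTilouine2020SymmetricPower, Thms 1.3, 1.6, 7.1-7.2; Jones2016TwelfthRoots, §5; TsaltasJarvis2019Descending, Thm 4.2; HWang2019LevelLowering, Thms 1-2; BroshiEtAl2020Unobstructed, Thm 1.1 (bookkeeping proved here)] [claim: KalethaMinguezShinWhite2014, under-review] -/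
theorem hundredeighth_holds_top :
    (((canon₁₀₈ νtop μtop κtop).HTunitaryU4 ∧ (canon₁₀₈ νtop μtop κtop).HTstandardGSp4) ∧ (canon₁₀₈ νtop μtop κtop).JonesQzeta12 ∧
        ((canon₁₀₈ νtop μtop κtop).TJlgc ∧ (canon₁₀₈ νtop μtop κtop).TJdescent) ∧ (canon₁₀₈ νtop μtop κtop).HWangLevelLowering ∧ (canon₁₀₈ νtop μtop κtop).BMSWunobstructed) ∧
      (canon₁₀₈ νtop μtop κtop).HTsymTower :=
  hundredeighth_of_inputs (canon_implications₁₀₈ νtop μtop κtop) (canon_implications₂₈ νtop μtop κtop) (canon_implications νtop μtop κtop) (canon_implications₁₈ νtop μtop κtop)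
    bookInputs_top mokInputs_top (kmswInputs_top μtop).1

/-- BOOK SIDE, EXACT SUPPORT: in each of the 24 book countermodels (Mok and KMSW at the top; tranches 1 / 18 / 28 / 108 read canonically over it, all edges valid) the SIX C191-supported
statements AND C275's node FAIL — every book leaf is load-bearing through Mok 2014's transfer ([read: has also been established [Mok14]]; [read: constructed in [Mok14]];
[read: Sorensen (see [24]) and Mok (see Theorem 3.1]; [read: [Sor10] and [Mo14]]; [read: [Sor] and [Mok]]) — while C273's third statement HOLDS there (its support has no
book leaf). [cite: HidaTilouine2020SymmetricPower, §3.2, §7, §6; Jones2016TwelfthRoots, §1; TsaltasJarvis2019Descending, §4 fn 8; HWang2019LevelLowering, §3; BroshiEtAl2020Unobstructed, Thm 3.1; with Mok2014Compositio §1 and Arthur2013 §1.5 (bookkeeping proved here)] -/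
theorem c108_book_cm (l : LeafSupport.Leaf) :
    LeafSupport.Systems (LeafSupport.mkN (LeafSupport.cm l)) (LeafSupport.mkW (LeafSupport.cm l)) (LeafSupport.mkG (LeafSupport.cm l)) ∧
      (∀ l', l' ≠ l → (LeafSupport.mkN (LeafSupport.cm l)).leaf l') ∧ ¬ (LeafSupport.mkN (LeafSupport.cm l)).leaf l ∧
      Implications108 (canon₁₈ (LeafSupport.mkN (LeafSupport.cm l)) μtop κtop) (canon₂₈ (LeafSupport.mkN (LeafSupport.cm l)) μtop κtop)
        (canon₁₀₈ (LeafSupport.mkN (LeafSupport.cm l)) μtop κtop) ∧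
      (¬ (canon₁₀₈ (LeafSupport.mkN (LeafSupport.cm l)) μtop κtop).HTunitaryU4 ∧ ¬ (canon₁₀₈ (LeafSupport.mkN (LeafSupport.cm l)) μtop κtop).HTstandardGSp4 ∧
        ¬ (canon₁₀₈ (LeafSupport.mkN (LeafSupport.cm l)) μtop κtop).JonesQzeta12 ∧ ¬ (canon₁₀₈ (LeafSupport.mkN (LeafSupport.cm l)) μtop κtop).TJlgc ∧
        ¬ (canon₁₀₈ (LeafSupport.mkN (LeafSupport.cm l)) μtop κtop).TJdescent ∧ ¬ (canon₁₀₈ (LeafSupport.mkN (LeafSupport.cm l)) μtop κtop).HWangLevelLowering ∧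
        ¬ (canon₁₀₈ (LeafSupport.mkN (LeafSupport.cm l)) μtop κtop).BMSWunobstructed) ∧
      (canon₁₀₈ (LeafSupport.mkN (LeafSupport.cm l)) μtop κtop).HTsymTower :=
  have cmod := LeafSupport.countermodel l
  have nb := not_B_cm l
  ⟨cmod.1, cmod.2.1, cmod.2.2.1, canon_implications₁₀₈ _ _ _,
    ⟨fun h => nb h.1, fun h => nb h.1, fun h => nb h.1, fun h => nb h.1, fun h => nb h.1, fun h => nb h.1, fun h => nb h.1⟩,
    ⟨mokInputs_top.everything, (kmswInputs_top μtop).1.stabOrdI⟩⟩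

/-- Row C177 DENIED (`ClozelThorne2 := False`; C178 as in `canon₁₈` at the top): a reading of `Consumers18` used only to deny Clozel – Thorne II; no tranche-18 edge is claimed for it. [cite: ClozelThorne2015, Thm 1.2 (separating model; bookkeeping)] -/
abbrev c₁₈noCT2 : Consumers18 := { canon₁₈ νtop μtop κtop with ClozelThorne2 := False }

/-- THE TYPED PREMISES ARE LOAD-BEARING EXACTLY AS TYPED (reading-level separation at the top): (a) ROW C191 DENIED (section 31's `canon₂₈noC191`: `MokGSp4 := False`, the
first-order rows of tranche 28 as at the top) ⇒ the six C191-supported statements and C275's node FAIL, C273's third statement HOLDS; (b) ROW C177 DENIED (`c₁₈noCT2`) ⇒ only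
C273's third statement FAILS.  Every hundred-and-eighth edge holds over each denied assignment. [cite: HidaTilouine2020SymmetricPower, §3.2 ([Mok14]), §1 ([CT15]); TsaltasJarvis2019Descending, §4 fn 8 ([19]); BroshiEtAl2020Unobstructed, Thm 3.1 ([Mok]) (separating models; bookkeeping proved here)] -/
theorem c108_rows_denied_top :
    (Implications108 (canon₁₈ νtop μtop κtop) (canon₂₈noC191 νtop μtop κtop) (canon₁₀₈W (canon₁₈ νtop μtop κtop) (canon₂₈noC191 νtop μtop κtop)) ∧
        ¬ (canon₁₀₈W (canon₁₈ νtop μtop κtop) (canon₂₈noC191 νtop μtop κtop)).HTunitaryU4 ∧ ¬ (canon₁₀₈W (canon₁₈ νtop μtop κtop) (canon₂₈noC191 νtop μtop κtop)).HTstandardGSp4 ∧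
        ¬ (canon₁₀₈W (canon₁₈ νtop μtop κtop) (canon₂₈noC191 νtop μtop κtop)).JonesQzeta12 ∧ ¬ (canon₁₀₈W (canon₁₈ νtop μtop κtop) (canon₂₈noC191 νtop μtop κtop)).TJlgc ∧
        ¬ (canon₁₀₈W (canon₁₈ νtop μtop κtop) (canon₂₈noC191 νtop μtop κtop)).TJdescent ∧ ¬ (canon₁₀₈W (canon₁₈ νtop μtop κtop) (canon₂₈noC191 νtop μtop κtop)).HWangLevelLowering ∧
        ¬ (canon₁₀₈W (canon₁₈ νtop μtop κtop) (canon₂₈noC191 νtop μtop κtop)).BMSWunobstructed ∧ (canon₁₀₈W (canon₁₈ νtop μtop κtop) (canon₂₈noC191 νtop μtop κtop)).HTsymTower) ∧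
      (Implications108 c₁₈noCT2 (canon₂₈ νtop μtop κtop) (canon₁₀₈W c₁₈noCT2 (canon₂₈ νtop μtop κtop)) ∧
        ¬ (canon₁₀₈W c₁₈noCT2 (canon₂₈ νtop μtop κtop)).HTsymTower ∧ (canon₁₀₈W c₁₈noCT2 (canon₂₈ νtop μtop κtop)).HTunitaryU4 ∧
        (canon₁₀₈W c₁₈noCT2 (canon₂₈ νtop μtop κtop)).TJdescent ∧ (canon₁₀₈W c₁₈noCT2 (canon₂₈ νtop μtop κtop)).BMSWunobstructed) :=
  have b : ∀ N, νtop.Everything N := bookInputs_top.everything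
  have k : (canon₂₈ νtop μtop κtop).MokGSp4 := ⟨b, b⟩
  ⟨⟨canon_implications₁₀₈W _ _, fun h => h, fun h => h, fun h => h, fun h => h, fun h => h, fun h => h, fun h => h,
      ⟨mokInputs_top.everything, (kmswInputs_top μtop).1.stabOrdI⟩⟩,
    ⟨canon_implications₁₀₈W _ _, fun h => h, k, k, k⟩⟩

/-- MOK SIDE: in the Mok countermodel of ANY leaf `l` (book and KMSW at the top; tranches 18 / 28 / 108 read over it) every edge holds; C273's third statement FAILS — through
Clozel – Thorne II ([read: conditional on the results in [Mok]]) — while the six C191-supported statements HOLD (Mok 2014's transfer is book-side). [cite: HidaTilouine2020SymmetricPower, §1 ([CT15]); ClozelThorne2015, §1.1; Mok2014Compositio, §1 (bookkeeping proved here)] -/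
theorem c108_mok_cm (l : Mok2015.LeafSupport.Leaf) :
    ¬ (Mok2015.LeafSupport.mkN (Mok2015.LeafSupport.cm l)).leaf l ∧
      Implications108 (canon₁₈ νtop (Mok2015.LeafSupport.mkN (Mok2015.LeafSupport.cm l)) κtop) (canon₂₈ νtop (Mok2015.LeafSupport.mkN (Mok2015.LeafSupport.cm l)) κtop)
        (canon₁₀₈ νtop (Mok2015.LeafSupport.mkN (Mok2015.LeafSupport.cm l)) κtop) ∧
      ¬ (canon₁₀₈ νtop (Mok2015.LeafSupport.mkN (Mok2015.LeafSupport.cm l)) κtop).HTsymTower ∧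
      ((canon₁₀₈ νtop (Mok2015.LeafSupport.mkN (Mok2015.LeafSupport.cm l)) κtop).HTunitaryU4 ∧ (canon₁₀₈ νtop (Mok2015.LeafSupport.mkN (Mok2015.LeafSupport.cm l)) κtop).JonesQzeta12 ∧
        (canon₁₀₈ νtop (Mok2015.LeafSupport.mkN (Mok2015.LeafSupport.cm l)) κtop).TJdescent ∧ (canon₁₀₈ νtop (Mok2015.LeafSupport.mkN (Mok2015.LeafSupport.cm l)) κtop).HWangLevelLowering ∧
        (canon₁₀₈ νtop (Mok2015.LeafSupport.mkN (Mok2015.LeafSupport.cm l)) κtop).BMSWunobstructed) :=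
  have cmod := Mok2015.LeafSupport.countermodel l
  have nm := not_M_cm l
  have b : ∀ N, νtop.Everything N := bookInputs_top.everything
  ⟨cmod.2.2.1, canon_implications₁₀₈W _ _, fun h => nm h.1, ⟨⟨b, b⟩, ⟨b, b⟩, ⟨b, b⟩, ⟨b, b⟩, ⟨b, b⟩⟩⟩

/-- KMSW SIDE, TWO-SIDED for C273's third statement: in KMSW's countermodel of ANY leaf `l'` (book and Mok at the top) every edge holds; `HTsymTower` HOLDS exactly when `l'` is
none of the five premises of the inner-form stabilisation edge (`l'.stabOrdI = false` — the first file's `stabOrdI_cm_iff`, as section 22 certified for C177 itself); the six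
C191-supported statements HOLD throughout (no KMSW leaf in their support). [cite: HidaTilouine2020SymmetricPower, §6; ClozelThorne2015, p0017:L12-13 (bookkeeping proved here)] [claim: KalethaMinguezShinWhite2014, under-review] -/
theorem c108_kmsw (l' : KMSW2014.LeafSupport.Leaf) :
    ¬ (KMSW2014.LeafSupport.mkN (KMSW2014.LeafSupport.cm l')).leaf l' ∧
      Implications108 (canon₁₈ νtop μtop (KMSW2014.LeafSupport.mkN (KMSW2014.LeafSupport.cm l'))) (canon₂₈ νtop μtop (KMSW2014.LeafSupport.mkN (KMSW2014.LeafSupport.cm l')))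
        (canon₁₀₈ νtop μtop (KMSW2014.LeafSupport.mkN (KMSW2014.LeafSupport.cm l'))) ∧
      ((canon₁₀₈ νtop μtop (KMSW2014.LeafSupport.mkN (KMSW2014.LeafSupport.cm l'))).HTsymTower ↔ l'.stabOrdI = false) ∧
      ((canon₁₀₈ νtop μtop (KMSW2014.LeafSupport.mkN (KMSW2014.LeafSupport.cm l'))).HTunitaryU4 ∧ (canon₁₀₈ νtop μtop (KMSW2014.LeafSupport.mkN (KMSW2014.LeafSupport.cm l'))).TJdescent ∧
        (canon₁₀₈ νtop μtop (KMSW2014.LeafSupport.mkN (KMSW2014.LeafSupport.cm l'))).BMSWunobstructed) :=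
  have cmod := KMSW2014.LeafSupport.countermodel l'
  have b : ∀ N, νtop.Everything N := bookInputs_top.everything
  ⟨cmod.2.2.1, canon_implications₁₀₈W _ _,
    ⟨fun h => (stabOrdI_cm_iff l').1 h.2, fun h => ⟨mokInputs_top.everything, (stabOrdI_cm_iff l').2 h⟩⟩, ⟨⟨b, b⟩, ⟨b, b⟩, ⟨b, b⟩⟩⟩

/-- THE HUNDRED-AND-EIGHTH TRANCHE REGRADED, in one statement: (i) at the top all eight fields hold; (ii) in the book countermodel of ANY leaf the six C191-supported statements
(shown: four of them and C275's node) fail and C273's third statement holds; (iii) C191 denied: the six fail, the third holds; C177 denied: only the third fails; (iv) in every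
Mok countermodel the third fails and the six hold; (v) in KMSW's leaf countermodels the third holds iff the leaf is not a premise of `StabOrdI`, the six hold.  Supports: book 24
(through Mok 2014 and Gee – Taïbi) for `HTunitaryU4`, `HTstandardGSp4`, `JonesQzeta12`, `TJlgc`, `TJdescent`, `HWangLevelLowering`, `BMSWunobstructed` — nothing of Mok 2015 or
KMSW; Mok 29 ∪ KMSW's five `StabOrdI` premises (FL, split and general weighted FL, Arthur's STF, transfer) for `HTsymTower` — no book leaf, no KMSW chapter or sequel.
[cite: HidaTilouine2020SymmetricPower, Thms 1.3, 1.6, 7.1-7.2; Jones2016TwelfthRoots, §5; TsaltasJarvis2019Descending, Thm 4.2; HWang2019LevelLowering, Thms 1-2; BroshiEtAl2020Unobstructed, Thm 1.1 (bookkeeping proved here)] [claim: KalethaMinguezShinWhite2014, under-review] -/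
theorem c108_regraded :
    ((((canon₁₀₈ νtop μtop κtop).HTunitaryU4 ∧ (canon₁₀₈ νtop μtop κtop).HTstandardGSp4) ∧ (canon₁₀₈ νtop μtop κtop).JonesQzeta12 ∧
          ((canon₁₀₈ νtop μtop κtop).TJlgc ∧ (canon₁₀₈ νtop μtop κtop).TJdescent) ∧ (canon₁₀₈ νtop μtop κtop).HWangLevelLowering ∧ (canon₁₀₈ νtop μtop κtop).BMSWunobstructed) ∧
        (canon₁₀₈ νtop μtop κtop).HTsymTower) ∧
      (∀ l : LeafSupport.Leaf, ¬ (LeafSupport.mkN (LeafSupport.cm l)).leaf l ∧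
        ¬ (canon₁₀₈ (LeafSupport.mkN (LeafSupport.cm l)) μtop κtop).HTunitaryU4 ∧ ¬ (canon₁₀₈ (LeafSupport.mkN (LeafSupport.cm l)) μtop κtop).JonesQzeta12 ∧
        ¬ (canon₁₀₈ (LeafSupport.mkN (LeafSupport.cm l)) μtop κtop).TJlgc ∧ ¬ (canon₁₀₈ (LeafSupport.mkN (LeafSupport.cm l)) μtop κtop).HWangLevelLowering ∧
        ¬ (canon₁₀₈ (LeafSupport.mkN (LeafSupport.cm l)) μtop κtop).BMSWunobstructed ∧ (canon₁₀₈ (LeafSupport.mkN (LeafSupport.cm l)) μtop κtop).HTsymTower) ∧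
      (¬ (canon₁₀₈W (canon₁₈ νtop μtop κtop) (canon₂₈noC191 νtop μtop κtop)).HTunitaryU4 ∧ ¬ (canon₁₀₈W (canon₁₈ νtop μtop κtop) (canon₂₈noC191 νtop μtop κtop)).TJdescent ∧
        (canon₁₀₈W (canon₁₈ νtop μtop κtop) (canon₂₈noC191 νtop μtop κtop)).HTsymTower ∧ ¬ (canon₁₀₈W c₁₈noCT2 (canon₂₈ νtop μtop κtop)).HTsymTower ∧
        (canon₁₀₈W c₁₈noCT2 (canon₂₈ νtop μtop κtop)).HTunitaryU4) ∧
      (∀ l : Mok2015.LeafSupport.Leaf, ¬ (Mok2015.LeafSupport.mkN (Mok2015.LeafSupport.cm l)).leaf l ∧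
        ¬ (canon₁₀₈ νtop (Mok2015.LeafSupport.mkN (Mok2015.LeafSupport.cm l)) κtop).HTsymTower ∧ (canon₁₀₈ νtop (Mok2015.LeafSupport.mkN (Mok2015.LeafSupport.cm l)) κtop).HTunitaryU4) ∧
      (∀ l' : KMSW2014.LeafSupport.Leaf,
        ((canon₁₀₈ νtop μtop (KMSW2014.LeafSupport.mkN (KMSW2014.LeafSupport.cm l'))).HTsymTower ↔ l'.stabOrdI = false) ∧
          (canon₁₀₈ νtop μtop (KMSW2014.LeafSupport.mkN (KMSW2014.LeafSupport.cm l'))).HTunitaryU4) :=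
  have d := c108_rows_denied_top
  ⟨hundredeighth_holds_top,
    fun l => have h := c108_book_cm l
      ⟨h.2.2.1, h.2.2.2.2.1.1, h.2.2.2.2.1.2.2.1, h.2.2.2.2.1.2.2.2.1, h.2.2.2.2.1.2.2.2.2.2.1, h.2.2.2.2.1.2.2.2.2.2.2, h.2.2.2.2.2⟩,
    ⟨d.1.2.1, d.1.2.2.2.2.2.1, d.1.2.2.2.2.2.2.2.2, d.2.2.1, d.2.2.2.1⟩,
    fun l => have h := c108_mok_cm l
      ⟨h.1, h.2.2.1, h.2.2.2.1⟩,
    fun l' => have h := c108_kmsw l'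
      ⟨h.2.2.1, h.2.2.2.1⟩⟩

/-! ## 112. Hundred-and-ninth tranche (v5 of this file, after `Downstream32.lean` v3; unit `pub-arthur-down-g42`): supports of THE SYMMETRIC-POWER VEIN, I — C278 `GKPPSsatoTateGaps`,
C280 `JanuszewskiSymPadicL`, C281 node `ZhangSymLayers` / `ZhangSelmerTower` (⇐ C177 ∧ C29) and C279 `LOTeffectiveST8` (⇐ C29); see the module docstring for the summary of
what is certified. -/

section Canon109

variable (ν : Nodes) (μ : Mok2015.Nodes) (κ : KMSW2014.Nodes)

/-- The parametrised canonical reading of the hundred-and-ninth tranche: the assignments `c₁₈`, `c₆₄` of tranches 18 / 64 are the parameters; C278, C280 and C281's node and theorem := the value of row C177 ∧ the value of row C29; C279 := the value of row C29 alone (as cited). [cite: GillmanEtAl2020SatoTatePatterns, Thms 1.1-1.2; LemkeOliverThorner2019ZeroDensity, Thm 1.8; Januszewski2024RankinSelberg, §1; XZhang2021SymmetricSelmer, Thm 4.27 (canonical model; bookkeeping)] -/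
abbrev canon₁₀₉W (c₁₈ : Consumers18) (c₆₄ : Consumers64) : Consumers109 where
  GKPPSsatoTateGaps := c₁₈.ClozelThorne2 ∧ c₆₄.ClozelThorneIII
  LOTeffectiveST8 := c₆₄.ClozelThorneIII
  JanuszewskiSymPadicL := c₁₈.ClozelThorne2 ∧ c₆₄.ClozelThorneIII
  ZhangSymLayers := c₁₈.ClozelThorne2 ∧ c₆₄.ClozelThorneIII
  ZhangSelmerTower := c₁₈.ClozelThorne2 ∧ c₆₄.ClozelThorneIII

/-- The canonical instance over section 22's `canon₁₈` (C177 := Mok at all ranks ∧ KMSW's node `StabOrdI`) and section 67's `canon₆₄` (C29 := Mok ∧ `StabOrdI` ∧ E43's five published book leaves ∧ C177's value). [cite: ClozelThorne2015, Thm 1.2; ClozelThorne2017III, Thm 6.1 (canonical model; bookkeeping)] -/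
abbrev canon₁₀₉ : Consumers109 := canon₁₀₉W (canon₁₈ ν μ κ) (canon₆₄ ν μ κ)

/-- Every hundred-and-ninth-tranche edge holds in the parametrised reading, for every assignment of tranches 18 / 64. [cite: GillmanEtAl2020SatoTatePatterns, Thms 1.1-1.2; LemkeOliverThorner2019ZeroDensity, Thm 1.8; Januszewski2024RankinSelberg, §1; XZhang2021SymmetricSelmer, Thm 4.27 (bookkeeping proved here)] -/
theorem canon_implications₁₀₉W (c₁₈ : Consumers18) (c₆₄ : Consumers64) : Implications109 c₁₈ c₆₄ (canon₁₀₉W c₁₈ c₆₄) where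
  gkpps := fun t u => ⟨t, u⟩
  lot := fun u => u
  jan := fun t u => ⟨t, u⟩
  zhL := fun t u => ⟨t, u⟩
  zhS := fun z => z

/-- Every edge holds in the canonical instance, for arbitrary ν, μ, κ. [cite: GillmanEtAl2020SatoTatePatterns, Thm 1.1; XZhang2021SymmetricSelmer, Thm 4.27 (bookkeeping proved here)] -/
theorem canon_implications₁₀₉ : Implications109 (canon₁₈ ν μ κ) (canon₆₄ ν μ κ) (canon₁₀₉ ν μ κ) :=
  canon_implications₁₀₉W _ _

/-- In the parametrised reading all five fields hold as soon as rows C177 and C29 hold — through the tranche's own `symPowerVein_of_rows`. [cite: GillmanEtAl2020SatoTatePatterns, Thms 1.1-1.2; LemkeOliverThorner2019ZeroDensity, Thm 1.8; Januszewski2024RankinSelberg, §1; XZhang2021SymmetricSelmer, Thm 4.27 (bookkeeping proved here)] -/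
theorem c109_all_of (c₁₈ : Consumers18) (c₆₄ : Consumers64) (h₁₇₇ : c₁₈.ClozelThorne2) (h₂₉ : c₆₄.ClozelThorneIII) :
    (canon₁₀₉W c₁₈ c₆₄).GKPPSsatoTateGaps ∧ (canon₁₀₉W c₁₈ c₆₄).LOTeffectiveST8 ∧ (canon₁₀₉W c₁₈ c₆₄).JanuszewskiSymPadicL ∧
      ((canon₁₀₉W c₁₈ c₆₄).ZhangSymLayers ∧ (canon₁₀₉W c₁₈ c₆₄).ZhangSelmerTower) :=
  symPowerVein_of_rows (canon_implications₁₀₉W c₁₈ c₆₄) h₁₇₇ h₂₉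

end Canon109

/-- At the top (every input of the three DAGs) all five fields hold — through the tranche's own `hundredninth_of_inputs` fed by section 67's `canon_implications₆₄`, section 22's
`canon_implications₁₈` and section 47's `canon_implications₄₅`. [cite: GillmanEtAl2020SatoTatePatterns, Thms 1.1-1.2; LemkeOliverThorner2019ZeroDensity, Thm 1.8; Januszewski2024RankinSelberg, §1; XZhang2021SymmetricSelmer, Thm 4.27 (bookkeeping proved here)] [claim: KalethaMinguezShinWhite2014, under-review] -/
theorem hundredninth_holds_top :
    (canon₁₀₉ νtop μtop κtop).GKPPSsatoTateGaps ∧ (canon₁₀₉ νtop μtop κtop).LOTeffectiveST8 ∧ (canon₁₀₉ νtop μtop κtop).JanuszewskiSymPadicL ∧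
      ((canon₁₀₉ νtop μtop κtop).ZhangSymLayers ∧ (canon₁₀₉ νtop μtop κtop).ZhangSelmerTower) :=
  hundredninth_of_inputs (canon_implications₁₀₉ νtop μtop κtop) (canon_implications₆₄ νtop μtop κtop) (canon_implications₁₈ νtop μtop κtop)
    (canon_implications₄₅ νtop μtop κtop) bookInputs_top mokInputs_top (kmswInputs_top μtop).1

/-- BOOK SIDE, EXACT SUPPORT AS TYPED: in the book countermodel of ANY leaf `l` (Mok and KMSW at the top; tranches 18 / 45 / 64 / 109 read canonically over it, every
hundred-and-ninth edge valid) each of the five statements holds IF AND ONLY IF E43's canonical value does (section 67's `galoisII_book_cm`: C29 ↔ E43; C177 holds there) —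
i.e. (section 47) iff `l` is none of the five PUBLISHED leaves LLC_GLN, FL, Transfer, InvariantTF, TwistedTF: NO OPEN LEAF OF THE BOOK is in the support of the tranche
([read: [CT15, CT17]]; [read: By recent work of Clozel and Thorne [ClozelThorne]]; [read: Thanks to recent progress by Clozel-Thorne]; [read: Note that by [ClozelThorne2014,
ClozelThorne2015, ClozelThorne2017]]). [cite: GillmanEtAl2020SatoTatePatterns, §1.1; LemkeOliverThorner2019ZeroDensity, §1.3; Januszewski2024RankinSelberg, §1; XZhang2021SymmetricSelmer, §4; ClozelThorne2017III, p0003:L39-41; Moeglin2007Unitary, §1 (bookkeeping proved here)] -/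
theorem c109_book_cm (l : LeafSupport.Leaf) :
    ¬ (LeafSupport.mkN (LeafSupport.cm l)).leaf l ∧
      Implications109 (canon₁₈ (LeafSupport.mkN (LeafSupport.cm l)) μtop κtop) (canon₆₄ (LeafSupport.mkN (LeafSupport.cm l)) μtop κtop)
        (canon₁₀₉ (LeafSupport.mkN (LeafSupport.cm l)) μtop κtop) ∧
      (((canon₁₀₉ (LeafSupport.mkN (LeafSupport.cm l)) μtop κtop).GKPPSsatoTateGaps ↔ (canon₄₅ (LeafSupport.mkN (LeafSupport.cm l))).MoeglinUnitaryDS) ∧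
        ((canon₁₀₉ (LeafSupport.mkN (LeafSupport.cm l)) μtop κtop).LOTeffectiveST8 ↔ (canon₄₅ (LeafSupport.mkN (LeafSupport.cm l))).MoeglinUnitaryDS) ∧
        ((canon₁₀₉ (LeafSupport.mkN (LeafSupport.cm l)) μtop κtop).JanuszewskiSymPadicL ↔ (canon₄₅ (LeafSupport.mkN (LeafSupport.cm l))).MoeglinUnitaryDS) ∧
        ((canon₁₀₉ (LeafSupport.mkN (LeafSupport.cm l)) μtop κtop).ZhangSymLayers ↔ (canon₄₅ (LeafSupport.mkN (LeafSupport.cm l))).MoeglinUnitaryDS) ∧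
        ((canon₁₀₉ (LeafSupport.mkN (LeafSupport.cm l)) μtop κtop).ZhangSelmerTower ↔ (canon₄₅ (LeafSupport.mkN (LeafSupport.cm l))).MoeglinUnitaryDS)) :=
  have cmod := LeafSupport.countermodel l
  have e := (galoisII_book_cm l).2.2.1
  have t : (canon₁₈ (LeafSupport.mkN (LeafSupport.cm l)) μtop κtop).ClozelThorne2 := ⟨mokInputs_top.everything, (kmswInputs_top μtop).1.stabOrdI⟩
  ⟨cmod.2.2.1, canon_implications₁₀₉W _ _,
    ⟨⟨fun h => e.1 h.2, fun h => ⟨t, e.2 h⟩⟩, e, ⟨fun h => e.1 h.2, fun h => ⟨t, e.2 h⟩⟩, ⟨fun h => e.1 h.2, fun h => ⟨t, e.2 h⟩⟩,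
      ⟨fun h => e.1 h.2, fun h => ⟨t, e.2 h⟩⟩⟩⟩

/-- BOOK SIDE, THE OPEN LEAVES: in the book countermodel of any leaf other than the five published ones (in particular of each 2024–2026 preprint leaf and of the two unwritten
weighted fundamental lemmas) all five statements HOLD (section 47's `moeglinUnitaryDS_cm_holds`). [cite: ClozelThorne2017III, Thm 6.1; Moeglin2007Unitary, §1 (bookkeeping proved here)] -/
theorem c109_book_open_leaves (l : LeafSupport.Leaf) (h₁ : l ≠ .LLC_GLN) (h₂ : l ≠ .FL) (h₃ : l ≠ .Transfer) (h₄ : l ≠ .InvariantTF) (h₅ : l ≠ .TwistedTF) :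
    ¬ (LeafSupport.mkN (LeafSupport.cm l)).leaf l ∧
      (canon₁₀₉ (LeafSupport.mkN (LeafSupport.cm l)) μtop κtop).GKPPSsatoTateGaps ∧ (canon₁₀₉ (LeafSupport.mkN (LeafSupport.cm l)) μtop κtop).LOTeffectiveST8 ∧
      (canon₁₀₉ (LeafSupport.mkN (LeafSupport.cm l)) μtop κtop).JanuszewskiSymPadicL ∧ (canon₁₀₉ (LeafSupport.mkN (LeafSupport.cm l)) μtop κtop).ZhangSelmerTower :=
  have h := c109_book_cm l
  have e := moeglinUnitaryDS_cm_holds l h₁ h₂ h₃ h₄ h₅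
  ⟨h.1, h.2.2.1.2 e, h.2.2.2.1.2 e, h.2.2.2.2.1.2 e, h.2.2.2.2.2.2.2 e⟩

/-- BOOK SIDE, THE FIVE PUBLISHED LEAVES: in the book countermodel of LLC_GLN, FL, Transfer, InvariantTF or TwistedTF (E43's support, section 47's `moeglinUnitaryDS_cm_fails`)
all five statements FAIL. [cite: ClozelThorne2017III, Thm 6.1; Moeglin2007Unitary, §1 (bookkeeping proved here)] -/
theorem c109_book_published_leaves (l : LeafSupport.Leaf) (hl : l = .LLC_GLN ∨ l = .FL ∨ l = .Transfer ∨ l = .InvariantTF ∨ l = .TwistedTF) :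
    ¬ (canon₁₀₉ (LeafSupport.mkN (LeafSupport.cm l)) μtop κtop).GKPPSsatoTateGaps ∧ ¬ (canon₁₀₉ (LeafSupport.mkN (LeafSupport.cm l)) μtop κtop).LOTeffectiveST8 ∧
      ¬ (canon₁₀₉ (LeafSupport.mkN (LeafSupport.cm l)) μtop κtop).JanuszewskiSymPadicL ∧ ¬ (canon₁₀₉ (LeafSupport.mkN (LeafSupport.cm l)) μtop κtop).ZhangSymLayers ∧
      ¬ (canon₁₀₉ (LeafSupport.mkN (LeafSupport.cm l)) μtop κtop).ZhangSelmerTower :=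
  have h := c109_book_cm l
  have ne := (moeglinUnitaryDS_cm_fails l hl).2
  ⟨fun x => ne (h.2.2.1.1 x), fun x => ne (h.2.2.2.1.1 x), fun x => ne (h.2.2.2.2.1.1 x), fun x => ne (h.2.2.2.2.2.1.1 x), fun x => ne (h.2.2.2.2.2.2.1 x)⟩

/-- Row C29 DENIED (`ClozelThorneIII := False`; C171, C57, C34 as in `canon₆₄` at the top): a reading of `Consumers64` used only to deny Clozel – Thorne III; no tranche-64 edge is claimed for it. [cite: ClozelThorne2017III, Thm 6.1 (separating model; bookkeeping)] -/
abbrev c₆₄noCT3 : Consumers64 := { canon₆₄ νtop μtop κtop with ClozelThorneIII := False }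

/-- THE TYPED PREMISES ARE LOAD-BEARING EXACTLY AS TYPED (reading-level separation at the top): (a) ROW C29 DENIED (`c₆₄noCT3`, C177 at its top value) ⇒ all five statements FAIL;
(b) ROW C177 DENIED (section 111's `c₁₈noCT2`, C29 at its top value) ⇒ C278, C280, C281's node and theorem FAIL while C279 HOLDS (bound to part III alone, as cited).  Every
hundred-and-ninth edge holds over each denied assignment. [cite: GillmanEtAl2020SatoTatePatterns, proof of Thm 1.1 ([CT17]) and §1.1 ([CT15, CT17]); LemkeOliverThorner2019ZeroDensity, §1.3 ([ClozelThorne]); Januszewski2024RankinSelberg, §1; XZhang2021SymmetricSelmer, §4 (separating models; bookkeeping proved here)] -/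
theorem c109_rows_denied_top :
    (Implications109 (canon₁₈ νtop μtop κtop) c₆₄noCT3 (canon₁₀₉W (canon₁₈ νtop μtop κtop) c₆₄noCT3) ∧
        ¬ (canon₁₀₉W (canon₁₈ νtop μtop κtop) c₆₄noCT3).GKPPSsatoTateGaps ∧ ¬ (canon₁₀₉W (canon₁₈ νtop μtop κtop) c₆₄noCT3).LOTeffectiveST8 ∧
        ¬ (canon₁₀₉W (canon₁₈ νtop μtop κtop) c₆₄noCT3).JanuszewskiSymPadicL ∧ ¬ (canon₁₀₉W (canon₁₈ νtop μtop κtop) c₆₄noCT3).ZhangSymLayers ∧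
        ¬ (canon₁₀₉W (canon₁₈ νtop μtop κtop) c₆₄noCT3).ZhangSelmerTower) ∧
      (Implications109 c₁₈noCT2 (canon₆₄ νtop μtop κtop) (canon₁₀₉W c₁₈noCT2 (canon₆₄ νtop μtop κtop)) ∧
        ¬ (canon₁₀₉W c₁₈noCT2 (canon₆₄ νtop μtop κtop)).GKPPSsatoTateGaps ∧ (canon₁₀₉W c₁₈noCT2 (canon₆₄ νtop μtop κtop)).LOTeffectiveST8 ∧
        ¬ (canon₁₀₉W c₁₈noCT2 (canon₆₄ νtop μtop κtop)).JanuszewskiSymPadicL ∧ ¬ (canon₁₀₉W c₁₈noCT2 (canon₆₄ νtop μtop κtop)).ZhangSymLayers ∧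
        ¬ (canon₁₀₉W c₁₈noCT2 (canon₆₄ νtop μtop κtop)).ZhangSelmerTower) :=
  have t3 : (canon₆₄ νtop μtop κtop).ClozelThorneIII := sixtyfourth_holds_top.1
  ⟨⟨canon_implications₁₀₉W _ _, fun h => h.2, fun h => h, fun h => h.2, fun h => h.2, fun h => h.2⟩,
    ⟨canon_implications₁₀₉W _ _, fun h => h.1, t3, fun h => h.1, fun h => h.1, fun h => h.1⟩⟩

/-- MOK SIDE: in the Mok countermodel of ANY leaf `l` (book and KMSW at the top; tranches 18 / 64 / 109 read over it) every edge holds and ALL FIVE statements FAIL — Mok at all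
ranks is the first premise of both parts ([read: the whole paper as conditional on the results in [Mok]]; [read: our proofs rely on the work of Mok [Mok15]]). [cite: ClozelThorne2015, §1.1; ClozelThorne2017III, p0003:L39-41 (bookkeeping proved here)] -/
theorem c109_mok_cm (l : Mok2015.LeafSupport.Leaf) :
    ¬ (Mok2015.LeafSupport.mkN (Mok2015.LeafSupport.cm l)).leaf l ∧
      Implications109 (canon₁₈ νtop (Mok2015.LeafSupport.mkN (Mok2015.LeafSupport.cm l)) κtop) (canon₆₄ νtop (Mok2015.LeafSupport.mkN (Mok2015.LeafSupport.cm l)) κtop)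
        (canon₁₀₉ νtop (Mok2015.LeafSupport.mkN (Mok2015.LeafSupport.cm l)) κtop) ∧
      (¬ (canon₁₀₉ νtop (Mok2015.LeafSupport.mkN (Mok2015.LeafSupport.cm l)) κtop).GKPPSsatoTateGaps ∧ ¬ (canon₁₀₉ νtop (Mok2015.LeafSupport.mkN (Mok2015.LeafSupport.cm l)) κtop).LOTeffectiveST8 ∧
        ¬ (canon₁₀₉ νtop (Mok2015.LeafSupport.mkN (Mok2015.LeafSupport.cm l)) κtop).JanuszewskiSymPadicL ∧ ¬ (canon₁₀₉ νtop (Mok2015.LeafSupport.mkN (Mok2015.LeafSupport.cm l)) κtop).ZhangSymLayers ∧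
        ¬ (canon₁₀₉ νtop (Mok2015.LeafSupport.mkN (Mok2015.LeafSupport.cm l)) κtop).ZhangSelmerTower) :=
  have cmod := Mok2015.LeafSupport.countermodel l
  have nm := not_M_cm l
  ⟨cmod.2.2.1, canon_implications₁₀₉W _ _, ⟨fun h => nm h.1.1, fun h => nm h.1, fun h => nm h.1.1, fun h => nm h.1.1, fun h => nm h.1.1⟩⟩

/-- KMSW SIDE, TWO-SIDED: in KMSW's countermodel of ANY leaf `l'` (book and Mok at the top) every edge holds, and each of the five statements HOLDS exactly when `l'` is none of the
five premises of the inner-form stabilisation edge (`l'.stabOrdI = false` — the first file's `stabOrdI_cm_iff`, as sections 22 / 67 certified for parts II / III themselves).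
[cite: ClozelThorne2015, p0017:L12-13; ClozelThorne2017III, p0029:L44-46 (bookkeeping proved here)] [claim: KalethaMinguezShinWhite2014, under-review] -/
theorem c109_kmsw (l' : KMSW2014.LeafSupport.Leaf) :
    ¬ (KMSW2014.LeafSupport.mkN (KMSW2014.LeafSupport.cm l')).leaf l' ∧
      Implications109 (canon₁₈ νtop μtop (KMSW2014.LeafSupport.mkN (KMSW2014.LeafSupport.cm l'))) (canon₆₄ νtop μtop (KMSW2014.LeafSupport.mkN (KMSW2014.LeafSupport.cm l')))
        (canon₁₀₉ νtop μtop (KMSW2014.LeafSupport.mkN (KMSW2014.LeafSupport.cm l'))) ∧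
      (((canon₁₀₉ νtop μtop (KMSW2014.LeafSupport.mkN (KMSW2014.LeafSupport.cm l'))).GKPPSsatoTateGaps ↔ l'.stabOrdI = false) ∧
        ((canon₁₀₉ νtop μtop (KMSW2014.LeafSupport.mkN (KMSW2014.LeafSupport.cm l'))).LOTeffectiveST8 ↔ l'.stabOrdI = false) ∧
        ((canon₁₀₉ νtop μtop (KMSW2014.LeafSupport.mkN (KMSW2014.LeafSupport.cm l'))).ZhangSelmerTower ↔ l'.stabOrdI = false)) :=
  have cmod := KMSW2014.LeafSupport.countermodel l'
  have m : ∀ N, μtop.Everything N := mokInputs_top.everything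
  have c3 := (galoisII_kmsw_cm l').2.2.2.1
  have c2 : (canon₁₈ νtop μtop (KMSW2014.LeafSupport.mkN (KMSW2014.LeafSupport.cm l'))).ClozelThorne2 ↔ l'.stabOrdI = false :=
    ⟨fun h => (stabOrdI_cm_iff l').1 h.2, fun h => ⟨m, (stabOrdI_cm_iff l').2 h⟩⟩
  ⟨cmod.2.2.1, canon_implications₁₀₉W _ _,
    ⟨⟨fun h => c3.1 h.2, fun h => ⟨c2.2 h, c3.2 h⟩⟩, c3, ⟨fun h => c3.1 h.2, fun h => ⟨c2.2 h, c3.2 h⟩⟩⟩⟩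

/-- THE HUNDRED-AND-NINTH TRANCHE REGRADED, in one statement: (i) at the top all five hold; (ii) in the book countermodel of ANY leaf each statement (shown: C278's and C279's) holds
iff E43's value does — so it holds at every open leaf's countermodel and fails only at the five published leaves'; (iii) C29 denied: all fail; C177 denied: all but C279's fail;
(iv) in every Mok countermodel all fail; (v) in KMSW's leaf countermodels each holds iff the leaf is not a premise of `StabOrdI`.  Supports: Mok 29 ∪ KMSW's five `StabOrdI`
premises (FL, split and general weighted FL, Arthur's STF, transfer) for all five statements; on the book's side the five PUBLISHED leaves of E43 only — a 2020
bounded-gaps theorem inside Sato – Tate sets, a 2019 effective short-interval Sato – Tate asymptotic, a 2024 Amer. J. Math. family of symmetric-power p-adic L-functions and a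
2021 Amer. J. Math. Iwasawa-theoretic congruence theorem (under its printed functoriality assumption, supplied by Clozel – Thorne) inherit exactly parts II / III's residue: Mok's 2024–2026
preprint layer and two weighted fundamental lemmas, KMSW's general weighted fundamental lemma, and no open leaf of the book. [cite: GillmanEtAl2020SatoTatePatterns, Thms 1.1-1.2; LemkeOliverThorner2019ZeroDensity, Thm 1.8; Januszewski2024RankinSelberg, §1; XZhang2021SymmetricSelmer, Thm 4.27 (bookkeeping proved here)] [claim: KalethaMinguezShinWhite2014, under-review] -/
theorem c109_regraded :
    ((canon₁₀₉ νtop μtop κtop).GKPPSsatoTateGaps ∧ (canon₁₀₉ νtop μtop κtop).LOTeffectiveST8 ∧ (canon₁₀₉ νtop μtop κtop).JanuszewskiSymPadicL ∧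
        ((canon₁₀₉ νtop μtop κtop).ZhangSymLayers ∧ (canon₁₀₉ νtop μtop κtop).ZhangSelmerTower)) ∧
      (∀ l : LeafSupport.Leaf, ¬ (LeafSupport.mkN (LeafSupport.cm l)).leaf l ∧
        ((canon₁₀₉ (LeafSupport.mkN (LeafSupport.cm l)) μtop κtop).GKPPSsatoTateGaps ↔ (canon₄₅ (LeafSupport.mkN (LeafSupport.cm l))).MoeglinUnitaryDS) ∧
        ((canon₁₀₉ (LeafSupport.mkN (LeafSupport.cm l)) μtop κtop).LOTeffectiveST8 ↔ (canon₄₅ (LeafSupport.mkN (LeafSupport.cm l))).MoeglinUnitaryDS)) ∧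
      (¬ (canon₁₀₉W (canon₁₈ νtop μtop κtop) c₆₄noCT3).GKPPSsatoTateGaps ∧ ¬ (canon₁₀₉W (canon₁₈ νtop μtop κtop) c₆₄noCT3).LOTeffectiveST8 ∧
        ¬ (canon₁₀₉W c₁₈noCT2 (canon₆₄ νtop μtop κtop)).GKPPSsatoTateGaps ∧ (canon₁₀₉W c₁₈noCT2 (canon₆₄ νtop μtop κtop)).LOTeffectiveST8) ∧
      (∀ l : Mok2015.LeafSupport.Leaf, ¬ (Mok2015.LeafSupport.mkN (Mok2015.LeafSupport.cm l)).leaf l ∧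
        ¬ (canon₁₀₉ νtop (Mok2015.LeafSupport.mkN (Mok2015.LeafSupport.cm l)) κtop).GKPPSsatoTateGaps ∧ ¬ (canon₁₀₉ νtop (Mok2015.LeafSupport.mkN (Mok2015.LeafSupport.cm l)) κtop).LOTeffectiveST8) ∧
      (∀ l' : KMSW2014.LeafSupport.Leaf,
        ((canon₁₀₉ νtop μtop (KMSW2014.LeafSupport.mkN (KMSW2014.LeafSupport.cm l'))).GKPPSsatoTateGaps ↔ l'.stabOrdI = false) ∧
          ((canon₁₀₉ νtop μtop (KMSW2014.LeafSupport.mkN (KMSW2014.LeafSupport.cm l'))).LOTeffectiveST8 ↔ l'.stabOrdI = false)) :=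
  have d := c109_rows_denied_top
  ⟨hundredninth_holds_top,
    fun l => have h := c109_book_cm l
      ⟨h.1, h.2.2.1, h.2.2.2.1⟩,
    ⟨d.1.2.1, d.1.2.2.1, d.2.2.1, d.2.2.2.1⟩,
    fun l => have h := c109_mok_cm l
      ⟨h.1, h.2.2.1, h.2.2.2.1⟩,
    fun l' => have h := c109_kmsw l'
      ⟨h.2.2.1, h.2.2.2.1⟩⟩

/-! ## 113. Hundred-and-tenth tranche (v6 of this file, after `Downstream32.lean` v4; unit `pub-arthur-down-g43`): supports of THE NOETHER–LEFSCHETZ / BALL-QUOTIENT VEIN, II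
— C282 node `STcupProduct` with `STcentralRF` / `STbranchedCovers` and C283 `LIPexoticKernels` (⇐ C17-Acta `Consumers4.BMMball`), C284 `PetersenVanishing` and C285
`LOGpicardRank` (⇐ C99 `Consumers2.BLMM`); see the module docstring for the summary of what is certified. -/

section Canon110

variable (ν : Nodes) (μ : Mok2015.Nodes) (κ : KMSW2014.Nodes)

/-- The parametrised canonical reading of the hundred-and-tenth tranche: the assignments `c₂`, `c₄` of tranches 2 / 4 are the parameters; C282's node and two theorems and C283's theorem := the value of row C17-Acta `c₄.BMMball`; C284's and C285's theorems := the value of row C99 `c₂.BLMM`. [cite: StoverToledo2022CentralExtensions, Thms 1.2 / 1.5 / 3.3; LlosaIsenrichPy2025ExoticFiniteness, Thm 1.1; Petersen2019K3Vanishing, Thm 2.2; LazaOGrady2019QuarticK3, Thm 3.1.1 (canonical model; bookkeeping)] -/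
abbrev canon₁₁₀W (c₂ : Consumers2) (c₄ : Consumers4) : Consumers110 where
  STcupProduct := c₄.BMMball
  STcentralRF := c₄.BMMball
  STbranchedCovers := c₄.BMMball
  LIPexoticKernels := c₄.BMMball
  PetersenVanishing := c₂.BLMM
  LOGpicardRank := c₂.BLMM

/-- The canonical instance over the first support file's `canon₂` (C99 := everything the book establishes, at all ranks) and `canon₄` (C17-Acta := Mok at all ranks ∧ KMSW's node `StabOrdI`). [cite: BergeronEtAl2016, Thms 1, 5; BergeronMillsonMoeglin2013, Thm 1 ff. (canonical model; bookkeeping)] -/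
abbrev canon₁₁₀ : Consumers110 := canon₁₁₀W (canon₂ ν μ κ) (canon₄ ν μ κ)

/-- Every hundred-and-tenth-tranche edge holds in the parametrised reading, for every assignment of tranches 2 / 4. [cite: StoverToledo2022CentralExtensions, Thms 1.2 / 1.5 / 3.3; LlosaIsenrichPy2025ExoticFiniteness, Thm 1.1; Petersen2019K3Vanishing, Thm 2.2; LazaOGrady2019QuarticK3, Thm 3.1.1 (bookkeeping proved here)] -/
theorem canon_implications₁₁₀W (c₂ : Consumers2) (c₄ : Consumers4) : Implications110 c₂ c₄ (canon₁₁₀W c₂ c₄) where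
  stCup := fun h => h
  stRF := fun h => h
  stBr := fun h => h
  lip := fun h => h
  pet := fun h => h
  log := fun h => h

/-- Every edge holds in the canonical instance, for arbitrary ν, μ, κ. [cite: StoverToledo2022CentralExtensions, Thm 3.3; Petersen2019K3Vanishing, Thm 2.2 (bookkeeping proved here)] -/
theorem canon_implications₁₁₀ : Implications110 (canon₂ ν μ κ) (canon₄ ν μ κ) (canon₁₁₀ ν μ κ) :=
  canon_implications₁₁₀W _ _

/-- In the parametrised reading the four ball-quotient statements hold as soon as row C17-Acta holds and the two K3-moduli statements as soon as row C99 holds — through the tranche's own `stoverToledoLine_of_row` / `k3ModuliLine_of_row`. [cite: StoverToledo2022CentralExtensions, Thms 1.2 / 1.5 / 3.3; LlosaIsenrichPy2025ExoticFiniteness, Thm 1.1; Petersen2019K3Vanishing, Thm 2.2; LazaOGrady2019QuarticK3, Thm 3.1.1 (bookkeeping proved here)] -/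
theorem c110_all_of (c₂ : Consumers2) (c₄ : Consumers4) (h₁₇ : c₄.BMMball) (h₉₉ : c₂.BLMM) :
    ((canon₁₁₀W c₂ c₄).STcupProduct ∧ (canon₁₁₀W c₂ c₄).STcentralRF ∧ (canon₁₁₀W c₂ c₄).STbranchedCovers ∧ (canon₁₁₀W c₂ c₄).LIPexoticKernels) ∧
      ((canon₁₁₀W c₂ c₄).PetersenVanishing ∧ (canon₁₁₀W c₂ c₄).LOGpicardRank) :=
  ⟨stoverToledoLine_of_row (canon_implications₁₁₀W c₂ c₄) h₁₇, k3ModuliLine_of_row (canon_implications₁₁₀W c₂ c₄) h₉₉⟩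

end Canon110

/-- At the top (every input of the three DAGs) all six fields hold — through the tranche's own `hundredtenth_of_inputs` fed by the first support file's `canon_implications`,
`canon_implications₂`, `canon_implications₄`. [cite: StoverToledo2022CentralExtensions, Thms 1.2 / 1.5 / 3.3; LlosaIsenrichPy2025ExoticFiniteness, Thm 1.1; Petersen2019K3Vanishing, Thm 2.2; LazaOGrady2019QuarticK3, Thm 3.1.1 (bookkeeping proved here)] [claim: KalethaMinguezShinWhite2014, under-review] -/
theorem hundredtenth_holds_top :
    ((canon₁₁₀ νtop μtop κtop).STcupProduct ∧ (canon₁₁₀ νtop μtop κtop).STcentralRF ∧ (canon₁₁₀ νtop μtop κtop).STbranchedCovers ∧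
        (canon₁₁₀ νtop μtop κtop).LIPexoticKernels) ∧
      ((canon₁₁₀ νtop μtop κtop).PetersenVanishing ∧ (canon₁₁₀ νtop μtop κtop).LOGpicardRank) :=
  hundredtenth_of_inputs (canon_implications₁₁₀ νtop μtop κtop) (canon_implications νtop μtop κtop) (canon_implications₂ νtop μtop κtop)
    (canon_implications₄ νtop μtop κtop) bookInputs_top mokInputs_top (kmswInputs_top μtop).1

/-- BOOK SIDE, EXACT SUPPORT AS TYPED: in the book countermodel of ANY of the 24 leaves `l` (Mok and KMSW at the top; tranches 2 / 4 / 110 read canonically over it, every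
hundred-and-tenth edge valid) the two K3-MODULI statements FAIL (C99 := everything the book establishes — the first support file's `not_B_cm`: ALL 24 leaves are load-bearing
for C284 and C285, as for C161 / C162) while the four BALL-QUOTIENT statements HOLD (C17-Acta := Mok ∧ `StabOrdI`, both at the top: NO leaf of the book is in the support of
C282 / C283) ([read: after [bergeronlimillsonmoeglin]]; [read: Recent work of Bergeron et al. establishes that this is in fact an isomorphism]; [read: begins by using work of
Bergeron, Millson, and Moeglin [Acta]]). [cite: Petersen2019K3Vanishing, p0004:L21; LazaOGrady2019QuarticK3, p0029:L1; StoverToledo2022CentralExtensions, p0003:L27; BergeronEtAl2016, p0005:L17; BergeronMillsonMoeglin2013, p0002:L7-9 (bookkeeping proved here)] [claim: KalethaMinguezShinWhite2014, under-review] -/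
theorem c110_book_cm (l : LeafSupport.Leaf) :
    ¬ (LeafSupport.mkN (LeafSupport.cm l)).leaf l ∧
      Implications110 (canon₂ (LeafSupport.mkN (LeafSupport.cm l)) μtop κtop) (canon₄ (LeafSupport.mkN (LeafSupport.cm l)) μtop κtop)
        (canon₁₁₀ (LeafSupport.mkN (LeafSupport.cm l)) μtop κtop) ∧
      (¬ (canon₁₁₀ (LeafSupport.mkN (LeafSupport.cm l)) μtop κtop).PetersenVanishing ∧ ¬ (canon₁₁₀ (LeafSupport.mkN (LeafSupport.cm l)) μtop κtop).LOGpicardRank) ∧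
      ((canon₁₁₀ (LeafSupport.mkN (LeafSupport.cm l)) μtop κtop).STcupProduct ∧ (canon₁₁₀ (LeafSupport.mkN (LeafSupport.cm l)) μtop κtop).STcentralRF ∧
        (canon₁₁₀ (LeafSupport.mkN (LeafSupport.cm l)) μtop κtop).STbranchedCovers ∧ (canon₁₁₀ (LeafSupport.mkN (LeafSupport.cm l)) μtop κtop).LIPexoticKernels) :=
  have cmod := LeafSupport.countermodel l
  have nb := not_B_cm l
  have t : (canon₄ (LeafSupport.mkN (LeafSupport.cm l)) μtop κtop).BMMball := ⟨mokInputs_top.everything, (kmswInputs_top μtop).1.stabOrdI⟩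
  ⟨cmod.2.2.1, canon_implications₁₁₀W _ _, ⟨nb, nb⟩, ⟨t, t, t, t⟩⟩

/-- Row C17-Acta DENIED (`BMMball := False`; every other fourth-tranche field at its top value): a reading of `Consumers4` used only to deny the Acta theorems; no tranche-4 edge is claimed for it. [cite: BergeronMillsonMoeglin2013, Thm 1 ff. (separating model; bookkeeping)] -/
abbrev c₄noBMMball : Consumers4 := { canon₄ νtop μtop κtop with BMMball := False }

/-- Row C99 DENIED (`BLMM := False`; every other second-tranche field at its top value): a reading of `Consumers2` used only to deny the Noether–Lefschetz theorems; no tranche-2 edge is claimed for it. [cite: BergeronEtAl2016, Thms 1, 5 (separating model; bookkeeping)] -/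
abbrev c₂noBLMM : Consumers2 := { canon₂ νtop μtop κtop with BLMM := False }

/-- THE TYPED PREMISES ARE LOAD-BEARING EXACTLY AS TYPED (reading-level separation at the top): (a) ROW C17-Acta DENIED (`c₄noBMMball`, C99 at its top value) ⇒ C282's node and
two theorems and C283 FAIL while C284 / C285 HOLD; (b) ROW C99 DENIED (`c₂noBLMM`, C17-Acta at its top value) ⇒ C284 / C285 FAIL while the ball-quotient line HOLDS.  Every
hundred-and-tenth edge holds over each denied assignment — the two lines of the tranche are independent, as the texts have it (C282 / C283 cite the Acta paper, C284 / C285 the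
Inventiones paper; [Invent] in C282 is named for a method only). [cite: StoverToledo2022CentralExtensions, p0003:L25-27; LlosaIsenrichPy2025ExoticFiniteness, p0009:L25; Petersen2019K3Vanishing, p0004:L10; LazaOGrady2019QuarticK3, p0028:L7-8 (separating models; bookkeeping proved here)] -/
theorem c110_rows_denied_top :
    (Implications110 (canon₂ νtop μtop κtop) c₄noBMMball (canon₁₁₀W (canon₂ νtop μtop κtop) c₄noBMMball) ∧
        ¬ (canon₁₁₀W (canon₂ νtop μtop κtop) c₄noBMMball).STcupProduct ∧ ¬ (canon₁₁₀W (canon₂ νtop μtop κtop) c₄noBMMball).STcentralRF ∧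
        ¬ (canon₁₁₀W (canon₂ νtop μtop κtop) c₄noBMMball).STbranchedCovers ∧ ¬ (canon₁₁₀W (canon₂ νtop μtop κtop) c₄noBMMball).LIPexoticKernels ∧
        (canon₁₁₀W (canon₂ νtop μtop κtop) c₄noBMMball).PetersenVanishing ∧ (canon₁₁₀W (canon₂ νtop μtop κtop) c₄noBMMball).LOGpicardRank) ∧
      (Implications110 c₂noBLMM (canon₄ νtop μtop κtop) (canon₁₁₀W c₂noBLMM (canon₄ νtop μtop κtop)) ∧
        (canon₁₁₀W c₂noBLMM (canon₄ νtop μtop κtop)).STcupProduct ∧ (canon₁₁₀W c₂noBLMM (canon₄ νtop μtop κtop)).STcentralRF ∧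
        (canon₁₁₀W c₂noBLMM (canon₄ νtop μtop κtop)).STbranchedCovers ∧ (canon₁₁₀W c₂noBLMM (canon₄ νtop μtop κtop)).LIPexoticKernels ∧
        ¬ (canon₁₁₀W c₂noBLMM (canon₄ νtop μtop κtop)).PetersenVanishing ∧ ¬ (canon₁₁₀W c₂noBLMM (canon₄ νtop μtop κtop)).LOGpicardRank) :=
  have b : ∀ N, νtop.Everything N := bookInputs_top.everything
  have t : (canon₄ νtop μtop κtop).BMMball := ⟨mokInputs_top.everything, (kmswInputs_top μtop).1.stabOrdI⟩
  ⟨⟨canon_implications₁₁₀W _ _, fun h => h, fun h => h, fun h => h, fun h => h, b, b⟩,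
    ⟨canon_implications₁₁₀W _ _, t, t, t, t, fun h => h, fun h => h⟩⟩

/-- MOK SIDE: in the Mok countermodel of ANY of the 29 leaves `l` (book and KMSW at the top; tranches 2 / 4 / 110 read over it) every edge holds, the four BALL-QUOTIENT statements
FAIL (Mok at all ranks is the first premise of the Acta theorems — `not_M_cm`: all 29 Mok leaves are load-bearing for C282 / C283, as for C164) and the two K3-MODULI statements
HOLD (no Mok leaf in the support of C284 / C285 beyond what the book's own DAG records). [cite: StoverToledo2022CentralExtensions, p0010:L57; BergeronMillsonMoeglin2013, p0002:L7-9; Petersen2019K3Vanishing, Thm 2.2 (bookkeeping proved here)] -/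
theorem c110_mok_cm (l : Mok2015.LeafSupport.Leaf) :
    ¬ (Mok2015.LeafSupport.mkN (Mok2015.LeafSupport.cm l)).leaf l ∧
      Implications110 (canon₂ νtop (Mok2015.LeafSupport.mkN (Mok2015.LeafSupport.cm l)) κtop) (canon₄ νtop (Mok2015.LeafSupport.mkN (Mok2015.LeafSupport.cm l)) κtop)
        (canon₁₁₀ νtop (Mok2015.LeafSupport.mkN (Mok2015.LeafSupport.cm l)) κtop) ∧
      (¬ (canon₁₁₀ νtop (Mok2015.LeafSupport.mkN (Mok2015.LeafSupport.cm l)) κtop).STcupProduct ∧ ¬ (canon₁₁₀ νtop (Mok2015.LeafSupport.mkN (Mok2015.LeafSupport.cm l)) κtop).STcentralRF ∧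
        ¬ (canon₁₁₀ νtop (Mok2015.LeafSupport.mkN (Mok2015.LeafSupport.cm l)) κtop).STbranchedCovers ∧ ¬ (canon₁₁₀ νtop (Mok2015.LeafSupport.mkN (Mok2015.LeafSupport.cm l)) κtop).LIPexoticKernels) ∧
      ((canon₁₁₀ νtop (Mok2015.LeafSupport.mkN (Mok2015.LeafSupport.cm l)) κtop).PetersenVanishing ∧ (canon₁₁₀ νtop (Mok2015.LeafSupport.mkN (Mok2015.LeafSupport.cm l)) κtop).LOGpicardRank) :=
  have cmod := Mok2015.LeafSupport.countermodel l
  have nm := not_M_cm l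
  have b : ∀ N, νtop.Everything N := bookInputs_top.everything
  ⟨cmod.2.2.1, canon_implications₁₁₀W _ _, ⟨fun h => nm h.1, fun h => nm h.1, fun h => nm h.1, fun h => nm h.1⟩, ⟨b, b⟩⟩

/-- KMSW SIDE, TWO-SIDED: in KMSW's countermodel of ANY leaf `l'` (book and Mok at the top) every edge holds, each of the four BALL-QUOTIENT statements HOLDS exactly when `l'` is
none of the five premises of the inner-form stabilisation edge (`l'.stabOrdI = false` — the first file's `stabOrdI_cm_iff`, as `kmsw_ballLine_iff` certified for the Acta
paper and for row C164 themselves: FL, split and general weighted FL, Arthur's stabilisation, transfer — no chapter of KMSW, no sequel), and the two K3-MODULI statements HOLD.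
[cite: StoverToledo2022CentralExtensions, Thm 3.3; LlosaIsenrichPy2025ExoticFiniteness, Thm 1.1; BergeronMillsonMoeglin2013, Thm 1 ff. (bookkeeping proved here)] [claim: KalethaMinguezShinWhite2014, under-review] -/
theorem c110_kmsw (l' : KMSW2014.LeafSupport.Leaf) :
    ¬ (KMSW2014.LeafSupport.mkN (KMSW2014.LeafSupport.cm l')).leaf l' ∧
      Implications110 (canon₂ νtop μtop (KMSW2014.LeafSupport.mkN (KMSW2014.LeafSupport.cm l'))) (canon₄ νtop μtop (KMSW2014.LeafSupport.mkN (KMSW2014.LeafSupport.cm l')))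
        (canon₁₁₀ νtop μtop (KMSW2014.LeafSupport.mkN (KMSW2014.LeafSupport.cm l'))) ∧
      (((canon₁₁₀ νtop μtop (KMSW2014.LeafSupport.mkN (KMSW2014.LeafSupport.cm l'))).STcupProduct ↔ l'.stabOrdI = false) ∧
        ((canon₁₁₀ νtop μtop (KMSW2014.LeafSupport.mkN (KMSW2014.LeafSupport.cm l'))).STcentralRF ↔ l'.stabOrdI = false) ∧
        ((canon₁₁₀ νtop μtop (KMSW2014.LeafSupport.mkN (KMSW2014.LeafSupport.cm l'))).STbranchedCovers ↔ l'.stabOrdI = false) ∧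
        ((canon₁₁₀ νtop μtop (KMSW2014.LeafSupport.mkN (KMSW2014.LeafSupport.cm l'))).LIPexoticKernels ↔ l'.stabOrdI = false)) ∧
      ((canon₁₁₀ νtop μtop (KMSW2014.LeafSupport.mkN (KMSW2014.LeafSupport.cm l'))).PetersenVanishing ∧
        (canon₁₁₀ νtop μtop (KMSW2014.LeafSupport.mkN (KMSW2014.LeafSupport.cm l'))).LOGpicardRank) :=
  have cmod := KMSW2014.LeafSupport.countermodel l'
  have m : ∀ N, μtop.Everything N := mokInputs_top.everything
  have b : ∀ N, νtop.Everything N := bookInputs_top.everything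
  have e : (canon₄ νtop μtop (KMSW2014.LeafSupport.mkN (KMSW2014.LeafSupport.cm l'))).BMMball ↔ l'.stabOrdI = false :=
    ⟨fun h => (stabOrdI_cm_iff l').1 h.2, fun h => ⟨m, (stabOrdI_cm_iff l').2 h⟩⟩
  ⟨cmod.2.2.1, canon_implications₁₁₀W _ _, ⟨e, e, e, e⟩, ⟨b, b⟩⟩

/-- THE HUNDRED-AND-TENTH TRANCHE REGRADED, in one statement: (i) at the top all six hold; (ii) in the book countermodel of ANY of the 24 leaves C284 / C285 fail and C282's
Theorem 1.2 / C283's Theorem 1.1 hold; (iii) C17-Acta denied: the ball-quotient line fails and the K3-moduli line holds; C99 denied: conversely; (iv) in every Mok countermodel the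
ball-quotient line fails and the K3-moduli line holds; (v) in KMSW's leaf countermodels the ball-quotient line holds iff the leaf is not a premise of `StabOrdI`, the K3-moduli
line holds.  Supports: support(`PetersenVanishing`) = support(`LOGpicardRank`) = ALL 24 leaves of the book's DAG (through C99; the general weighted FL a second time through the
inner-form stabilisation) — a 2019 Amer. J. Math. vanishing theorem for the tautological cohomology of the moduli of K3 surfaces and a 2019 Compositio computation of Picard
ranks of the period spaces of quartic K3 surfaces inherit exactly the Inventiones paper's residue: the 2024–2026 preprint layer and the two unwritten weighted
fundamental lemmas; support(`STcupProduct`) = support(`STcentralRF`) = support(`STbranchedCovers`) = support(`LIPexoticKernels`) = Mok 29 ∪ KMSW's five `StabOrdI`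
premises ∪ AMR-unitary, NO leaf of the book — a 2022 Pure Appl. Math. Q. residual-finiteness theorem for central extensions of arithmetic lattices in PU(n,1) with its
negatively curved branched covers, and a 2025 J. Topol. family of Kähler groups with exotic finiteness properties, inherit exactly the Acta paper's residue: Mok's 2024–2026
preprint layer, Mok's general and non-standard weighted fundamental lemmas, KMSW's general weighted fundamental lemma. [cite: StoverToledo2022CentralExtensions, Thms 1.2 / 1.5 / 3.3; LlosaIsenrichPy2025ExoticFiniteness, Thm 1.1; Petersen2019K3Vanishing, Thm 2.2; LazaOGrady2019QuarticK3, Thm 3.1.1 (bookkeeping proved here)] [claim: KalethaMinguezShinWhite2014, under-review] -/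
theorem c110_regraded :
    (((canon₁₁₀ νtop μtop κtop).STcupProduct ∧ (canon₁₁₀ νtop μtop κtop).STcentralRF ∧ (canon₁₁₀ νtop μtop κtop).STbranchedCovers ∧
          (canon₁₁₀ νtop μtop κtop).LIPexoticKernels) ∧
        ((canon₁₁₀ νtop μtop κtop).PetersenVanishing ∧ (canon₁₁₀ νtop μtop κtop).LOGpicardRank)) ∧
      (∀ l : LeafSupport.Leaf, ¬ (LeafSupport.mkN (LeafSupport.cm l)).leaf l ∧
        ¬ (canon₁₁₀ (LeafSupport.mkN (LeafSupport.cm l)) μtop κtop).PetersenVanishing ∧ ¬ (canon₁₁₀ (LeafSupport.mkN (LeafSupport.cm l)) μtop κtop).LOGpicardRank ∧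
        (canon₁₁₀ (LeafSupport.mkN (LeafSupport.cm l)) μtop κtop).STcentralRF ∧ (canon₁₁₀ (LeafSupport.mkN (LeafSupport.cm l)) μtop κtop).LIPexoticKernels) ∧
      (¬ (canon₁₁₀W (canon₂ νtop μtop κtop) c₄noBMMball).STcentralRF ∧ ¬ (canon₁₁₀W (canon₂ νtop μtop κtop) c₄noBMMball).LIPexoticKernels ∧
        (canon₁₁₀W (canon₂ νtop μtop κtop) c₄noBMMball).PetersenVanishing ∧
        (canon₁₁₀W c₂noBLMM (canon₄ νtop μtop κtop)).STcentralRF ∧ ¬ (canon₁₁₀W c₂noBLMM (canon₄ νtop μtop κtop)).PetersenVanishing ∧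
        ¬ (canon₁₁₀W c₂noBLMM (canon₄ νtop μtop κtop)).LOGpicardRank) ∧
      (∀ l : Mok2015.LeafSupport.Leaf, ¬ (Mok2015.LeafSupport.mkN (Mok2015.LeafSupport.cm l)).leaf l ∧
        ¬ (canon₁₁₀ νtop (Mok2015.LeafSupport.mkN (Mok2015.LeafSupport.cm l)) κtop).STcentralRF ∧ ¬ (canon₁₁₀ νtop (Mok2015.LeafSupport.mkN (Mok2015.LeafSupport.cm l)) κtop).LIPexoticKernels ∧
        (canon₁₁₀ νtop (Mok2015.LeafSupport.mkN (Mok2015.LeafSupport.cm l)) κtop).PetersenVanishing ∧ (canon₁₁₀ νtop (Mok2015.LeafSupport.mkN (Mok2015.LeafSupport.cm l)) κtop).LOGpicardRank) ∧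
      (∀ l' : KMSW2014.LeafSupport.Leaf,
        ((canon₁₁₀ νtop μtop (KMSW2014.LeafSupport.mkN (KMSW2014.LeafSupport.cm l'))).STcentralRF ↔ l'.stabOrdI = false) ∧
          ((canon₁₁₀ νtop μtop (KMSW2014.LeafSupport.mkN (KMSW2014.LeafSupport.cm l'))).LIPexoticKernels ↔ l'.stabOrdI = false) ∧
          (canon₁₁₀ νtop μtop (KMSW2014.LeafSupport.mkN (KMSW2014.LeafSupport.cm l'))).PetersenVanishing) :=
  have d := c110_rows_denied_top
  ⟨hundredtenth_holds_top,
    fun l => have h := c110_book_cm l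
      ⟨h.1, h.2.2.1.1, h.2.2.1.2, h.2.2.2.2.1, h.2.2.2.2.2.2⟩,
    ⟨d.1.2.2.1, d.1.2.2.2.2.1, d.1.2.2.2.2.2.1, d.2.2.2.1, d.2.2.2.2.2.2.1, d.2.2.2.2.2.2.2⟩,
    fun l => have h := c110_mok_cm l
      ⟨h.1, h.2.2.1.2.1, h.2.2.1.2.2.2, h.2.2.2.1, h.2.2.2.2⟩,
    fun l' => have h := c110_kmsw l'
      ⟨h.2.2.1.2.1, h.2.2.1.2.2.2, h.2.2.2.1⟩⟩

/-! ## 114. Hundred-and-eleventh tranche (v7 of this file, after `Downstream33.lean` v1; unit `pub-arthur-down-g43`): supports of THE NOETHER–LEFSCHETZ VEIN, III — C286 node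
`BLspecialCycles` with `BLfranchetta` / `BLtautological` (⇐ C99 `Consumers2.BLMM` ∧ C17-IMRN `Consumers4.BMMorth`), C287 `LZdeligneBeilinson` (⇐ C286), C288 `DFVintegralPicard`,
C289 node `BZheegnerSpan` with `BZprimitiveLift`, C290 `BBFWnlCone` / `BBFWuniruled` (⇐ C99 ∧ C289's node), C291 `HLMYpicardOne` / `HLMYbailyBorel` (⇐ C99, C288); see the module
docstring for the summary of what is certified. -/

section Canon111

variable (ν : Nodes) (μ : Mok2015.Nodes) (κ : KMSW2014.Nodes)

/-- The parametrised canonical reading of the hundred-and-eleventh tranche: the assignments `c₂`, `c₄` of tranches 2 / 4 are the parameters; C286's node, its two theorems and C287's theorem := the value of row C99 ∧ row C17-IMRN (`c₂.BLMM ∧ c₄.BMMorth`, as the node is typed); the seven statements of C288 – C291 := the value of row C99 `c₂.BLMM` (C289's node and C288 being themselves read as C99, the chains C290 ⇐ C289 and C291 ⇐ C288 add nothing to the reading). [cite: BergeronLi2019Tautological, Thms 26-27, 32; BergeronLi2022Erratum, Thm 3; BergeronLi2023Complement, Thm 3.1; LiZhang2022DeligneBeilinson, Thm 1.0.1; DiLorenzoFringuelliVistoli2023Picard,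 Thm 2.1; BruinierZuffetti2026Lefschetz, Thm 1.2, Cor. 4.16; BarrosEtAl2026NLCones, Thm 1.1, Prop. 1.2; HuangEtAl2024BailyBorel, Thms 1.1, 1.3 (canonical model; bookkeeping)] -/
abbrev canon₁₁₁W (c₂ : Consumers2) (c₄ : Consumers4) : Consumers111 where
  BLspecialCycles := c₂.BLMM ∧ c₄.BMMorth
  BLfranchetta := c₂.BLMM ∧ c₄.BMMorth
  BLtautological := c₂.BLMM ∧ c₄.BMMorth
  LZdeligneBeilinson := c₂.BLMM ∧ c₄.BMMorth
  DFVintegralPicard := c₂.BLMM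
  BZheegnerSpan := c₂.BLMM
  BZprimitiveLift := c₂.BLMM
  BBFWnlCone := c₂.BLMM
  BBFWuniruled := c₂.BLMM
  HLMYpicardOne := c₂.BLMM
  HLMYbailyBorel := c₂.BLMM

/-- The canonical instance over the first support file's `canon₂` (C99 := everything the book establishes, at all ranks) and `canon₄` (C17-IMRN := everything the book establishes, at all ranks). [cite: BergeronEtAl2016, Thms 1, 5; BergeronMillsonMoeglin2011, §1 (canonical model; bookkeeping)] -/
abbrev canon₁₁₁ : Consumers111 := canon₁₁₁W (canon₂ ν μ κ) (canon₄ ν μ κ)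

/-- Every hundred-and-eleventh-tranche edge holds in the parametrised reading, for every assignment of tranches 2 / 4. [cite: BergeronLi2019Tautological, Thms 26-27, 32; BergeronLi2022Erratum, Thm 3; BergeronLi2023Complement, Thm 3.1; LiZhang2022DeligneBeilinson, Thm 1.0.1; DiLorenzoFringuelliVistoli2023Picard, Thm 2.1; BruinierZuffetti2026Lefschetz, Thm 1.2, Cor. 4.16; BarrosEtAl2026NLCones, Thm 1.1, Prop. 1.2; HuangEtAl2024BailyBorel, Thms 1.1, 1.3 (bookkeeping proved here)] -/
theorem canon_implications₁₁₁W (c₂ : Consumers2) (c₄ : Consumers4) : Implications111 c₂ c₄ (canon₁₁₁W c₂ c₄) where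
  blS := fun h k => ⟨h, k⟩
  blF := fun h => h
  blT := fun _ h => h
  lz := fun h _ => h
  dfv := fun h => h
  bzH := fun h => h
  bzL := fun h => h
  bbC := fun h _ => h
  bbU := fun h _ => h
  hlO := fun h => h
  hlB := fun h _ => h

/-- Every edge holds in the canonical instance, for arbitrary ν, μ, κ. [cite: BergeronLi2019Tautological, Thms 26-27; BruinierZuffetti2026Lefschetz, Cor. 4.16 (bookkeeping proved here)] -/
theorem canon_implications₁₁₁ : Implications111 (canon₂ ν μ κ) (canon₄ ν μ κ) (canon₁₁₁ ν μ κ) :=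
  canon_implications₁₁₁W _ _

/-- In the parametrised reading all eleven statements hold as soon as rows C99 and C17-IMRN hold — through the tranche's own `nlVeinIII_of_rows`. [cite: BergeronLi2019Tautological, Thms 26-27, 32; BergeronLi2022Erratum, Thm 3; BergeronLi2023Complement, Thm 3.1; LiZhang2022DeligneBeilinson, Thm 1.0.1; DiLorenzoFringuelliVistoli2023Picard, Thm 2.1; BruinierZuffetti2026Lefschetz, Thm 1.2, Cor. 4.16; BarrosEtAl2026NLCones, Thm 1.1, Prop. 1.2; HuangEtAl2024BailyBorel, Thms 1.1, 1.3 (bookkeeping proved here)] -/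
theorem c111_all_of (c₂ : Consumers2) (c₄ : Consumers4) (h₉₉ : c₂.BLMM) (h₁₇ : c₄.BMMorth) :
    ((canon₁₁₁W c₂ c₄).BLspecialCycles ∧ (canon₁₁₁W c₂ c₄).BLfranchetta ∧ (canon₁₁₁W c₂ c₄).BLtautological) ∧ (canon₁₁₁W c₂ c₄).LZdeligneBeilinson ∧ (canon₁₁₁W c₂ c₄).DFVintegralPicard ∧
        ((canon₁₁₁W c₂ c₄).BZheegnerSpan ∧ (canon₁₁₁W c₂ c₄).BZprimitiveLift) ∧ ((canon₁₁₁W c₂ c₄).BBFWnlCone ∧ (canon₁₁₁W c₂ c₄).BBFWuniruled) ∧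
        ((canon₁₁₁W c₂ c₄).HLMYpicardOne ∧ (canon₁₁₁W c₂ c₄).HLMYbailyBorel) :=
  nlVeinIII_of_rows (canon_implications₁₁₁W c₂ c₄) h₉₉ h₁₇

end Canon111

/-- At the top (every input of the three DAGs) all eleven fields hold — through the tranche's own `hundredeleventh_of_inputs` fed by the first support file's `canon_implications`,
`canon_implications₂`, `canon_implications₄` and `bookInputs_top`. [cite: BergeronLi2019Tautological, Thms 26-27, 32; BergeronLi2022Erratum, Thm 3; BergeronLi2023Complement, Thm 3.1; LiZhang2022DeligneBeilinson, Thm 1.0.1; DiLorenzoFringuelliVistoli2023Picard, Thm 2.1; BruinierZuffetti2026Lefschetz, Thm 1.2, Cor. 4.16; BarrosEtAl2026NLCones, Thm 1.1, Prop. 1.2; HuangEtAl2024BailyBorel, Thms 1.1, 1.3 (bookkeeping proved here)] [claim: KalethaMinguezShinWhite2014, under-review] -/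
theorem hundredeleventh_holds_top :
    ((canon₁₁₁ νtop μtop κtop).BLspecialCycles ∧ (canon₁₁₁ νtop μtop κtop).BLfranchetta ∧ (canon₁₁₁ νtop μtop κtop).BLtautological) ∧ (canon₁₁₁ νtop μtop κtop).LZdeligneBeilinson ∧ (canon₁₁₁ νtop μtop κtop).DFVintegralPicard ∧
        ((canon₁₁₁ νtop μtop κtop).BZheegnerSpan ∧ (canon₁₁₁ νtop μtop κtop).BZprimitiveLift) ∧ ((canon₁₁₁ νtop μtop κtop).BBFWnlCone ∧ (canon₁₁₁ νtop μtop κtop).BBFWuniruled) ∧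
        ((canon₁₁₁ νtop μtop κtop).HLMYpicardOne ∧ (canon₁₁₁ νtop μtop κtop).HLMYbailyBorel) :=
  hundredeleventh_of_inputs (canon_implications₁₁₁ νtop μtop κtop) (canon_implications νtop μtop κtop) (canon_implications₂ νtop μtop κtop)
    (canon_implications₄ νtop μtop κtop) bookInputs_top

/-- BOOK SIDE, EXACT SUPPORT AS TYPED: in the book countermodel of ANY of the 24 leaves `l` (Mok and KMSW at the top; tranches 2 / 4 / 111 read canonically over it, every
hundred-and-eleventh edge valid) ALL ELEVEN statements FAIL (C99 := everything the book establishes — the first support file's `not_B_cm`; C17-IMRN likewise): ALL 24 leaves are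
load-bearing for C286 – C291, as for C161 / C162 / C163 / C284 / C285 ([read: simply refer to [BLMM16] for the proof of Theorem]; [read: precisely the main result of [BLMM16]];
[read: according to [BL17], there exists]; [read: whose rank is known [BLMM]]; [read: the Noether–Lefschetz Conj., proved in [BLMM17]]; [read: The surjectivity is Theorem
(thm:sec2:BLMM17)]; [read: By [BLMM17], the first Chern class map induces an isomorphism]). [cite: BergeronLi2019Tautological, p0016:L35, p0016:L67; BergeronLi2022Erratum, p0006:L14-36; BergeronLi2023Complement, p0007:L27-50; LiZhang2022DeligneBeilinson, p0017:L12; DiLorenzoFringuelliVistoli2023Picard, p0007:L46; BruinierZuffetti2026Lefschetz, p0018:L67-69, p0003:L54-55; BarrosEtAl2026NLCones, p0006:L68-76, p0008:L24; HuangEtAl2024BailyBorel, p0014:L83, p0015:L24-47; BergeronEtAl2016, p0005:L17; BergeronMillsonMoeglin2011, p0003:L27-29 (bookkeeping proved here)] [claim: KalethaMinguezShinWhite2014, under-review] -/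
theorem c111_book_cm (l : LeafSupport.Leaf) :
    ¬ (LeafSupport.mkN (LeafSupport.cm l)).leaf l ∧
      Implications111 (canon₂ (LeafSupport.mkN (LeafSupport.cm l)) μtop κtop) (canon₄ (LeafSupport.mkN (LeafSupport.cm l)) μtop κtop)
        (canon₁₁₁ (LeafSupport.mkN (LeafSupport.cm l)) μtop κtop) ∧
      ((¬ (canon₁₁₁ (LeafSupport.mkN (LeafSupport.cm l)) μtop κtop).BLspecialCycles ∧ ¬ (canon₁₁₁ (LeafSupport.mkN (LeafSupport.cm l)) μtop κtop).BLfranchetta ∧ ¬ (canon₁₁₁ (LeafSupport.mkN (LeafSupport.cm l)) μtop κtop).BLtautological) ∧ ¬ (canon₁₁₁ (LeafSupport.mkN (LeafSupport.cm l)) μtop κtop).LZdeligneBeilinson ∧ ¬ (canon₁₁₁ (LeafSupport.mkN (LeafSupport.cm l)) μtop κtop).DFVintegralPicard ∧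
          (¬ (canon₁₁₁ (LeafSupport.mkN (LeafSupport.cm l)) μtop κtop).BZheegnerSpan ∧ ¬ (canon₁₁₁ (LeafSupport.mkN (LeafSupport.cm l)) μtop κtop).BZprimitiveLift) ∧ (¬ (canon₁₁₁ (LeafSupport.mkN (LeafSupport.cm l)) μtop κtop).BBFWnlCone ∧ ¬ (canon₁₁₁ (LeafSupport.mkN (LeafSupport.cm l)) μtop κtop).BBFWuniruled) ∧
          (¬ (canon₁₁₁ (LeafSupport.mkN (LeafSupport.cm l)) μtop κtop).HLMYpicardOne ∧ ¬ (canon₁₁₁ (LeafSupport.mkN (LeafSupport.cm l)) μtop κtop).HLMYbailyBorel)) :=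
  have cmod := LeafSupport.countermodel l
  have nb := not_B_cm l
  ⟨cmod.2.2.1, canon_implications₁₁₁W _ _, ⟨fun h => nb h.1, fun h => nb h.1, fun h => nb h.1⟩, fun h => nb h.1, nb, ⟨nb, nb⟩, ⟨nb, nb⟩, ⟨nb, nb⟩⟩

/-- Row C17-IMRN DENIED (`BMMorth := False`; every other fourth-tranche field at its top value): a reading of `Consumers4` used only to deny the IMRN Hodge-type theorems; no tranche-4 edge is claimed for it. [cite: BergeronMillsonMoeglin2011, §1 (separating model; bookkeeping)] -/
abbrev c₄noBMMorth : Consumers4 := { canon₄ νtop μtop κtop with BMMorth := False }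

/-- THE TYPED PREMISES ARE LOAD-BEARING EXACTLY AS TYPED (reading-level separation at the top): (a) ROW C17-IMRN DENIED (`c₄noBMMorth`, C99 at its top value) ⇒ C286's node,
its two theorems and C287 FAIL (the node is typed from C99 ∧ C17-IMRN: [read: It follows from [BMM16, Theorem 1.10 and §8.13] …]) while the seven statements of C288 – C291
HOLD (their texts cite the Inventiones paper only); (b) ROW C99 DENIED (section 113's `c₂noBLMM`, C17-IMRN at its top value) ⇒ ALL ELEVEN FAIL.  Every hundred-and-eleventh
edge holds over each denied assignment. [cite: BergeronLi2019Tautological, p0016:L67; DiLorenzoFringuelliVistoli2023Picard, p0007:L46; BruinierZuffetti2026Lefschetz, p0018:L67-69; BarrosEtAl2026NLCones, p0008:L24; HuangEtAl2024BailyBorel, p0014:L83 (separating models; bookkeeping proved here)] -/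
theorem c111_rows_denied_top :
    (Implications111 (canon₂ νtop μtop κtop) c₄noBMMorth (canon₁₁₁W (canon₂ νtop μtop κtop) c₄noBMMorth) ∧
        (¬ (canon₁₁₁W (canon₂ νtop μtop κtop) c₄noBMMorth).BLspecialCycles ∧ ¬ (canon₁₁₁W (canon₂ νtop μtop κtop) c₄noBMMorth).BLfranchetta ∧ ¬ (canon₁₁₁W (canon₂ νtop μtop κtop) c₄noBMMorth).BLtautological ∧
          ¬ (canon₁₁₁W (canon₂ νtop μtop κtop) c₄noBMMorth).LZdeligneBeilinson) ∧
        ((canon₁₁₁W (canon₂ νtop μtop κtop) c₄noBMMorth).DFVintegralPicard ∧ (canon₁₁₁W (canon₂ νtop μtop κtop) c₄noBMMorth).BZheegnerSpan ∧ (canon₁₁₁W (canon₂ νtop μtop κtop) c₄noBMMorth).BZprimitiveLift ∧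
          (canon₁₁₁W (canon₂ νtop μtop κtop) c₄noBMMorth).BBFWnlCone ∧ (canon₁₁₁W (canon₂ νtop μtop κtop) c₄noBMMorth).BBFWuniruled ∧ (canon₁₁₁W (canon₂ νtop μtop κtop) c₄noBMMorth).HLMYpicardOne ∧
          (canon₁₁₁W (canon₂ νtop μtop κtop) c₄noBMMorth).HLMYbailyBorel)) ∧
      (Implications111 c₂noBLMM (canon₄ νtop μtop κtop) (canon₁₁₁W c₂noBLMM (canon₄ νtop μtop κtop)) ∧
        ((¬ (canon₁₁₁W c₂noBLMM (canon₄ νtop μtop κtop)).BLspecialCycles ∧ ¬ (canon₁₁₁W c₂noBLMM (canon₄ νtop μtop κtop)).BLfranchetta ∧ ¬ (canon₁₁₁W c₂noBLMM (canon₄ νtop μtop κtop)).BLtautological) ∧ ¬ (canon₁₁₁W c₂noBLMM (canon₄ νtop μtop κtop)).LZdeligneBeilinson ∧ ¬ (canon₁₁₁W c₂noBLMM (canon₄ νtop μtop κtop)).DFVintegralPicard ∧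
          (¬ (canon₁₁₁W c₂noBLMM (canon₄ νtop μtop κtop)).BZheegnerSpan ∧ ¬ (canon₁₁₁W c₂noBLMM (canon₄ νtop μtop κtop)).BZprimitiveLift) ∧ (¬ (canon₁₁₁W c₂noBLMM (canon₄ νtop μtop κtop)).BBFWnlCone ∧ ¬ (canon₁₁₁W c₂noBLMM (canon₄ νtop μtop κtop)).BBFWuniruled) ∧
          (¬ (canon₁₁₁W c₂noBLMM (canon₄ νtop μtop κtop)).HLMYpicardOne ∧ ¬ (canon₁₁₁W c₂noBLMM (canon₄ νtop μtop κtop)).HLMYbailyBorel))) :=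
  have b : ∀ N, νtop.Everything N := bookInputs_top.everything
  ⟨⟨canon_implications₁₁₁W _ _, ⟨fun h => h.2, fun h => h.2, fun h => h.2, fun h => h.2⟩, ⟨b, b, b, b, b, b, b⟩⟩,
    ⟨canon_implications₁₁₁W _ _, ⟨fun h => h.1, fun h => h.1, fun h => h.1⟩, fun h => h.1, fun h => h, ⟨fun h => h, fun h => h⟩, ⟨fun h => h, fun h => h⟩,
      ⟨fun h => h, fun h => h⟩⟩⟩

/-- MOK SIDE: in the Mok countermodel of ANY of the 29 leaves `l` (book and KMSW at the top; tranches 2 / 4 / 111 read over it) every edge holds and ALL ELEVEN statements HOLD —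
no Mok leaf is in the support of C286 – C291 beyond what the book's own DAG records (the inner-form stabilisation's premises, inside `BookInputs`). [cite: BergeronLi2019Tautological, Thms 26-27, 32; BergeronLi2022Erratum, Thm 3; BergeronLi2023Complement, Thm 3.1; LiZhang2022DeligneBeilinson, Thm 1.0.1; DiLorenzoFringuelliVistoli2023Picard, Thm 2.1; BruinierZuffetti2026Lefschetz, Thm 1.2, Cor. 4.16; BarrosEtAl2026NLCones, Thm 1.1, Prop. 1.2; HuangEtAl2024BailyBorel, Thms 1.1, 1.3 (bookkeeping proved here)] -/
theorem c111_mok_cm (l : Mok2015.LeafSupport.Leaf) :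
    ¬ (Mok2015.LeafSupport.mkN (Mok2015.LeafSupport.cm l)).leaf l ∧
      Implications111 (canon₂ νtop (Mok2015.LeafSupport.mkN (Mok2015.LeafSupport.cm l)) κtop) (canon₄ νtop (Mok2015.LeafSupport.mkN (Mok2015.LeafSupport.cm l)) κtop)
        (canon₁₁₁ νtop (Mok2015.LeafSupport.mkN (Mok2015.LeafSupport.cm l)) κtop) ∧
      (((canon₁₁₁ νtop (Mok2015.LeafSupport.mkN (Mok2015.LeafSupport.cm l)) κtop).BLspecialCycles ∧ (canon₁₁₁ νtop (Mok2015.LeafSupport.mkN (Mok2015.LeafSupport.cm l)) κtop).BLfranchetta ∧ (canon₁₁₁ νtop (Mok2015.LeafSupport.mkN (Mok2015.LeafSupport.cm l)) κtop).BLtautological) ∧ (canon₁₁₁ νtop (Mok2015.LeafSupport.mkN (Mok2015.LeafSupport.cm l)) κtop).LZdeligneBeilinson ∧ (canon₁₁₁ νtop (Mok2015.LeafSupport.mkN (Mok2015.LeafSupport.cm l)) κtop).DFVintegralPicard ∧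
          ((canon₁₁₁ νtop (Mok2015.LeafSupport.mkN (Mok2015.LeafSupport.cm l)) κtop).BZheegnerSpan ∧ (canon₁₁₁ νtop (Mok2015.LeafSupport.mkN (Mok2015.LeafSupport.cm l)) κtop).BZprimitiveLift) ∧ ((canon₁₁₁ νtop (Mok2015.LeafSupport.mkN (Mok2015.LeafSupport.cm l)) κtop).BBFWnlCone ∧ (canon₁₁₁ νtop (Mok2015.LeafSupport.mkN (Mok2015.LeafSupport.cm l)) κtop).BBFWuniruled) ∧
          ((canon₁₁₁ νtop (Mok2015.LeafSupport.mkN (Mok2015.LeafSupport.cm l)) κtop).HLMYpicardOne ∧ (canon₁₁₁ νtop (Mok2015.LeafSupport.mkN (Mok2015.LeafSupport.cm l)) κtop).HLMYbailyBorel)) :=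
  have cmod := Mok2015.LeafSupport.countermodel l
  have b : ∀ N, νtop.Everything N := bookInputs_top.everything
  ⟨cmod.2.2.1, canon_implications₁₁₁W _ _,
    c111_all_of (canon₂ νtop (Mok2015.LeafSupport.mkN (Mok2015.LeafSupport.cm l)) κtop) (canon₄ νtop (Mok2015.LeafSupport.mkN (Mok2015.LeafSupport.cm l)) κtop) b b⟩

/-- KMSW SIDE: in KMSW's countermodel of ANY leaf `l'` (book and Mok at the top) every edge holds and ALL ELEVEN statements HOLD — no KMSW leaf is in the support of C286 – C291
beyond the book's own record of the inner-form stabilisation. [cite: BergeronLi2019Tautological, Thms 26-27, 32; BergeronLi2022Erratum, Thm 3; BergeronLi2023Complement, Thm 3.1; LiZhang2022DeligneBeilinson, Thm 1.0.1; DiLorenzoFringuelliVistoli2023Picard, Thm 2.1; BruinierZuffetti2026Lefschetz, Thm 1.2, Cor. 4.16; BarrosEtAl2026NLCones, Thm 1.1, Prop. 1.2; HuangEtAl2024BailyBorel, Thms 1.1, 1.3 (bookkeeping proved here)] [claim: KalethaMinguezShinWhite2014, under-review] -/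
theorem c111_kmsw (l' : KMSW2014.LeafSupport.Leaf) :
    ¬ (KMSW2014.LeafSupport.mkN (KMSW2014.LeafSupport.cm l')).leaf l' ∧
      Implications111 (canon₂ νtop μtop (KMSW2014.LeafSupport.mkN (KMSW2014.LeafSupport.cm l'))) (canon₄ νtop μtop (KMSW2014.LeafSupport.mkN (KMSW2014.LeafSupport.cm l')))
        (canon₁₁₁ νtop μtop (KMSW2014.LeafSupport.mkN (KMSW2014.LeafSupport.cm l'))) ∧
      (((canon₁₁₁ νtop μtop (KMSW2014.LeafSupport.mkN (KMSW2014.LeafSupport.cm l'))).BLspecialCycles ∧ (canon₁₁₁ νtop μtop (KMSW2014.LeafSupport.mkN (KMSW2014.LeafSupport.cm l'))).BLfranchetta ∧ (canon₁₁₁ νtop μtop (KMSW2014.LeafSupport.mkN (KMSW2014.LeafSupport.cm l'))).BLtautological) ∧ (canon₁₁₁ νtop μtop (KMSW2014.LeafSupport.mkN (KMSW2014.LeafSupport.cm l'))).LZdeligneBeilinson ∧ (canon₁₁₁ νtop μtop (KMSW2014.LeafSupport.mkN (KMSW2014.LeafSupport.cm l'))).DFVintegralPicard ∧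
          ((canon₁₁₁ νtop μtop (KMSW2014.LeafSupport.mkN (KMSW2014.LeafSupport.cm l'))).BZheegnerSpan ∧ (canon₁₁₁ νtop μtop (KMSW2014.LeafSupport.mkN (KMSW2014.LeafSupport.cm l'))).BZprimitiveLift) ∧ ((canon₁₁₁ νtop μtop (KMSW2014.LeafSupport.mkN (KMSW2014.LeafSupport.cm l'))).BBFWnlCone ∧ (canon₁₁₁ νtop μtop (KMSW2014.LeafSupport.mkN (KMSW2014.LeafSupport.cm l'))).BBFWuniruled) ∧
          ((canon₁₁₁ νtop μtop (KMSW2014.LeafSupport.mkN (KMSW2014.LeafSupport.cm l'))).HLMYpicardOne ∧ (canon₁₁₁ νtop μtop (KMSW2014.LeafSupport.mkN (KMSW2014.LeafSupport.cm l'))).HLMYbailyBorel)) :=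
  have cmod := KMSW2014.LeafSupport.countermodel l'
  have b : ∀ N, νtop.Everything N := bookInputs_top.everything
  ⟨cmod.2.2.1, canon_implications₁₁₁W _ _,
    c111_all_of (canon₂ νtop μtop (KMSW2014.LeafSupport.mkN (KMSW2014.LeafSupport.cm l'))) (canon₄ νtop μtop (KMSW2014.LeafSupport.mkN (KMSW2014.LeafSupport.cm l'))) b b⟩

/-- THE HUNDRED-AND-ELEVENTH TRANCHE REGRADED, in one statement: (i) at the top all eleven hold; (ii) in the book countermodel of ANY of the 24 leaves all eleven fail; (iii)
C17-IMRN denied: C286's theorems and C287 fail while C288, C289's Theorem 1.2, C290 and C291's Theorem 1.1 hold; C99 denied: all eleven fail; (iv) in every Mok countermodel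
and (v) in every KMSW leaf countermodel all eleven hold.  Supports: support(`BLfranchetta`) = support(`BLtautological`) = support(`LZdeligneBeilinson`) = support(`DFVintegralPicard`)
= support(`BZprimitiveLift`) = support(`BBFWnlCone`) = support(`BBFWuniruled`) = support(`HLMYpicardOne`) = support(`HLMYbailyBorel`) (and of the two nodes) = ALL 24 leaves of
the book's DAG (through C99, the general weighted FL a second time through the inner-form stabilisation; for C286 / C287 also through C17-IMRN, same leaves) and NO Mok / KMSW
leaf beyond it — a Duke theorem on tautological classes of hyper-Kähler moduli with its generalized Franchetta theorem (2019; the tautological statement as corrected in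
the arXiv Erratum 2021 = Ann. Fac. Sci. Toulouse Math. (6) 32 (2023) 839–854, Thm 3.1, the Duke Erratum 171 (2022) 243–245 being the notice), its Deligne – Beilinson refinement
(Forum Math. Sigma 2022), the integral Picard groups of the moduli of polarized K3 surfaces (Bull. LMS 2024), the Lefschetz decomposition and primitivity of the Kudla –
Millson lift (Proc. LMS 2026), the Noether – Lefschetz and Heegner cones with the uniruledness of OG6- and Kum_n-type moduli (Math. Ann. 2026) and the Picard group of the
Baily – Borel compactification of F_g (preprint 2024 / 2025) inherit exactly the Inventiones paper's residue: the 2024–2026 preprint layer and the two unwritten weighted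
fundamental lemmas. [cite: BergeronLi2019Tautological, Thms 26-27, 32; BergeronLi2022Erratum, Thm 3; BergeronLi2023Complement, Thm 3.1; LiZhang2022DeligneBeilinson, Thm 1.0.1; DiLorenzoFringuelliVistoli2023Picard, Thm 2.1; BruinierZuffetti2026Lefschetz, Thm 1.2, Cor. 4.16; BarrosEtAl2026NLCones, Thm 1.1, Prop. 1.2; HuangEtAl2024BailyBorel, Thms 1.1, 1.3 (bookkeeping proved here)] [claim: KalethaMinguezShinWhite2014, under-review] -/
theorem c111_regraded :
    (((canon₁₁₁ νtop μtop κtop).BLspecialCycles ∧ (canon₁₁₁ νtop μtop κtop).BLfranchetta ∧ (canon₁₁₁ νtop μtop κtop).BLtautological) ∧ (canon₁₁₁ νtop μtop κtop).LZdeligneBeilinson ∧ (canon₁₁₁ νtop μtop κtop).DFVintegralPicard ∧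
      ((canon₁₁₁ νtop μtop κtop).BZheegnerSpan ∧ (canon₁₁₁ νtop μtop κtop).BZprimitiveLift) ∧ ((canon₁₁₁ νtop μtop κtop).BBFWnlCone ∧ (canon₁₁₁ νtop μtop κtop).BBFWuniruled) ∧
      ((canon₁₁₁ νtop μtop κtop).HLMYpicardOne ∧ (canon₁₁₁ νtop μtop κtop).HLMYbailyBorel)) ∧
      (∀ l : LeafSupport.Leaf, ¬ (LeafSupport.mkN (LeafSupport.cm l)).leaf l ∧
        ((¬ (canon₁₁₁ (LeafSupport.mkN (LeafSupport.cm l)) μtop κtop).BLspecialCycles ∧ ¬ (canon₁₁₁ (LeafSupport.mkN (LeafSupport.cm l)) μtop κtop).BLfranchetta ∧ ¬ (canon₁₁₁ (LeafSupport.mkN (LeafSupport.cm l)) μtop κtop).BLtautological) ∧ ¬ (canon₁₁₁ (LeafSupport.mkN (LeafSupport.cm l)) μtop κtop).LZdeligneBeilinson ∧ ¬ (canon₁₁₁ (LeafSupport.mkN (LeafSupport.cm l)) μtop κtop).DFVintegralPicard ∧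
          (¬ (canon₁₁₁ (LeafSupport.mkN (LeafSupport.cm l)) μtop κtop).BZheegnerSpan ∧ ¬ (canon₁₁₁ (LeafSupport.mkN (LeafSupport.cm l)) μtop κtop).BZprimitiveLift) ∧ (¬ (canon₁₁₁ (LeafSupport.mkN (LeafSupport.cm l)) μtop κtop).BBFWnlCone ∧ ¬ (canon₁₁₁ (LeafSupport.mkN (LeafSupport.cm l)) μtop κtop).BBFWuniruled) ∧
          (¬ (canon₁₁₁ (LeafSupport.mkN (LeafSupport.cm l)) μtop κtop).HLMYpicardOne ∧ ¬ (canon₁₁₁ (LeafSupport.mkN (LeafSupport.cm l)) μtop κtop).HLMYbailyBorel))) ∧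
      ((¬ (canon₁₁₁W (canon₂ νtop μtop κtop) c₄noBMMorth).BLfranchetta ∧ ¬ (canon₁₁₁W (canon₂ νtop μtop κtop) c₄noBMMorth).BLtautological ∧
          ¬ (canon₁₁₁W (canon₂ νtop μtop κtop) c₄noBMMorth).LZdeligneBeilinson) ∧
        ((canon₁₁₁W (canon₂ νtop μtop κtop) c₄noBMMorth).DFVintegralPicard ∧ (canon₁₁₁W (canon₂ νtop μtop κtop) c₄noBMMorth).BZprimitiveLift ∧
          (canon₁₁₁W (canon₂ νtop μtop κtop) c₄noBMMorth).BBFWnlCone ∧ (canon₁₁₁W (canon₂ νtop μtop κtop) c₄noBMMorth).BBFWuniruled ∧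
          (canon₁₁₁W (canon₂ νtop μtop κtop) c₄noBMMorth).HLMYbailyBorel) ∧
        ((¬ (canon₁₁₁W c₂noBLMM (canon₄ νtop μtop κtop)).BLspecialCycles ∧ ¬ (canon₁₁₁W c₂noBLMM (canon₄ νtop μtop κtop)).BLfranchetta ∧ ¬ (canon₁₁₁W c₂noBLMM (canon₄ νtop μtop κtop)).BLtautological) ∧ ¬ (canon₁₁₁W c₂noBLMM (canon₄ νtop μtop κtop)).LZdeligneBeilinson ∧ ¬ (canon₁₁₁W c₂noBLMM (canon₄ νtop μtop κtop)).DFVintegralPicard ∧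
          (¬ (canon₁₁₁W c₂noBLMM (canon₄ νtop μtop κtop)).BZheegnerSpan ∧ ¬ (canon₁₁₁W c₂noBLMM (canon₄ νtop μtop κtop)).BZprimitiveLift) ∧ (¬ (canon₁₁₁W c₂noBLMM (canon₄ νtop μtop κtop)).BBFWnlCone ∧ ¬ (canon₁₁₁W c₂noBLMM (canon₄ νtop μtop κtop)).BBFWuniruled) ∧
          (¬ (canon₁₁₁W c₂noBLMM (canon₄ νtop μtop κtop)).HLMYpicardOne ∧ ¬ (canon₁₁₁W c₂noBLMM (canon₄ νtop μtop κtop)).HLMYbailyBorel))) ∧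
      (∀ l : Mok2015.LeafSupport.Leaf, ¬ (Mok2015.LeafSupport.mkN (Mok2015.LeafSupport.cm l)).leaf l ∧
        (((canon₁₁₁ νtop (Mok2015.LeafSupport.mkN (Mok2015.LeafSupport.cm l)) κtop).BLspecialCycles ∧ (canon₁₁₁ νtop (Mok2015.LeafSupport.mkN (Mok2015.LeafSupport.cm l)) κtop).BLfranchetta ∧ (canon₁₁₁ νtop (Mok2015.LeafSupport.mkN (Mok2015.LeafSupport.cm l)) κtop).BLtautological) ∧ (canon₁₁₁ νtop (Mok2015.LeafSupport.mkN (Mok2015.LeafSupport.cm l)) κtop).LZdeligneBeilinson ∧ (canon₁₁₁ νtop (Mok2015.LeafSupport.mkN (Mok2015.LeafSupport.cm l)) κtop).DFVintegralPicard ∧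
          ((canon₁₁₁ νtop (Mok2015.LeafSupport.mkN (Mok2015.LeafSupport.cm l)) κtop).BZheegnerSpan ∧ (canon₁₁₁ νtop (Mok2015.LeafSupport.mkN (Mok2015.LeafSupport.cm l)) κtop).BZprimitiveLift) ∧ ((canon₁₁₁ νtop (Mok2015.LeafSupport.mkN (Mok2015.LeafSupport.cm l)) κtop).BBFWnlCone ∧ (canon₁₁₁ νtop (Mok2015.LeafSupport.mkN (Mok2015.LeafSupport.cm l)) κtop).BBFWuniruled) ∧
          ((canon₁₁₁ νtop (Mok2015.LeafSupport.mkN (Mok2015.LeafSupport.cm l)) κtop).HLMYpicardOne ∧ (canon₁₁₁ νtop (Mok2015.LeafSupport.mkN (Mok2015.LeafSupport.cm l)) κtop).HLMYbailyBorel))) ∧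
      (∀ l' : KMSW2014.LeafSupport.Leaf, ¬ (KMSW2014.LeafSupport.mkN (KMSW2014.LeafSupport.cm l')).leaf l' ∧
        (((canon₁₁₁ νtop μtop (KMSW2014.LeafSupport.mkN (KMSW2014.LeafSupport.cm l'))).BLspecialCycles ∧ (canon₁₁₁ νtop μtop (KMSW2014.LeafSupport.mkN (KMSW2014.LeafSupport.cm l'))).BLfranchetta ∧ (canon₁₁₁ νtop μtop (KMSW2014.LeafSupport.mkN (KMSW2014.LeafSupport.cm l'))).BLtautological) ∧ (canon₁₁₁ νtop μtop (KMSW2014.LeafSupport.mkN (KMSW2014.LeafSupport.cm l'))).LZdeligneBeilinson ∧ (canon₁₁₁ νtop μtop (KMSW2014.LeafSupport.mkN (KMSW2014.LeafSupport.cm l'))).DFVintegralPicard ∧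
          ((canon₁₁₁ νtop μtop (KMSW2014.LeafSupport.mkN (KMSW2014.LeafSupport.cm l'))).BZheegnerSpan ∧ (canon₁₁₁ νtop μtop (KMSW2014.LeafSupport.mkN (KMSW2014.LeafSupport.cm l'))).BZprimitiveLift) ∧ ((canon₁₁₁ νtop μtop (KMSW2014.LeafSupport.mkN (KMSW2014.LeafSupport.cm l'))).BBFWnlCone ∧ (canon₁₁₁ νtop μtop (KMSW2014.LeafSupport.mkN (KMSW2014.LeafSupport.cm l'))).BBFWuniruled) ∧
          ((canon₁₁₁ νtop μtop (KMSW2014.LeafSupport.mkN (KMSW2014.LeafSupport.cm l'))).HLMYpicardOne ∧ (canon₁₁₁ νtop μtop (KMSW2014.LeafSupport.mkN (KMSW2014.LeafSupport.cm l'))).HLMYbailyBorel))) :=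
  have d := c111_rows_denied_top
  ⟨hundredeleventh_holds_top,
    fun l => have h := c111_book_cm l
      ⟨h.1, h.2.2⟩,
    ⟨⟨d.1.2.1.2.1, d.1.2.1.2.2.1, d.1.2.1.2.2.2⟩, ⟨d.1.2.2.1, d.1.2.2.2.2.1, d.1.2.2.2.2.2.1, d.1.2.2.2.2.2.2.1, d.1.2.2.2.2.2.2.2.2⟩, d.2.2⟩,
    fun l => have h := c111_mok_cm l
      ⟨h.1, h.2.2⟩,
    fun l' => have h := c111_kmsw l'
      ⟨h.1, h.2.2⟩⟩

end Support

end Downstream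

end Literature.NumberTheory.Automorphic.Arthur2013
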